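import Summits.Langlands.Langlands.Theorems.PhantomRMYoshidaResiduallyYoshidaLiftingSplit
import Summits.Langlands.Langlands.Theorems.PhantomRMYoshidaResiduallyYoshidaLiftingRibetNonsplitLattice
import Summits.Langlands.Langlands.Theorems.PhantomRMYoshidaResiduallyYoshidaLiftingKlingenDensityCornerVacuous
import Summits.Langlands.Langlands.Theorems.PhantomRMYoshidaResiduallyYoshidaLiftingRelSplit
import Summits.Langlands.Langlands.Theorems.PhantomRMYoshidaResiduallyYoshidaLiftingAnchorOfSameClass
import Summits.Langlands.Langlands.Theorems.PhantomRMYoshidaResiduallyYoshidaLiftingNoStableLine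
import Summits.Langlands.Langlands.Theorems.PhantomRMYoshidaResiduallyYoshidaLiftingNoStableCovector
import Summits.Langlands.Langlands.Theorems.PhantomRMYoshidaResiduallyYoshidaLiftingStablePlaneSaturation
import Summits.Langlands.Langlands.Theorems.PhantomRMYoshidaResiduallyYoshidaLiftingResidualPlaneOrientation
import Summits.Langlands.Langlands.Theorems.PhantomRMYoshidaResiduallyYoshidaLiftingSymplecticBlockDichotomy
import Summits.Langlands.Langlands.Theorems.PhantomRMYoshidaResiduallyYoshidaLiftingTwistOfDualCharpoly
import Summits.Langlands.Langlands.Theorems.PhantomRMYoshidaResiduallyYoshidaLiftingIrreducibleOfNoStableSubspace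
import Summits.Langlands.Langlands.Theorems.PhantomRMYoshidaResiduallyYoshidaLiftingReducibleRealiserOrientation
import Summits.Langlands.Langlands.Theorems.PhantomRMYoshidaResiduallyYoshidaLiftingBlockTriangularCharpolyReduction
import Summits.Langlands.Langlands.Theorems.PhantomRMYoshidaResiduallyYoshidaLiftingLagrangianQuotientCharpoly
import Summits.Langlands.Langlands.Theorems.PhantomRMYoshidaResiduallyYoshidaLiftingGreenbergPlane
import Summits.Langlands.Langlands.Theorems.PhantomRMYoshidaResiduallyYoshidaLiftingGreenbergCocycleCore
import Summits.Langlands.Langlands.Theorems.PhantomRMYoshidaResiduallyYoshidaLiftingNoStablePlaneSymplectic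
import Summits.Langlands.Langlands.Theorems.PhantomRMYoshidaResiduallyYoshidaLiftingRealisedCocycleGreenberg
import Summits.Langlands.Langlands.Theorems.PhantomRMYoshidaResiduallyYoshidaLiftingSymplecticRealiserIrreducible
import Summits.Langlands.Langlands.Theorems.PhantomRMYoshidaResiduallyYoshidaLiftingRealisedCocycleLocallyConstant
import Summits.Langlands.Langlands.Theorems.PhantomRMYoshidaResiduallyYoshidaLiftingRealisedClassSelmer
import Summits.Langlands.Langlands.Theorems.PhantomRMYoshidaResiduallyYoshidaLiftingSelmerAnchorRelOfRankOne
import Summits.Langlands.Langlands.Theorems.PhantomRMYoshidaResiduallyYoshidaLiftingAdjugateDualCocycle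
import Summits.Langlands.Langlands.Theorems.PhantomRMYoshidaResiduallyYoshidaLiftingDualFrameRealisation
import Summits.Langlands.Langlands.Theorems.PhantomRMYoshidaResiduallyYoshidaLiftingNonsplitNotSymplectic
import Summits.Langlands.Langlands.Theorems.PhantomRMYoshidaResiduallyYoshidaLiftingResidualGramForm
import Summits.Langlands.Langlands.Theorems.PhantomRMYoshidaResiduallyYoshidaLiftingResidualGramRadical
import Summits.Langlands.Langlands.Theorems.PhantomRMYoshidaResiduallyYoshidaLiftingGreenbergStablePlane
import Summits.Langlands.Langlands.Theorems.PhantomRMYoshidaResiduallyYoshidaLiftingBergerKlosinCriterion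
import Summits.Langlands.Langlands.Theorems.PhantomRMYoshidaResiduallyYoshidaLiftingRealisedClassSelmerDec
import Summits.Langlands.Langlands.Theorems.PhantomRMYoshidaResiduallyYoshidaLiftingRealisedClassesDual
import Summits.Langlands.Langlands.Theorems.PhantomRMYoshidaResiduallyYoshidaLiftingSelmerAnchorRelOfRankOneDec
import Summits.Langlands.Langlands.Theorems.PhantomRMYoshidaResiduallyYoshidaLiftingResidualConstancyOfRankOne
import Summits.Langlands.Langlands.Theorems.PhantomRMYoshidaResiduallyYoshidaLiftingFirstOrderReducibility
import Summits.Langlands.Langlands.Theorems.PhantomRMYoshidaResiduallyYoshidaLiftingInertiaFixedInOrdinaryPlane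
import Summits.Langlands.Langlands.Theorems.PhantomRMYoshidaResiduallyYoshidaLiftingGreenbergLinesDistinguished
import Summits.Langlands.Langlands.Theorems.PhantomRMYoshidaResiduallyYoshidaLiftingInnerTwistDihedral
import Summits.Langlands.Langlands.Theorems.PhantomRMYoshidaResiduallyYoshidaLiftingGreenbergDecIntrinsic
import Summits.Langlands.Langlands.Theorems.PhantomRMYoshidaResiduallyYoshidaLiftingGreenbergSelmerDefs
import Summits.Langlands.Langlands.Theorems.PhantomRMYoshidaResiduallyYoshidaLiftingGreenbergSelmerVocabulary
import Summits.Langlands.Langlands.Theorems.PhantomRMYoshidaResiduallyYoshidaLiftingFirstOrderCupObstruction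
import Summits.Langlands.Langlands.Theorems.PhantomRMYoshidaResiduallyYoshidaLiftingSelmerClassResiduallyOrdinary
import Summits.Langlands.Langlands.Theorems.PhantomRMYoshidaResiduallyYoshidaLiftingAdjugateDualGreenbergSelmer
import Summits.Langlands.Langlands.Theorems.PhantomRMYoshidaResiduallyYoshidaLiftingInnerTwistResidual
import Summits.Langlands.Langlands.Theorems.PhantomRMYoshidaResiduallyYoshidaLiftingRankOneReduction
import Summits.Langlands.Langlands.Theorems.PhantomRMYoshidaResiduallyYoshidaLiftingRamifiedClassTameRelation
import Summits.Langlands.Langlands.Theorems.PhantomRMYoshidaResiduallyYoshidaLiftingCrossRatioOfTameEigen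
import Summits.Langlands.Langlands.Theorems.PhantomRMYoshidaResiduallyYoshidaLiftingGreenbergDecOfOrdinaryFrame
import Summits.Langlands.Langlands.Theorems.PhantomRMYoshidaResiduallyYoshidaLiftingSelmerClassUnramifiedOffCross
import HarnessLib

/-!
# Line `sector-klingen-split` — crux `ResiduallyYoshidaLifting` (stmt-Langlands-13639) — skeleton rev 16c (lead c5-0)

rev 16c (lead c5-0, 2026-08-17T18:1xZ): + LR3 `stub_selmerClassUnramifiedOffCross` (assembly of LR + LR2) LANDED p171949 and entered by name.

rev 16b (lead c5-0, end of cycle 4, 2026-08-17T18:0xZ): ALL SIX rev-16 sub-goals LANDED and entered by name — KV2'+RR+KV4 p171661 (lead), LR2 p171699,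
LR p171801, RS2 p171862; wiring theorem `relKlingenDensityGeneric_onRankOne` (the propagation stub ALONE gives the relative generic
child on rank-one fibres); sorries = the 5 open-in-print stubs.

rev 16 (lead c5-0, cycle 4, 2026-08-17T17:2xZ): NEW registered sub-goals KV2' `stub_anchorRealises_of_rankLeOne`, RR `stub_rankOneReduction`
(the rank-one reduction: the anchor stub is eliminated on the Berger–Klosin sub-sector), LR `stub_ramifiedClassTameRelation`, LR2
`stub_crossRatioOfTameEigen` (auxiliary ramification of Selmer classes sits on ×-type level-raising places), RS2 `stub_greenbergDecOfOrdinaryFrame`,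
KV4 `stub_isRealisedThrough_dual`.

rev 15b (lead c5-0, end of cycle 3, 2026-08-17T17:5xZ): ALL NINE rev-15 sub-goals LANDED and entered by name — KV1–KV3 p171111, TL2 p171170,
RS p171290, D4+D6 p171476, W2+W3 p171544; sorries = the 5 open-in-print stubs.

rev 15 (lead c5-0, cycle 3, 2026-08-17T16:5xZ): the Greenberg–Selmer VOCABULARY landed (Theorems/…GreenbergSelmerDefs.lean, p170860:
`IsRealisedThrough` / `IsCoboundaryFor` / `IsGreenbergDecAt` / `IsGreenbergSelmerCocycle` / `GreenbergSelmerRankLeOne`); NEW registered sub-goals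
KV1–KV3 (K3⁺/K2⁺/RC over the vocabulary), TL2 `stub_firstOrderCupObstruction`, RS `stub_selmerClassResiduallyOrdinary`, D4
`stub_adjugateDualGreenbergSelmer`, D6 `stub_rankLeOne_symm`, W2 `stub_innerTwistResidualShadow`, W3 `stub_innerTwistOffGeneric`.

rev 14b (lead c5-0, end of cycle 2, 2026-08-17T16:4xZ): ALL SIX rev-14 sub-goals LANDED and entered by name — RC p170002, TL p170078, PD-a p170254,
PD-b p170642, W p170739, GL p170787; sorries = the 5 open-in-print stubs.

rev 14 (lead c5-0, cycle 2, 2026-08-17T16:0xZ): NEW registered sub-goals RC `stub_residualConstancyOfRankOne`, TL `stub_firstOrderReducibility`,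
PD-a `stub_inertiaFixedInOrdinaryPlane`, PD-b `stub_greenbergLinesDistinguished`, W `stub_innerTwistDihedral`, GL `stub_greenbergDecIntrinsic`
(section "Rev 14" below); the 5 open-in-print stubs untouched.

rev 13c (lead c5-0, 2026-08-17T15:5xZ, end of cycle 1): ALL TEN rev-13 sub-goals LANDED and entered by name — D2 p164728, D1 p165620,
G1 p166285, G2 p166592, BK p166795, N1⁺ p168218, K3⁺ p168375, G3 p169050, D3 p169383, K2⁺ p169418 (K2⁺ reshaped with `let`-abbreviations to
fit the registry's 4000-char cap); wiring `selmerAnchorRel_of_rankOneDec`; sorries = exactly the 5 open-in-print stubs again.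

rev 13 (lead prover-line-stmt-Langlands-13639-c5-0, 2026-08-17T14:0xZ): the five OPEN-IN-PRINT stubs of rev 6/12 are kept verbatim and un-waved;
NEW registered sub-goals (section "Rev 13" below) = THE SYMPLECTIC STRUCTURE OF THE REALISED CLASS: adjugate duality of orientations
(D2 `stub_adjugateDualCocycle`, D1 `stub_dualFrameRealisation`, D3 `stub_realisedClassesDual`), the residual Gram form of a symplectic
realiser (G1 `stub_nonsplitNotSymplectic`, G2 `stub_residualGramForm`, G3 `stub_residualGramRadical`: radical = the `σ̄`-plane), the
DECOMPOSITION-GROUP Greenberg condition (N1⁺ `stub_greenbergStablePlane`, K3⁺ `stub_realisedClassSelmerDec`, K2⁺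
`stub_selmerAnchorRel_of_rankOneDec`), and the Berger–Klosin commutative-algebra criterion (`stub_bergerKlosinCriterion`).
`ResiduallyYoshidaLifting_of` unchanged (rev 6).

rev 12 (lead c4-0, end of cycle 2): K1 (p160312), K3 (p160559), K2 (p161389) LANDED and entered by name; `selmerAnchorRel_of_rankOne` records the
wiring K2 ⇒ R1c-rel under a uniform rank-one hypothesis; sorries = exactly the 5 open-in-print stubs.  Seat total: 18 files landed.

rev 11 (lead c4-0, cycle 2 of the seat): new registered sub-goals K1 `stub_realisedCocycleLocallyConstant`, K3 `stub_realisedClassSelmer`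
(R1(b) complete: the realised class of an `Sh`-point is a Greenberg–Selmer cocycle), and K2 `stub_selmerAnchorRel_of_rankOne` (THE ANCHOR
DISCHARGED ON SELMER-RANK-ONE DATA, composed here from R1a + K3 + p148691, kernel-checked modulo K3).

rev 10 (lead c4-0, 2026-08-17T12:5xZ, after wave 3): T8-plane `stub_noStablePlaneSymplectic` (p158301) and N1 `stub_realisedCocycleGreenberg`
(p157554) LANDED and entered by name; T8 `stub_symplecticRealiserIrreducible` LANDED (p158782,
Theorems/…SymplecticRealiserIrreducible.lean — the kernel-checked composition that was written here in rev 9 — and entered by name); every rev-7/8 sub-goal is closed: sorries = exactly the 5 open-in-print stubs again.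

rev 9 (lead c4-0, 2026-08-17T11:5xZ, after wave 2): N2 `stub_reducibleRealiserOrientation` (p156627), T8b (p156235), T8c (p156378), N1a
`stub_greenbergPlane` (p156275), N1-core `stub_greenbergCocycleCore` (p156377) LANDED and entered by name; open sub-goals: T8-plane, N1 (wave 3), T8 (lead).

rev 8 (lead c4-0, 2026-08-17T11:2xZ, after wave 1): the seven wave-1 cores T2–T7, T9 are LANDED (p155019 p155075 p155220 p155179
p155154 p155337 p155087) and enter BY NAME (`Fibre.stub_…`); new registered sub-goals: T8b/T8c (charpoly bookkeeping), T8-plane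
(`stub_noStablePlaneSymplectic`, the Siegel/endoscopic half of T8), and N1 = the Greenberg condition of the realised cocycle at `p`
(N1a port of the disprover's `exists_greenbergPlane`, N1-core residual linear algebra, N1 assembly `stub_realisedCocycleGreenberg`).

rev 7 (lead prover-line-stmt-Langlands-13639-c4-0, 2026-08-17T10:3xZ): the five OPEN-IN-PRINT stubs of rev 6 are kept verbatim and
un-waved; NEW registered sub-goals T2–T9/N2 = the REDUCIBLE LOCUS OF THE REALISATION FIBRE (section below: no stable line /
hyperplane, stable-plane saturation over `ℤ̄_p`, orientation rigidity = design note N2, symplectic block dichotomy, Brauer–Nesbitt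
twist step, and the assembly `stub_symplecticRealiserIrreducible`: every symplectic realiser of a non-trivial class on a non-twist
fibre is irreducible).  `ResiduallyYoshidaLifting_of` unchanged (rev 6).

## History (rev 6 header, lead c3-0)

Crux strategist planner-cstrat-stmt-Langlands-13639-p1-0 (wall-breaker gen 1, 2026-08-17); OWNED by lead
prover-line-stmt-Langlands-13639-c2-0 since 2026-08-17T02:15Z.

rev 1 (= the strategist's skeleton): three stubs = the three prepared sub-cruxes `KlingenDensityGeneric` /
`KlingenLimitClassicality` / `KlingenDensityCorner`; composition `ResiduallyYoshidaLifting_of`.  The glue is LANDED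
(p137929, `Theorems/…Split.lean`: the three statements now live in the tree under `…SectorSplit`, with
`ResiduallyYoshidaLifting_of_subs` and `phantomRMSector_iff_subs`), so this file imports it instead of restating.

rev 6 (this file, lead c3-0, 2026-08-17T10:0xZ, after wave 2): the skeleton is made RELATIVE — re-based on the strategist s1's
anchored split glue `ResiduallyYoshidaLifting_of_relSubs` (RelSplit.lean, landed by this lead as Theorems/…RelSplit.lean): the anchor stub
becomes R1c-rel (rev-5 R1c-K + the crux's hypothesis `∃ ρ₀` automorphic irreducible `Sh`-point; PROVED on cyclic fibres from the landed
p148691 `stub_selmerAnchorKlingen_of_cyclic` / `stub_anchorOfSameClass`: `ρ₀` anchors every class projectively equal to `[B_{ρ₀}]`), the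
corners keep `ρ₀` (3a-rel, 3b-rel), compositions conclude `RelKlingenDensityGeneric` / `RelKlingenDensityCorner`; wave-2 landings
p148691, p148821 (`stub_twistCornerQuadratic`: the twist corner is a non-trivial QUADRATIC twist), p149860 (`stub_realiserMultiplierResidual`:
the multiplier of any symplectic realiser is residually forced to `det σ̄′`).  Open registered stubs: R1c-rel, R1d-rel, KL2, 3a-rel, 3b-rel — every density stub anchored (≤ the CRUX); KL2 ≤ the target;
so the skeleton exceeds the crux by exactly KL2 (`relSubs_iff`).

rev 5 (lead c3-0, 2026-08-17T08:09Z, after wave 1): (i) R1c/R1d RESHAPED to their Klingen-family forms R1c-K /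
R1d-K (anchor of Klingen shape `(0,0,c,c)`, `c ≡ 1 mod p-1` — wave-1 verdict on R1d: a regular anchor names the Borel
engine whose output is a REGULAR limit, exceeding the target by T8; both K-forms are ≤ the route target, ρ itself with
`c = 1`); (ii) the corner stub CUT into its two genuine sub-corners `stub_cornerThreeRel` (`p = 3`) and `stub_cornerTwistRel`
(`p ≥ 5`, twist pair), composed through the LANDED vacuity theorem p146293 (wave-1 worker: for `p ≥ 5` an `Sh`-point forces
absolute irreducibility of both constituents on `Γ_{ℚ(ζ_p)}`, so the two cyclotomic clauses of `GenericSector` are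
automatic); (iii) wave-1 landings: p145853 `stub_realisedCocycleUnramified` (R1(b) bookkeeping), p145852 / p145873 (old
R1c / R1d ≤ target), p144771 + (pending) `stub_noDecomposableRealiser` (census F3(i): no Yoshida-type point in the
realisation fibre of a non-trivial class), p146293 (corner vacuity).  Open registered stubs: R1c-K, R1d-K, KL2, corner-3,
corner-twist — all ≤ the route target, all OPEN IN PRINT.

rev 4 (lead c3-0, 2026-08-17T06:24Z): = rev 3a with R1a imported BY NAME (`Ribet.stub_ribetNonsplitLattice`, p142340) and
`ResiduallyYoshidaLifting_of` taking exactly the four OPEN registered stubs; sub-goals registered this cycle for supports: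
`stub_residualCommutantNonsplit` (residual Schur, p144771), `stub_noDecomposableRealiser` (census F3(i): no Yoshida-type point in
the realisation fibre of a non-trivial class), `stub_realisedCocycleUnramified` (R1(b) Selmer bookkeeping, unramified part).

rev 3a (lead c2-0):
STUB 1 `stub_klingenDensityGeneric` RESHAPED along census §7 R1 (the non-split-lattice /
Skinner–Wiles geometry, the strategist's recommended first idea for the generic child), into
  (R1a) `stub_ribetNonsplitLattice` — Ribet's non-split residual lattice over `ℤ̄_p` for irreducible `Sh`-points:
        PROVED AND LANDED by this lead (…RibetCongruence p138335 · …RibetDescent p138334 · …RibetLift p139389 · …RibetIterate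
        p139390 · …RibetTransport p139847 · …RibetCore p141475 · …RibetNonsplitLattice p142340; new mathematics: a direct proof
        over the NON-discrete valuation ring `ℤ̄_p`, no Krasner/Baire); companions LANDED: realisation depends only on the
        projective class (…RibetRealisation p140957), the realised class is UNIQUE up to `k^×`·coboundary
        (…RibetClassUniqueResidual p141805 · …RibetClassUnique p142701) — every irreducible `Sh`-point has an invariant `[B_ρ] ∈ ℙH¹`;
  (R1c) `stub_selmerAnchorRel` — every non-trivial residual class `[B] ∈ H¹(ℚ, Hom(σ̄′,σ̄))` realised by an irreducible
        `Sh`-point of a generic fibre is realised by an AUTOMORPHIC irreducible point of the ORDINARY FAMILY — symplectic,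
        Greenberg-ordinary and residually distinguished of SOME shape `a ≡ (0,0,1,1) mod (p-1)` (any weight of the Hida
        congruence class, regular weights included; rev 3 weakening of rev 2's weight-(2,2) `Sh ρ₁`: this is where
        Böcherer–Dummigan–Schulze-Pillot-type Yoshida congruences in LARGE weight live; still OPEN as typed — a Λ-adic
        converse-Ribet / level raising for the prescribed class, census §7 R1(c));
  (R1d) `stub_nonsplitPropagationRel` — pro-automorphy PROPAGATES inside a non-trivial residual class along the ordinary
        family: an irreducible `Sh`-point realising a class that an automorphic ordinary point (any weight) also realises is
        a Klingen classical limit (OPEN — the `GSp₄` transplant of Skinner–Wiles nice-prime patching on `Spec R^{ord}(ρ̄_c)`,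
        weight-independent, census §7 R1(d));
with the kernel-checked composition `klingenDensityGeneric_of_R1 : R1a → R1c → R1d → KlingenDensityGeneric`.
"`ρ` REALISES the cocycle `B`" is spelled inline (an `ℤ̄_p`-integral frame of `ρ` whose reduction through `red` is
`GL₄(k)`-conjugate to `(σ, B; 0, σ′)`); realisation is insensitive to coboundary changes of `B` (conjugate the
frame by a lift of the unipotent), so no quotient by coboundaries is needed — kernel-checked in Theorems/…RibetRealisation
(p140957: realisation depends only on `k^× · [B]`); by Theorems/…RibetClassUnique{Residual,} the realised class of a given
`r` is UNIQUE up to `k^×` and coboundaries, so every irreducible `Sh`-point `ρ` has a well-defined invariant `[B_ρ] ∈ ℙH¹`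
and R1c / R1d are statements about the fibres of `ρ ↦ [B_ρ]`.  (R1b) "the realised class is `Sh`-Selmer" is folded
into R1c/R1d's hypotheses (`Sh ρ` is carried, not a Selmer condition on `B`).

Stubs 2, 3 unchanged (`stub_klingenLimitClassicality`, `stub_klingenDensityCorner`).  `ResiduallyYoshidaLifting_of`
concludes the crux BY NAME from the five registered stubs R1a, R1c, R1d, 2, 3 (the glue is the landed p137929).

Honest status: R1c, R1d, stub 2, stub 3 are OPEN IN PRINT (census §1/§7); the line is alive as a decomposition whose
provable parts are landed.  Disproof used: as rev 1 (T17(d) ρ₀ idle; T8 exactness; T6a corner isolated; T12: the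
non-split lattices here are non-unimodular, consistent with "reducible = split" for unimodular ones; T4(a) residual
hypotheses carried in every stub).
-/

noncomputable section

set_option linter.dupNamespace false
set_option autoImplicit false

open IsDedekindDomain Filter
open scoped Matrix
open Literature.NumberTheory.GaloisRepresentations Literature.NumberTheory.Automorphic
open Summit.Langlands.Langlands.Cruxes.ResiduallyYoshidaLifting.YoshidaDivisorSelmerCount
open Summit.Langlands.Langlands.Cruxes.ResiduallyYoshidaLifting.SectorSplit
open Summit.Langlands.Langlands.Cruxes.ResiduallyYoshidaLifting.RelSectorSplit

namespace Summit.Langlands.Langlands.Cruxes.ResiduallyYoshidaLifting.SectorKlingenSplit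

/-! ## Stub 1, reshaped along R1 -/

/-- **STUB R1a `stub_ribetNonsplitLattice`** (registered 2026-08-17T02:09Z) — **PROVED AND LANDED** as
`Ribet.stub_ribetNonsplitLattice` (Theorems/…RibetNonsplitLattice.lean, p142340, over …RibetCongruence p138335 · …RibetDescent
p138334 · …RibetLift p139389 · …RibetIterate p139390 · …RibetTransport p139847 · …RibetCore p141475): Ribet's non-split residual
lattice over `ℤ̄_p` for an irreducible `r` whose a.e. Frobenius polynomials reduce to `charpoly σ̄ · charpoly σ̄'`; the residual
conjugator `h` is necessary (`red` need not be surjective).  Rev 4 (lead c3-0): imported BY NAME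
(`:= Ribet.stub_ribetNonsplitLattice`), so the skeleton's sorries are exactly the four OPEN registered stubs R1c, R1d, 2, 3. -/
theorem stub_ribetNonsplitLattice :
    ∀ (p : ℕ) [Fact p.Prime] (k : Type) [Field k] [CharP k p] [IsAlgClosed k]
      [TopologicalSpace k] [DiscreteTopology k] (red : Valued.integer (PadicAlgCl p) →+* k)
      (σ σ' : FramedGaloisRep ℚ k 2) (r : FramedGaloisRep ℚ (PadicAlgCl p) 4),
      σ.toGaloisRep.IsIrreducible → σ'.toGaloisRep.IsIrreducible →
      (¬ ∃ g : GL (Fin 2) k, ∀ x, g * σ x * g⁻¹ = σ' x) →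
      r.toGaloisRep.IsIrreducible →
      (∀ᶠ v : HeightOneSpectrum (NumberField.RingOfIntegers ℚ) in Filter.cofinite,
        r.IsUnramifiedAt v ∧ σ.IsUnramifiedAt v ∧ σ'.IsUnramifiedAt v ∧
        ∃ (P : Polynomial (Valued.integer (PadicAlgCl p))) (P₁ P₂ : Polynomial k),
          r.HasFrobCharpolyAt v (P.map (Valued.integer (PadicAlgCl p)).subtype) ∧
          σ.HasFrobCharpolyAt v P₁ ∧ σ'.HasFrobCharpolyAt v P₂ ∧ P.map red = P₁ * P₂) →
      ∃ (P : GL (Fin 4) (PadicAlgCl p))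
        (rint : Field.absoluteGaloisGroup ℚ →* GL (Fin 4) (Valued.integer (PadicAlgCl p)))
        (h : GL (Fin 4) k) (B : Field.absoluteGaloisGroup ℚ → Matrix (Fin 2) (Fin 2) k),
        (∀ g, Matrix.GeneralLinearGroup.map (Valued.integer (PadicAlgCl p)).subtype (rint g) = P⁻¹ * r g * P) ∧
        (∀ g, (Matrix.GeneralLinearGroup.map red (rint g)).val =
          h.val * Matrix.reindex finSumFinEquiv finSumFinEquiv
            (Matrix.fromBlocks (σ g).val (B g) 0 (σ' g).val) * (h⁻¹).val) ∧
        ¬ ∃ X : Matrix (Fin 2) (Fin 2) k, ∀ g, B g = (σ g).val * X - X * (σ' g).val :=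
  Ribet.stub_ribetNonsplitLattice

/-- **STUB R1c-rel `stub_selmerAnchorRel`** (OPEN off the anchor's class; Λ-adic converse-Ribet / level raising at the Yoshida point
in the KLINGEN family ON A FIBRE CARRYING AN AUTOMORPHIC `Sh`-POINT, census §7 R1(c); rev 6 = rev 5's R1c-K plus the crux's
relative hypothesis `∃ ρ₀` automorphic irreducible `Sh`-point — proved on cyclic fibres, `selmerAnchorRel_of_cyclic`): on a generic admissible fibre, a residual cocycle `B` that is NOT a coboundary and
is realised by SOME irreducible `Sh`-point is realised by an AUTOMORPHIC irreducible point of the Klingen-ordinary family —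
symplectic (some multiplier; residually forced to `ε̄⁻¹`, wave-1 dossier §2(a)), Greenberg-ordinary and residually
distinguished at `p` of the partial-weight-2 shape `(0, 0, c, c)`, `c ≡ 1 (mod p-1)` (Siegel weight `(c+1, 2)`; `c = 1`, a
weight-(2,2) automorphic realiser, allowed).  Rev 5 change (wave-1 worker verdict on R1d, dossier
`StubNonsplitPropagation-dossier.md` §2(b)): a REGULAR anchor lives on the 2-variable Borel family, whose Skinner–Wiles output
is a REGULAR limit (`IsOrdinaryClassicalLimit`, line A's currency, which exceeds the route target by T8); the engine-faithful
anchor for a KLINGEN limit is a Klingen-shape point.  The rev-3/4 regular form stays registered (inactive) with its landed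
≤-target lemma p145852. -/
theorem stub_selmerAnchorRel :
    ∀ (p : ℕ) [Fact p.Prime], p ≠ 2 → ∀ (k : Type) [Field k] [CharP k p] [IsAlgClosed k]
    [TopologicalSpace k] [DiscreteTopology k] (red : Valued.integer (PadicAlgCl p) →+* k)
    (σ σ' : FramedGaloisRep ℚ k 2) (hcpt : isCompact_glFiniteIntegralLevel 4 ℚ) (ι : PadicAlgCl p ≃+* ℂ)
    (B : Field.absoluteGaloisGroup ℚ → Matrix (Fin 2) (Fin 2) k),
    σ.toGaloisRep.IsIrreducible → σ'.toGaloisRep.IsIrreducible → DetC p k σ σ' →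
    (¬ ∃ g : GL (Fin 2) k, ∀ x, g * σ x * g⁻¹ = σ' x) → GenericSector p k σ σ' →
    (∃ ρ₀ : FramedGaloisRep ℚ (PadicAlgCl p) 4, ρ₀.toGaloisRep.IsIrreducible ∧ Sh p k red σ σ' ρ₀ ∧ Aut p hcpt ι ρ₀) →
    (¬ ∃ X : Matrix (Fin 2) (Fin 2) k, ∀ g, B g = (σ g).val * X - X * (σ' g).val) →
    (∃ ρ : FramedGaloisRep ℚ (PadicAlgCl p) 4, ρ.toGaloisRep.IsIrreducible ∧ Sh p k red σ σ' ρ ∧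
      ∃ (P : GL (Fin 4) (PadicAlgCl p))
        (rint : Field.absoluteGaloisGroup ℚ →* GL (Fin 4) (Valued.integer (PadicAlgCl p))) (h : GL (Fin 4) k),
        (∀ g, Matrix.GeneralLinearGroup.map (Valued.integer (PadicAlgCl p)).subtype (rint g) = P⁻¹ * ρ g * P) ∧
        (∀ g, (Matrix.GeneralLinearGroup.map red (rint g)).val =
          h.val * Matrix.reindex finSumFinEquiv finSumFinEquiv
            (Matrix.fromBlocks (σ g).val (B g) 0 (σ' g).val) * (h⁻¹).val)) →
    ∃ ρ₁ : FramedGaloisRep ℚ (PadicAlgCl p) 4, ρ₁.toGaloisRep.IsIrreducible ∧ Aut p hcpt ι ρ₁ ∧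
      (∃ c : ℕ, (c : ZMod (p - 1)) = 1 ∧
        (∃ ν : Field.absoluteGaloisGroup ℚ → PadicAlgCl p, ρ₁.IsSymplecticWithMultiplierFun ν) ∧
        ∀ v : HeightOneSpectrum (NumberField.RingOfIntegers ℚ), ((p : ℕ) : NumberField.RingOfIntegers ℚ) ∈ v.asIdeal →
          ρ₁.IsGreenbergOrdinaryOfShapeAt v ![0, 0, c, c] ∧ ρ₁.IsResiduallyDistinguishedAt v ![0, 0, c, c]) ∧
      ∃ (P : GL (Fin 4) (PadicAlgCl p))
        (rint : Field.absoluteGaloisGroup ℚ →* GL (Fin 4) (Valued.integer (PadicAlgCl p))) (h : GL (Fin 4) k),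
        (∀ g, Matrix.GeneralLinearGroup.map (Valued.integer (PadicAlgCl p)).subtype (rint g) = P⁻¹ * ρ₁ g * P) ∧
        (∀ g, (Matrix.GeneralLinearGroup.map red (rint g)).val =
          h.val * Matrix.reindex finSumFinEquiv finSumFinEquiv
            (Matrix.fromBlocks (σ g).val (B g) 0 (σ' g).val) * (h⁻¹).val) := by
  sorry

/-- **STUB R1d-rel `stub_nonsplitPropagationRel`** (OPEN; = rev-5 R1d-K plus the crux's hypothesis `∃ ρ₀` — anchored, hence
≤ the CRUX; pro-automorphy propagates inside a non-trivial residual class along the KLINGEN-ordinary family — the `GSp₄` transplant of Skinner–Wiles nice-prime patching on `Spec R^{Kli-ord}(ρ̄_B)`, census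
§7 R1(d); rev 5): on a generic admissible fibre, an irreducible `Sh`-point realising a NON-trivial residual class that is also
realised by an automorphic irreducible point of Klingen shape `(0,0,c,c)`, `c ≡ 1 (mod p-1)`, is a Klingen classical limit.
Open content (wave-1 dossier §2(e), §4): `NonsplitOrdinaryConnectivity(ρ̄_B)` — components of the non-split ordinary
deformation space linked through primes with irreducible `ρ mod Q` (SW99 Prop. 4.1 step two, hypothesis (G): here the
Selmer-divisor codimension EQUALS the connectivity codimension over every totally real base) + `GSp₄` TW patching at nice
characteristic-`p` primes. -/
theorem stub_nonsplitPropagationRel :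
    ∀ (p : ℕ) [Fact p.Prime], p ≠ 2 → ∀ (k : Type) [Field k] [CharP k p] [IsAlgClosed k]
    [TopologicalSpace k] [DiscreteTopology k] (red : Valued.integer (PadicAlgCl p) →+* k)
    (σ σ' : FramedGaloisRep ℚ k 2) (hcpt : isCompact_glFiniteIntegralLevel 4 ℚ) (ι : PadicAlgCl p ≃+* ℂ)
    (ρ : FramedGaloisRep ℚ (PadicAlgCl p) 4) (B : Field.absoluteGaloisGroup ℚ → Matrix (Fin 2) (Fin 2) k),
    σ.toGaloisRep.IsIrreducible → σ'.toGaloisRep.IsIrreducible → DetC p k σ σ' →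
    (¬ ∃ g : GL (Fin 2) k, ∀ x, g * σ x * g⁻¹ = σ' x) → GenericSector p k σ σ' →
    (∃ ρ₀ : FramedGaloisRep ℚ (PadicAlgCl p) 4, ρ₀.toGaloisRep.IsIrreducible ∧ Sh p k red σ σ' ρ₀ ∧ Aut p hcpt ι ρ₀) →
    (¬ ∃ X : Matrix (Fin 2) (Fin 2) k, ∀ g, B g = (σ g).val * X - X * (σ' g).val) →
    ρ.toGaloisRep.IsIrreducible → Sh p k red σ σ' ρ →
    (∃ (P : GL (Fin 4) (PadicAlgCl p))
        (rint : Field.absoluteGaloisGroup ℚ →* GL (Fin 4) (Valued.integer (PadicAlgCl p))) (h : GL (Fin 4) k),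
        (∀ g, Matrix.GeneralLinearGroup.map (Valued.integer (PadicAlgCl p)).subtype (rint g) = P⁻¹ * ρ g * P) ∧
        (∀ g, (Matrix.GeneralLinearGroup.map red (rint g)).val =
          h.val * Matrix.reindex finSumFinEquiv finSumFinEquiv
            (Matrix.fromBlocks (σ g).val (B g) 0 (σ' g).val) * (h⁻¹).val)) →
    (∃ ρ₁ : FramedGaloisRep ℚ (PadicAlgCl p) 4, ρ₁.toGaloisRep.IsIrreducible ∧ Aut p hcpt ι ρ₁ ∧
      (∃ c : ℕ, (c : ZMod (p - 1)) = 1 ∧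
        (∃ ν : Field.absoluteGaloisGroup ℚ → PadicAlgCl p, ρ₁.IsSymplecticWithMultiplierFun ν) ∧
        ∀ v : HeightOneSpectrum (NumberField.RingOfIntegers ℚ), ((p : ℕ) : NumberField.RingOfIntegers ℚ) ∈ v.asIdeal →
          ρ₁.IsGreenbergOrdinaryOfShapeAt v ![0, 0, c, c] ∧ ρ₁.IsResiduallyDistinguishedAt v ![0, 0, c, c]) ∧
      ∃ (P : GL (Fin 4) (PadicAlgCl p))
        (rint : Field.absoluteGaloisGroup ℚ →* GL (Fin 4) (Valued.integer (PadicAlgCl p))) (h : GL (Fin 4) k),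
        (∀ g, Matrix.GeneralLinearGroup.map (Valued.integer (PadicAlgCl p)).subtype (rint g) = P⁻¹ * ρ₁ g * P) ∧
        (∀ g, (Matrix.GeneralLinearGroup.map red (rint g)).val =
          h.val * Matrix.reindex finSumFinEquiv finSumFinEquiv
            (Matrix.fromBlocks (σ g).val (B g) 0 (σ' g).val) * (h⁻¹).val)) →
    IsKlingenClassicalLimit p hcpt ι ρ := by
  sorry

/-- **Relative sub-crux 1 from R1a + R1c-rel + R1d-rel** (kernel-checked composition, rev 6): on a generic fibre carrying an
automorphic irreducible `Sh`-point `ρ₀`, every irreducible `Sh`-point is a Klingen classical limit.  Given `ρ`, Ribet (R1a, fed by the a.e. Frobenius clause of `Sh ρ`) produces a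
non-trivial class `B` realised by `ρ`; the anchor (R1c-K) an automorphic Klingen-shape `ρ₁` realising `B`; propagation
(R1d-K) concludes.  (The anchor's handle is an automorphic point of the Klingen family, any `c ≡ 1 mod p-1`, rev 5.) -/
theorem relKlingenDensityGeneric_of_R1
    (hR : ∀ (p : ℕ) [Fact p.Prime] (k : Type) [Field k] [CharP k p] [IsAlgClosed k]
      [TopologicalSpace k] [DiscreteTopology k] (red : Valued.integer (PadicAlgCl p) →+* k)
      (σ σ' : FramedGaloisRep ℚ k 2) (r : FramedGaloisRep ℚ (PadicAlgCl p) 4),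
      σ.toGaloisRep.IsIrreducible → σ'.toGaloisRep.IsIrreducible →
      (¬ ∃ g : GL (Fin 2) k, ∀ x, g * σ x * g⁻¹ = σ' x) →
      r.toGaloisRep.IsIrreducible →
      (∀ᶠ v : HeightOneSpectrum (NumberField.RingOfIntegers ℚ) in Filter.cofinite,
        r.IsUnramifiedAt v ∧ σ.IsUnramifiedAt v ∧ σ'.IsUnramifiedAt v ∧
        ∃ (P : Polynomial (Valued.integer (PadicAlgCl p))) (P₁ P₂ : Polynomial k),
          r.HasFrobCharpolyAt v (P.map (Valued.integer (PadicAlgCl p)).subtype) ∧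
          σ.HasFrobCharpolyAt v P₁ ∧ σ'.HasFrobCharpolyAt v P₂ ∧ P.map red = P₁ * P₂) →
      ∃ (P : GL (Fin 4) (PadicAlgCl p))
        (rint : Field.absoluteGaloisGroup ℚ →* GL (Fin 4) (Valued.integer (PadicAlgCl p)))
        (h : GL (Fin 4) k) (B : Field.absoluteGaloisGroup ℚ → Matrix (Fin 2) (Fin 2) k),
        (∀ g, Matrix.GeneralLinearGroup.map (Valued.integer (PadicAlgCl p)).subtype (rint g) = P⁻¹ * r g * P) ∧
        (∀ g, (Matrix.GeneralLinearGroup.map red (rint g)).val =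
          h.val * Matrix.reindex finSumFinEquiv finSumFinEquiv
            (Matrix.fromBlocks (σ g).val (B g) 0 (σ' g).val) * (h⁻¹).val) ∧
        ¬ ∃ X : Matrix (Fin 2) (Fin 2) k, ∀ g, B g = (σ g).val * X - X * (σ' g).val)
    (hA : ∀ (p : ℕ) [Fact p.Prime], p ≠ 2 → ∀ (k : Type) [Field k] [CharP k p] [IsAlgClosed k]
      [TopologicalSpace k] [DiscreteTopology k] (red : Valued.integer (PadicAlgCl p) →+* k)
      (σ σ' : FramedGaloisRep ℚ k 2) (hcpt : isCompact_glFiniteIntegralLevel 4 ℚ) (ι : PadicAlgCl p ≃+* ℂ)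
      (B : Field.absoluteGaloisGroup ℚ → Matrix (Fin 2) (Fin 2) k),
      σ.toGaloisRep.IsIrreducible → σ'.toGaloisRep.IsIrreducible → DetC p k σ σ' →
      (¬ ∃ g : GL (Fin 2) k, ∀ x, g * σ x * g⁻¹ = σ' x) → GenericSector p k σ σ' →
      (∃ ρ₀ : FramedGaloisRep ℚ (PadicAlgCl p) 4, ρ₀.toGaloisRep.IsIrreducible ∧ Sh p k red σ σ' ρ₀ ∧ Aut p hcpt ι ρ₀) →
      (¬ ∃ X : Matrix (Fin 2) (Fin 2) k, ∀ g, B g = (σ g).val * X - X * (σ' g).val) →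
      (∃ ρ : FramedGaloisRep ℚ (PadicAlgCl p) 4, ρ.toGaloisRep.IsIrreducible ∧ Sh p k red σ σ' ρ ∧
        ∃ (P : GL (Fin 4) (PadicAlgCl p))
          (rint : Field.absoluteGaloisGroup ℚ →* GL (Fin 4) (Valued.integer (PadicAlgCl p))) (h : GL (Fin 4) k),
          (∀ g, Matrix.GeneralLinearGroup.map (Valued.integer (PadicAlgCl p)).subtype (rint g) = P⁻¹ * ρ g * P) ∧
          (∀ g, (Matrix.GeneralLinearGroup.map red (rint g)).val =
            h.val * Matrix.reindex finSumFinEquiv finSumFinEquiv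
              (Matrix.fromBlocks (σ g).val (B g) 0 (σ' g).val) * (h⁻¹).val)) →
      ∃ ρ₁ : FramedGaloisRep ℚ (PadicAlgCl p) 4, ρ₁.toGaloisRep.IsIrreducible ∧ Aut p hcpt ι ρ₁ ∧
        (∃ c : ℕ, (c : ZMod (p - 1)) = 1 ∧
          (∃ ν : Field.absoluteGaloisGroup ℚ → PadicAlgCl p, ρ₁.IsSymplecticWithMultiplierFun ν) ∧
          ∀ v : HeightOneSpectrum (NumberField.RingOfIntegers ℚ), ((p : ℕ) : NumberField.RingOfIntegers ℚ) ∈ v.asIdeal →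
            ρ₁.IsGreenbergOrdinaryOfShapeAt v ![0, 0, c, c] ∧ ρ₁.IsResiduallyDistinguishedAt v ![0, 0, c, c]) ∧
        ∃ (P : GL (Fin 4) (PadicAlgCl p))
          (rint : Field.absoluteGaloisGroup ℚ →* GL (Fin 4) (Valued.integer (PadicAlgCl p))) (h : GL (Fin 4) k),
          (∀ g, Matrix.GeneralLinearGroup.map (Valued.integer (PadicAlgCl p)).subtype (rint g) = P⁻¹ * ρ₁ g * P) ∧
          (∀ g, (Matrix.GeneralLinearGroup.map red (rint g)).val =
            h.val * Matrix.reindex finSumFinEquiv finSumFinEquiv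
              (Matrix.fromBlocks (σ g).val (B g) 0 (σ' g).val) * (h⁻¹).val))
    (hP : ∀ (p : ℕ) [Fact p.Prime], p ≠ 2 → ∀ (k : Type) [Field k] [CharP k p] [IsAlgClosed k]
      [TopologicalSpace k] [DiscreteTopology k] (red : Valued.integer (PadicAlgCl p) →+* k)
      (σ σ' : FramedGaloisRep ℚ k 2) (hcpt : isCompact_glFiniteIntegralLevel 4 ℚ) (ι : PadicAlgCl p ≃+* ℂ)
      (ρ : FramedGaloisRep ℚ (PadicAlgCl p) 4) (B : Field.absoluteGaloisGroup ℚ → Matrix (Fin 2) (Fin 2) k),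
      σ.toGaloisRep.IsIrreducible → σ'.toGaloisRep.IsIrreducible → DetC p k σ σ' →
      (¬ ∃ g : GL (Fin 2) k, ∀ x, g * σ x * g⁻¹ = σ' x) → GenericSector p k σ σ' →
      (∃ ρ₀ : FramedGaloisRep ℚ (PadicAlgCl p) 4, ρ₀.toGaloisRep.IsIrreducible ∧ Sh p k red σ σ' ρ₀ ∧ Aut p hcpt ι ρ₀) →
      (¬ ∃ X : Matrix (Fin 2) (Fin 2) k, ∀ g, B g = (σ g).val * X - X * (σ' g).val) →
      ρ.toGaloisRep.IsIrreducible → Sh p k red σ σ' ρ →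
      (∃ (P : GL (Fin 4) (PadicAlgCl p))
          (rint : Field.absoluteGaloisGroup ℚ →* GL (Fin 4) (Valued.integer (PadicAlgCl p))) (h : GL (Fin 4) k),
          (∀ g, Matrix.GeneralLinearGroup.map (Valued.integer (PadicAlgCl p)).subtype (rint g) = P⁻¹ * ρ g * P) ∧
          (∀ g, (Matrix.GeneralLinearGroup.map red (rint g)).val =
            h.val * Matrix.reindex finSumFinEquiv finSumFinEquiv
              (Matrix.fromBlocks (σ g).val (B g) 0 (σ' g).val) * (h⁻¹).val)) →
      (∃ ρ₁ : FramedGaloisRep ℚ (PadicAlgCl p) 4, ρ₁.toGaloisRep.IsIrreducible ∧ Aut p hcpt ι ρ₁ ∧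
        (∃ c : ℕ, (c : ZMod (p - 1)) = 1 ∧
          (∃ ν : Field.absoluteGaloisGroup ℚ → PadicAlgCl p, ρ₁.IsSymplecticWithMultiplierFun ν) ∧
          ∀ v : HeightOneSpectrum (NumberField.RingOfIntegers ℚ), ((p : ℕ) : NumberField.RingOfIntegers ℚ) ∈ v.asIdeal →
            ρ₁.IsGreenbergOrdinaryOfShapeAt v ![0, 0, c, c] ∧ ρ₁.IsResiduallyDistinguishedAt v ![0, 0, c, c]) ∧
        ∃ (P : GL (Fin 4) (PadicAlgCl p))
          (rint : Field.absoluteGaloisGroup ℚ →* GL (Fin 4) (Valued.integer (PadicAlgCl p))) (h : GL (Fin 4) k),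
          (∀ g, Matrix.GeneralLinearGroup.map (Valued.integer (PadicAlgCl p)).subtype (rint g) = P⁻¹ * ρ₁ g * P) ∧
          (∀ g, (Matrix.GeneralLinearGroup.map red (rint g)).val =
            h.val * Matrix.reindex finSumFinEquiv finSumFinEquiv
              (Matrix.fromBlocks (σ g).val (B g) 0 (σ' g).val) * (h⁻¹).val)) →
      IsKlingenClassicalLimit p hcpt ι ρ) :
    RelKlingenDensityGeneric := by
  intro p _ hp k _ _ _ _ _ red σ σ' hcpt ι ρ₀ ρ hσ hσ' hdet hnc hG hρ₀ hSh₀ hA₀ hρ hSh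
  -- Ribet: a non-trivial class realised by `ρ` (the a.e. Frobenius clause is the third conjunct of `Sh ρ`)
  obtain ⟨P, rint, h, B, hfr, hred, hncB⟩ :=
    hR p k red σ σ' ρ hσ hσ' hnc hρ hSh.2.2
  have hreal : ∃ (P : GL (Fin 4) (PadicAlgCl p))
      (rint : Field.absoluteGaloisGroup ℚ →* GL (Fin 4) (Valued.integer (PadicAlgCl p))) (h : GL (Fin 4) k),
      (∀ g, Matrix.GeneralLinearGroup.map (Valued.integer (PadicAlgCl p)).subtype (rint g) = P⁻¹ * ρ g * P) ∧
      (∀ g, (Matrix.GeneralLinearGroup.map red (rint g)).val =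
        h.val * Matrix.reindex finSumFinEquiv finSumFinEquiv
          (Matrix.fromBlocks (σ g).val (B g) 0 (σ' g).val) * (h⁻¹).val) := ⟨P, rint, h, hfr, hred⟩
  -- anchor, then propagation
  obtain ⟨ρ₁, hρ₁⟩ := hA p hp k red σ σ' hcpt ι B hσ hσ' hdet hnc hG ⟨ρ₀, hρ₀, hSh₀, hA₀⟩ hncB ⟨ρ, hρ, hSh, hreal⟩
  exact hP p hp k red σ σ' hcpt ι ρ B hσ hσ' hdet hnc hG ⟨ρ₀, hρ₀, hSh₀, hA₀⟩ hncB hρ hSh hreal ⟨ρ₁, hρ₁⟩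

/-- **Relative sub-crux 1 `RelKlingenDensityGeneric`** is a THEOREM modulo R1a (proved), R1c-rel, R1d-rel (rev 6). -/
theorem relKlingenDensityGeneric_of_stubs : RelKlingenDensityGeneric :=
  relKlingenDensityGeneric_of_R1 stub_ribetNonsplitLattice stub_selmerAnchorRel stub_nonsplitPropagationRel

/-! ## Stub 2 — weight-(2,2) classicality of Klingen limits -/

/-- **STUB 2 `stub_klingenLimitClassicality`** (= KL2 of p116982; ≤ route target; nearest print BCGP 2021
Thm 4.6.1 + §6.6, Pilloni 2020). OPEN IN PRINT. -/
theorem stub_klingenLimitClassicality : KlingenLimitClassicality := by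
  sorry

/-! ## Stub 3 — Klingen density off the generic sector, CUT INTO ITS TWO GENUINE SUB-CORNERS (rev 5) -/

/-- **STUB 3a-rel `stub_cornerThreeRel`** (the ANCHORED `p = 3` corner — the crux's `ρ₀` kept as a hypothesis, rev 6: images in `GL₂(𝔽₉)`, the phantom-RM Frobenius-twist fibres
on which line C's cross-regular element fails, p96414; the named residue of conjunct (B) at `p = 3`). OPEN. -/
theorem stub_cornerThreeRel :
    ∀ (p : ℕ) [Fact p.Prime], p = 3 → ∀ (k : Type) [Field k] [CharP k p] [IsAlgClosed k]
    [TopologicalSpace k] [DiscreteTopology k] (red : Valued.integer (PadicAlgCl p) →+* k)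
    (σ σ' : FramedGaloisRep ℚ k 2) (hcpt : isCompact_glFiniteIntegralLevel 4 ℚ) (ι : PadicAlgCl p ≃+* ℂ)
    (ρ₀ ρ : FramedGaloisRep ℚ (PadicAlgCl p) 4),
    σ.toGaloisRep.IsIrreducible → σ'.toGaloisRep.IsIrreducible → DetC p k σ σ' →
    (¬ ∃ g : GL (Fin 2) k, ∀ x, g * σ x * g⁻¹ = σ' x) →
    ρ₀.toGaloisRep.IsIrreducible → Sh p k red σ σ' ρ₀ → Aut p hcpt ι ρ₀ →
    ρ.toGaloisRep.IsIrreducible → Sh p k red σ σ' ρ → IsKlingenClassicalLimit p hcpt ι ρ := by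
  sorry

/-- **STUB 3b-rel `stub_cornerTwistRel`** (the ANCHORED twist corner, `p ≥ 5`, `ρ₀` kept; by p148821 the twist is QUADRATIC: `σ̄'` a pointwise-scalar twist of a conjugate of `σ̄`,
i.e. `σ̄' ≅ σ̄ ⊗ χ` — the fibres carrying the INDUCED stable components of Disproof T17(c); the named residue of (B)
there). OPEN. -/
theorem stub_cornerTwistRel :
    ∀ (p : ℕ) [Fact p.Prime], 5 ≤ p → ∀ (k : Type) [Field k] [CharP k p] [IsAlgClosed k]
    [TopologicalSpace k] [DiscreteTopology k] (red : Valued.integer (PadicAlgCl p) →+* k)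
    (σ σ' : FramedGaloisRep ℚ k 2) (hcpt : isCompact_glFiniteIntegralLevel 4 ℚ) (ι : PadicAlgCl p ≃+* ℂ)
    (ρ₀ ρ : FramedGaloisRep ℚ (PadicAlgCl p) 4),
    σ.toGaloisRep.IsIrreducible → σ'.toGaloisRep.IsIrreducible → DetC p k σ σ' →
    (¬ ∃ g : GL (Fin 2) k, ∀ x, g * σ x * g⁻¹ = σ' x) →
    (∃ g : GL (Fin 2) k, ∀ x, ∃ c : k, (g * σ x * g⁻¹).val = c • (σ' x).val) →
    ρ₀.toGaloisRep.IsIrreducible → Sh p k red σ σ' ρ₀ → Aut p hcpt ι ρ₀ →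
    ρ.toGaloisRep.IsIrreducible → Sh p k red σ σ' ρ → IsKlingenClassicalLimit p hcpt ι ρ := by
  sorry

/-- **Relative sub-crux 3 from 3a-rel + 3b-rel** (kernel-checked composition, rev 6): off the generic sector either `p = 3`, or `p ≥ 5` and
then — by the LANDED vacuity theorem `stub_cornerVacuous_cyclotomicReducible` / `twistPair_of_not_genericSector`
(p146293, wave-1 worker of this lead: for `p ≥ 5` an `Sh`-point forces BOTH constituents to be absolutely irreducible on
`Γ_{ℚ(ζ_p)}`, via the inertia-invariant line of the Greenberg shape and `det = ε̄⁻¹`) — the pair is a twist pair. -/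
theorem relKlingenDensityCorner_of_corners
    (h₃ : ∀ (p : ℕ) [Fact p.Prime], p = 3 → ∀ (k : Type) [Field k] [CharP k p] [IsAlgClosed k]
      [TopologicalSpace k] [DiscreteTopology k] (red : Valued.integer (PadicAlgCl p) →+* k)
      (σ σ' : FramedGaloisRep ℚ k 2) (hcpt : isCompact_glFiniteIntegralLevel 4 ℚ) (ι : PadicAlgCl p ≃+* ℂ)
      (ρ₀ ρ : FramedGaloisRep ℚ (PadicAlgCl p) 4),
      σ.toGaloisRep.IsIrreducible → σ'.toGaloisRep.IsIrreducible → DetC p k σ σ' →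
      (¬ ∃ g : GL (Fin 2) k, ∀ x, g * σ x * g⁻¹ = σ' x) →
      ρ₀.toGaloisRep.IsIrreducible → Sh p k red σ σ' ρ₀ → Aut p hcpt ι ρ₀ →
      ρ.toGaloisRep.IsIrreducible → Sh p k red σ σ' ρ → IsKlingenClassicalLimit p hcpt ι ρ)
    (hT : ∀ (p : ℕ) [Fact p.Prime], 5 ≤ p → ∀ (k : Type) [Field k] [CharP k p] [IsAlgClosed k]
      [TopologicalSpace k] [DiscreteTopology k] (red : Valued.integer (PadicAlgCl p) →+* k)
      (σ σ' : FramedGaloisRep ℚ k 2) (hcpt : isCompact_glFiniteIntegralLevel 4 ℚ) (ι : PadicAlgCl p ≃+* ℂ)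
      (ρ₀ ρ : FramedGaloisRep ℚ (PadicAlgCl p) 4),
      σ.toGaloisRep.IsIrreducible → σ'.toGaloisRep.IsIrreducible → DetC p k σ σ' →
      (¬ ∃ g : GL (Fin 2) k, ∀ x, g * σ x * g⁻¹ = σ' x) →
      (∃ g : GL (Fin 2) k, ∀ x, ∃ c : k, (g * σ x * g⁻¹).val = c • (σ' x).val) →
      ρ₀.toGaloisRep.IsIrreducible → Sh p k red σ σ' ρ₀ → Aut p hcpt ι ρ₀ →
      ρ.toGaloisRep.IsIrreducible → Sh p k red σ σ' ρ → IsKlingenClassicalLimit p hcpt ι ρ) :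
    RelKlingenDensityCorner := by
  intro p _ hp2 k _ _ _ _ _ red σ σ' hcpt ι ρ₀ ρ hσ hσ' hdet hnc hng hρ₀ hSh₀ hA₀ hρ hSh
  by_cases hp3 : p = 3
  · exact h₃ p hp3 k red σ σ' hcpt ι ρ₀ ρ hσ hσ' hdet hnc hρ₀ hSh₀ hA₀ hρ hSh
  · have hp5 : 5 ≤ p := by
      have hprime : p.Prime := Fact.out
      have h2 := hprime.two_le
      have hp4 : p ≠ 4 := by
        rintro rfl
        exact absurd hprime (by decide)
      omega
    exact hT p hp5 k red σ σ' hcpt ι ρ₀ ρ hσ hσ' hdet hnc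
      (twistPair_of_not_genericSector hp5 red σ σ' ρ hσ hσ' hdet hSh hng) hρ₀ hSh₀ hA₀ hρ hSh

/-- **Relative sub-crux 3 `RelKlingenDensityCorner`** is a THEOREM modulo 3a-rel, 3b-rel (rev 6). -/
theorem relKlingenDensityCorner_of_stubs : RelKlingenDensityCorner :=
  relKlingenDensityCorner_of_corners stub_cornerThreeRel stub_cornerTwistRel

/-! ## Rev 7 (lead c4-0, 2026-08-17): THE REDUCIBLE LOCUS OF THE REALISATION FIBRE — registered sub-goals

Design note `Lines/sector-klingen-split-next.md` N2 (orientation rigidity), sharpened into the theorem that on a NON-TWIST fibre every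
SYMPLECTIC realiser of a non-trivial class `[B]` is IRREDUCIBLE: the reducible locus of the symplectic realisation fibre is EMPTY in
characteristic `0` (Klingen/Borel type: no stable line / hyperplane, T2/T3; Siegel type: stable-plane saturation over `ℤ̄_p` T4 +
orientation T5 + the symplectic block dichotomy T6 + Brauer–Nesbitt for the Lagrangian quotient T7 ⇒ twist pair; endoscopic type:
p146441).  Cores are stated for an abstract group `Γ` and maps `rint : Γ → GL₄(ℤ̄_p)` exactly like the landed c3 files
(`not_blockDiagonal_of_realises_nonsplit`, `stub_nonsplitInvariantSubspaces`), so that they are reusable by the anchor / propagation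
proofs; the assembly T8 is over the crux's `FramedGaloisRep` binders. -/

/-- **STUB T2 `stub_noStableLine`** (rev 7): a realiser of a NON-trivial class has no stable LINE — a primitive integral generator
would reduce to a stable line of the non-split `h (σ̄, B; 0, σ̄') h⁻¹`, excluded by the invariant-subspace trichotomy (p152467).
No hypothesis on `rint` beyond the reduction identity. [folklore] -/
theorem stub_noStableLine :
    ∀ (p : ℕ) [Fact p.Prime] (k : Type) [Field k] (Γ : Type) [Group Γ]
      (red : Valued.integer (PadicAlgCl p) →+* k) (σ σ' : Γ →* GL (Fin 2) k),
      Representation.IsIrreducible ((glStdRepresentation (Fin 2) k).comp σ) →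
      Representation.IsIrreducible ((glStdRepresentation (Fin 2) k).comp σ') →
      ∀ (B : Γ → Matrix (Fin 2) (Fin 2) k),
      (¬ ∃ X : Matrix (Fin 2) (Fin 2) k, ∀ g, B g = (σ g).val * X - X * (σ' g).val) →
      ∀ (rint : Γ → GL (Fin 4) (Valued.integer (PadicAlgCl p))) (h : GL (Fin 4) k),
      (∀ g, (Matrix.GeneralLinearGroup.map red (rint g)).val =
          h.val * Matrix.reindex finSumFinEquiv finSumFinEquiv
            (Matrix.fromBlocks (σ g).val (B g) 0 (σ' g).val) * (h⁻¹).val) →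
      ¬ ∃ v : Fin 4 → PadicAlgCl p, v ≠ 0 ∧ ∀ g, ∃ c : PadicAlgCl p,
          (Matrix.GeneralLinearGroup.map (Valued.integer (PadicAlgCl p)).subtype (rint g)).val *ᵥ v = c • v :=
  Fibre.stub_noStableLine

/-- **STUB T3 `stub_noStableCovector`** (rev 7): a realiser of a NON-trivial class has no stable HYPERPLANE, stated through a
stable covector (row eigenvector): its primitive reduction `w̄ ≠ 0` would cut a stable hyperplane `ker w̄` of the non-split
`h (σ̄, B; 0, σ̄') h⁻¹`, excluded by the trichotomy (p152467). [folklore] -/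
theorem stub_noStableCovector :
    ∀ (p : ℕ) [Fact p.Prime] (k : Type) [Field k] (Γ : Type) [Group Γ]
      (red : Valued.integer (PadicAlgCl p) →+* k) (σ σ' : Γ →* GL (Fin 2) k),
      Representation.IsIrreducible ((glStdRepresentation (Fin 2) k).comp σ) →
      Representation.IsIrreducible ((glStdRepresentation (Fin 2) k).comp σ') →
      ∀ (B : Γ → Matrix (Fin 2) (Fin 2) k),
      (¬ ∃ X : Matrix (Fin 2) (Fin 2) k, ∀ g, B g = (σ g).val * X - X * (σ' g).val) →
      ∀ (rint : Γ → GL (Fin 4) (Valued.integer (PadicAlgCl p))) (h : GL (Fin 4) k),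
      (∀ g, (Matrix.GeneralLinearGroup.map red (rint g)).val =
          h.val * Matrix.reindex finSumFinEquiv finSumFinEquiv
            (Matrix.fromBlocks (σ g).val (B g) 0 (σ' g).val) * (h⁻¹).val) →
      ¬ ∃ w : Fin 4 → PadicAlgCl p, w ≠ 0 ∧ ∀ g, ∃ c : PadicAlgCl p,
          w ᵥ* (Matrix.GeneralLinearGroup.map (Valued.integer (PadicAlgCl p)).subtype (rint g)).val = c • w :=
  Fibre.stub_noStableCovector

/-- **STUB T4 `stub_stablePlaneSaturation`** (rev 7; the lattice-free replacement of "saturated rank-2 submodules of `ℤ̄_p⁴` are free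
direct summands" over the NON-discrete, non-Noetherian valuation ring `ℤ̄_p`): a plane of `ℚ̄_p⁴` (column span of a rank-2 `M₁`) stable
under integral matrices `rint g` has an INTEGRAL basis `N = M₁ A` containing an identity `2 × 2` block (rows `i ≠ j`) — two pivot steps:
rescale a column by its entry of maximal norm, clear, repeat — and then the matrices `T g` of `rint g` on the plane in that basis are
INTEGRAL (`T g` = rows `i, j` of `rint g * N`). [folklore] -/
theorem stub_stablePlaneSaturation :
    ∀ (p : ℕ) [Fact p.Prime] (Γ : Type)
      (rint : Γ → Matrix (Fin 4) (Fin 4) (Valued.integer (PadicAlgCl p)))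
      (M₁ : Matrix (Fin 4) (Fin 2) (PadicAlgCl p)),
      (∀ a : Fin 2 → PadicAlgCl p, M₁ *ᵥ a = 0 → a = 0) →
      (∀ g, ∃ T : Matrix (Fin 2) (Fin 2) (PadicAlgCl p),
          (rint g).map (Valued.integer (PadicAlgCl p)).subtype * M₁ = M₁ * T) →
      ∃ (N : Matrix (Fin 4) (Fin 2) (Valued.integer (PadicAlgCl p)))
        (A : Matrix (Fin 2) (Fin 2) (PadicAlgCl p)) (i j : Fin 4)
        (T : Γ → Matrix (Fin 2) (Fin 2) (Valued.integer (PadicAlgCl p))),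
        i ≠ j ∧ N i 0 = 1 ∧ N i 1 = 0 ∧ N j 0 = 0 ∧ N j 1 = 1 ∧ IsUnit A.det ∧
        N.map (Valued.integer (PadicAlgCl p)).subtype = M₁ * A ∧
        ∀ g, rint g * N = N * T g :=
  Fibre.stub_stablePlaneSaturation

/-- **STUB T5 `stub_residualPlaneOrientation`** (rev 7; ORIENTATION RIGIDITY, residual half): a plane of `k⁴` (column span of a
rank-2 `N`) stable under the realised non-split `h (σ̄, B; 0, σ̄') h⁻¹` is the `σ̄`-plane, and the action on it is CONJUGATE TO `σ̄`
(not to `σ̄'`): the trichotomy p152467 leaves only the `σ̄`-plane in dimension 2. [folklore] -/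
theorem stub_residualPlaneOrientation :
    ∀ (k : Type) [Field k] (Γ : Type) [Group Γ] (σ σ' : Γ →* GL (Fin 2) k),
      Representation.IsIrreducible ((glStdRepresentation (Fin 2) k).comp σ) →
      Representation.IsIrreducible ((glStdRepresentation (Fin 2) k).comp σ') →
      ∀ (B : Γ → Matrix (Fin 2) (Fin 2) k),
      (¬ ∃ X : Matrix (Fin 2) (Fin 2) k, ∀ g, B g = (σ g).val * X - X * (σ' g).val) →
      ∀ (h : GL (Fin 4) k) (N : Matrix (Fin 4) (Fin 2) k) (T : Γ → Matrix (Fin 2) (Fin 2) k),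
      (∀ a : Fin 2 → k, N *ᵥ a = 0 → a = 0) →
      (∀ g, h.val * Matrix.reindex finSumFinEquiv finSumFinEquiv
            (Matrix.fromBlocks (σ g).val (B g) 0 (σ' g).val) * (h⁻¹).val * N = N * T g) →
      ∃ A : GL (Fin 2) k, ∀ g, (σ g).val * A.val = A.val * T g :=
  Fibre.stub_residualPlaneOrientation

/-- **STUB T6 `stub_symplecticBlockDichotomy`** (rev 7; the symplectic plane dichotomy T12 of the disprover, IN MATRICES): a block
upper-triangular similitude `(τ, C; 0, τ')` of a non-degenerate alternating `(J₁₁, X; -Xᵀ, Y)` either has its plane LAGRANGIAN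
(`J₁₁ = 0`; then `X` is invertible and `τᵀ X τ' = ν X`, i.e. `τ' = ν X⁻¹ τ⁻ᵀ X` — Lagrangian duality) or is block-DIAGONALISABLE by the
unipotent `(1, Z; 0, 1)`, `Z = -J₁₁⁻¹ X` (`C = Z τ' - τ Z`). Needs `2 ≠ 0`. [folklore] -/
theorem stub_symplecticBlockDichotomy :
    ∀ (K : Type) [Field K], (2 : K) ≠ 0 → ∀ (Γ : Type)
      (τ τ' C : Γ → Matrix (Fin 2) (Fin 2) K) (ν : Γ → K) (J₁₁ X Y : Matrix (Fin 2) (Fin 2) K),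
      J₁₁ᵀ = -J₁₁ → Yᵀ = -Y → (Matrix.fromBlocks J₁₁ X (-Xᵀ) Y).det ≠ 0 →
      (∀ g, IsUnit (τ g).det) → (∀ g, ν g ≠ 0) →
      (∀ g, (Matrix.fromBlocks (τ g) (C g) 0 (τ' g))ᵀ * Matrix.fromBlocks J₁₁ X (-Xᵀ) Y *
          Matrix.fromBlocks (τ g) (C g) 0 (τ' g) = ν g • Matrix.fromBlocks J₁₁ X (-Xᵀ) Y) →
      (J₁₁ = 0 ∧ IsUnit X.det ∧ ∀ g, (τ g)ᵀ * X * τ' g = ν g • X) ∨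
      (∃ Z : Matrix (Fin 2) (Fin 2) K, ∀ g, C g = Z * τ' g - τ g * Z) :=
  Fibre.stub_symplecticBlockDichotomy

/-- **STUB T7 `stub_twistOfDualCharpoly`** (rev 7; Brauer–Nesbitt step): if the irreducible `σ̄'` has the characteristic polynomials of
the TWISTED DUAL `χ ⊗ σ̄⁻ᵀ` of the irreducible `σ̄`, then `(σ̄, σ̄')` is a TWIST PAIR in the skeleton's pointwise-scalar form
(`J₂ A J₂⁻¹ = det A · A⁻ᵀ` on `GL₂`, then Brauer–Nesbitt `Representation.nonempty_equiv_of_charpoly_eq`, any field).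
[cite: BourbakiAlgebreVIII2012, VIII § 20 n° 6, Thm. 2, Cor. 1 (p. 378)] -/
theorem stub_twistOfDualCharpoly :
    ∀ (k : Type) [Field k] (Γ : Type) [Group Γ] (σ σ' : Γ →* GL (Fin 2) k) (χ : Γ →* kˣ),
      Representation.IsIrreducible ((glStdRepresentation (Fin 2) k).comp σ) →
      Representation.IsIrreducible ((glStdRepresentation (Fin 2) k).comp σ') →
      (∀ g, (σ' g).val.charpoly = (((χ g : kˣ) : k) • ((σ g).val)ᵀ⁻¹).charpoly) →
      ∃ A : GL (Fin 2) k, ∀ x, ∃ c : k, (A * σ x * A⁻¹).val = c • (σ' x).val :=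
  Fibre.stub_twistOfDualCharpoly

/-- **STUB T9 `stub_irreducible_of_noStableSubspace`** (rev 7; pure linear algebra): a matrix representation `r : Γ → GL₄(K)` with no
stable line (eigen-line of all `r g`), no stable hyperplane (row eigen-covector of all `r g`) and no stable plane (rank-2 `4 × 2` matrix
`M` with `r g M = M T_g`) is IRREDUCIBLE on `K⁴` (Mathlib `Representation.IsIrreducible` = simple order of subrepresentations:
dimension count `0 … 4`, bases of a stable submodule, the dot-product annihilator of a stable 3-space is a stable covector line). [folklore] -/
theorem stub_irreducible_of_noStableSubspace :
    ∀ (K : Type) [Field K] (Γ : Type) [Group Γ] (r : Γ →* GL (Fin 4) K),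
      (¬ ∃ v : Fin 4 → K, v ≠ 0 ∧ ∀ g, ∃ c : K, (r g).val *ᵥ v = c • v) →
      (¬ ∃ w : Fin 4 → K, w ≠ 0 ∧ ∀ g, ∃ c : K, w ᵥ* (r g).val = c • w) →
      (¬ ∃ M : Matrix (Fin 4) (Fin 2) K, (∀ a : Fin 2 → K, M *ᵥ a = 0 → a = 0) ∧
          ∀ g, ∃ T : Matrix (Fin 2) (Fin 2) K, (r g).val * M = M * T) →
      Representation.IsIrreducible ((glStdRepresentation (Fin 4) K).comp r) :=
  Fibre.stub_irreducible_of_noStableSubspace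

/-- **STUB N2 `stub_reducibleRealiserOrientation`** (rev 7 = design note N2 verbatim; assembly of T4 + T5 + block-triangular charpoly
bookkeeping, briefed once T4/T5 land): if an integral frame `rint` of a realiser of the NON-trivial class `B` (sub `σ̄`, quotient `σ̄'`)
is block UPPER triangular `(τ, C; 0, τ')` after a `GL₄(ℚ̄_p)`-conjugation, then `charpoly τ(g) ∈ ℤ̄_p[X]` REDUCES TO `charpoly σ̄(g)`
and `charpoly τ'(g)` to `charpoly σ̄'(g)` — never the other way round: the reducible locus of the realisation fibre consists of
extensions of a `σ̄'`-lift by a `σ̄`-lift (census F3(i), the Selmer-divisor orientation). [folklore] -/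
theorem stub_reducibleRealiserOrientation :
    ∀ (p : ℕ) [Fact p.Prime] (k : Type) [Field k] (Γ : Type) [Group Γ]
      (red : Valued.integer (PadicAlgCl p) →+* k) (σ σ' : Γ →* GL (Fin 2) k),
      Representation.IsIrreducible ((glStdRepresentation (Fin 2) k).comp σ) →
      Representation.IsIrreducible ((glStdRepresentation (Fin 2) k).comp σ') →
      ∀ (B : Γ → Matrix (Fin 2) (Fin 2) k),
      (¬ ∃ X : Matrix (Fin 2) (Fin 2) k, ∀ g, B g = (σ g).val * X - X * (σ' g).val) →
      ∀ (rint : Γ →* GL (Fin 4) (Valued.integer (PadicAlgCl p))) (h : GL (Fin 4) k),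
      (∀ g, (Matrix.GeneralLinearGroup.map red (rint g)).val =
          h.val * Matrix.reindex finSumFinEquiv finSumFinEquiv
            (Matrix.fromBlocks (σ g).val (B g) 0 (σ' g).val) * (h⁻¹).val) →
      ∀ (Q : GL (Fin 4) (PadicAlgCl p)) (τ τ' C : Γ → Matrix (Fin 2) (Fin 2) (PadicAlgCl p)),
      (∀ g, ((Q⁻¹ * Matrix.GeneralLinearGroup.map (Valued.integer (PadicAlgCl p)).subtype (rint g) * Q :
            GL (Fin 4) (PadicAlgCl p)) : Matrix (Fin 4) (Fin 4) (PadicAlgCl p)) =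
          Matrix.reindex finSumFinEquiv finSumFinEquiv (Matrix.fromBlocks (τ g) (C g) 0 (τ' g))) →
      ∀ g, ∃ P₁ P₂ : Polynomial (Valued.integer (PadicAlgCl p)),
        P₁.map (Valued.integer (PadicAlgCl p)).subtype = (τ g).charpoly ∧ P₁.map red = (σ g).val.charpoly ∧
        P₂.map (Valued.integer (PadicAlgCl p)).subtype = (τ' g).charpoly ∧ P₂.map red = (σ' g).val.charpoly :=
  Fibre.stub_reducibleRealiserOrientation

/-- **STUB T8b `stub_blockTriangularCharpolyReduction`** (rev 8; charpoly bookkeeping for T8-plane): an integral block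
UPPER-triangular family `r' g = (T g, C g; 0, τ' g)` over `ℤ̄_p` whose reduction through `red` is conjugate to the realised
`h (σ̄, B; 0, σ̄') h⁻¹`, with top block residually conjugate to `σ̄` (orientation, T5), has bottom block with the characteristic
polynomials of `σ̄'`: `charpoly (red τ' g) = charpoly σ̄'(g)` (block-triangular charpolys multiply; cancel the monic `charpoly σ̄(g)`
in `k[X]`). [folklore] -/
theorem stub_blockTriangularCharpolyReduction :
    ∀ (p : ℕ) [Fact p.Prime] (k : Type) [Field k] (Γ : Type)
      (red : Valued.integer (PadicAlgCl p) →+* k) (σ σ' : Γ → GL (Fin 2) k) (B : Γ → Matrix (Fin 2) (Fin 2) k)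
      (h W : GL (Fin 4) k) (Ab : GL (Fin 2) k)
      (T C τ' : Γ → Matrix (Fin 2) (Fin 2) (Valued.integer (PadicAlgCl p)))
      (r' : Γ → Matrix (Fin 4) (Fin 4) (Valued.integer (PadicAlgCl p))),
      (∀ g, r' g = Matrix.reindex finSumFinEquiv finSumFinEquiv (Matrix.fromBlocks (T g) (C g) 0 (τ' g))) →
      (∀ g, (r' g).map red = W.val * (h.val * Matrix.reindex finSumFinEquiv finSumFinEquiv
            (Matrix.fromBlocks (σ g).val (B g) 0 (σ' g).val) * (h⁻¹).val) * (W⁻¹).val) →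
      (∀ g, (σ g).val * Ab.val = Ab.val * (T g).map red) →
      ∀ g, ((τ' g).map red).charpoly = (σ' g).val.charpoly :=
  Fibre.stub_blockTriangularCharpolyReduction

/-- **STUB T8c `stub_lagrangianQuotientCharpoly`** (rev 8; the Lagrangian relation read residually): if `Tᵀ X τ' = ν X` over
`ℚ̄_p` with `T ∈ GL₂(ℤ̄_p)`, `τ'` integral, `ν ∈ ℤ̄_p` and `X ∈ GL₂(ℚ̄_p)` (NOT assumed integral), then `τ' = ν X⁻¹ T⁻ᵀ X`, the
INTEGRAL polynomials `charpoly τ'` and `charpoly (ν T⁻ᵀ)` agree (injectivity of `ℤ̄_p[X] → ℚ̄_p[X]`), hence so do their reductions: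
`charpoly (red τ') = charpoly (red ν • (red T)⁻ᵀ)`. [folklore] -/
theorem stub_lagrangianQuotientCharpoly :
    ∀ (p : ℕ) [Fact p.Prime] (k : Type) [Field k] (red : Valued.integer (PadicAlgCl p) →+* k)
      (T : GL (Fin 2) (Valued.integer (PadicAlgCl p))) (τ' : Matrix (Fin 2) (Fin 2) (Valued.integer (PadicAlgCl p)))
      (X : Matrix (Fin 2) (Fin 2) (PadicAlgCl p)) (ν : Valued.integer (PadicAlgCl p)),
      IsUnit X.det →
      (Matrix.GeneralLinearGroup.map (Valued.integer (PadicAlgCl p)).subtype T).valᵀ * X *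
          τ'.map (Valued.integer (PadicAlgCl p)).subtype = ((ν : Valued.integer (PadicAlgCl p)) : PadicAlgCl p) • X →
      (τ'.map red).charpoly = ((red ν) • ((Matrix.GeneralLinearGroup.map red T).val)ᵀ⁻¹).charpoly :=
  Fibre.stub_lagrangianQuotientCharpoly

/-- **STUB T8-plane `stub_noStablePlaneSymplectic`** (rev 8; the Siegel/endoscopic half of T8, assembly of T4 + T5 + T6 + T7 + T8b + T8c +
p146441): an integral frame `rint : Γ →* GL₄(ℤ̄_p)` realising a NON-trivial class `B` of a NON-TWIST pair, SYMPLECTIC for some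
non-degenerate alternating `J` over `ℚ̄_p` with multiplier `ν`, has NO stable plane (rank-2 `M` with `rint g M = M T_g`).
Plan: saturate (T4) to `N`, `T` integral with identity rows; orient (T5): `red T ∼ σ̄`; complete `N` by two coordinate columns to
`Q ∈ GL₄(ℤ̄_p)` so that `Q⁻¹ rint Q = (T, C; 0, τ')`; `J' := Qᵀ J Q`; block dichotomy (T6, `p ≠ 2` so `2 ≠ 0` in `ℚ̄_p` — in fact
char 0): either `C = Z τ' - T Z` and `Q (1, Z; 0, 1)` block-diagonalises `rint` — contradicting `not_blockDiagonal_of_realises_nonsplit`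
(p146441) — or Lagrangian: `Tᵀ X τ' = ν X`, then T8c + T8b give `charpoly σ̄' = charpoly (ν̄ σ̄⁻ᵀ)` (`ν` is a unit character:
`ν(gh) = ν(g)ν(h)` from the similitude identity, `‖ν‖ = 1` from `ν⁴ = det²`), and T7 makes `(σ̄, σ̄')` a twist pair — excluded. [folklore] -/
theorem stub_noStablePlaneSymplectic :
    ∀ (p : ℕ) [Fact p.Prime], p ≠ 2 → ∀ (k : Type) [Field k] [CharP k p] [IsAlgClosed k] (Γ : Type) [Group Γ]
      (red : Valued.integer (PadicAlgCl p) →+* k) (σ σ' : Γ →* GL (Fin 2) k),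
      Representation.IsIrreducible ((glStdRepresentation (Fin 2) k).comp σ) →
      Representation.IsIrreducible ((glStdRepresentation (Fin 2) k).comp σ') →
      (¬ ∃ g : GL (Fin 2) k, ∀ x, ∃ c : k, (g * σ x * g⁻¹).val = c • (σ' x).val) →
      ∀ (B : Γ → Matrix (Fin 2) (Fin 2) k),
      (¬ ∃ X : Matrix (Fin 2) (Fin 2) k, ∀ g, B g = (σ g).val * X - X * (σ' g).val) →
      ∀ (rint : Γ →* GL (Fin 4) (Valued.integer (PadicAlgCl p))) (h : GL (Fin 4) k),
      (∀ g, (Matrix.GeneralLinearGroup.map red (rint g)).val =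
          h.val * Matrix.reindex finSumFinEquiv finSumFinEquiv
            (Matrix.fromBlocks (σ g).val (B g) 0 (σ' g).val) * (h⁻¹).val) →
      ∀ (J : Matrix (Fin 4) (Fin 4) (PadicAlgCl p)) (ν : Γ → PadicAlgCl p), Jᵀ = -J → J.det ≠ 0 →
      (∀ g, (Matrix.GeneralLinearGroup.map (Valued.integer (PadicAlgCl p)).subtype (rint g)).valᵀ * J *
          (Matrix.GeneralLinearGroup.map (Valued.integer (PadicAlgCl p)).subtype (rint g)).val = ν g • J) →
      ¬ ∃ M : Matrix (Fin 4) (Fin 2) (PadicAlgCl p), (∀ a : Fin 2 → PadicAlgCl p, M *ᵥ a = 0 → a = 0) ∧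
          ∀ g, ∃ T : Matrix (Fin 2) (Fin 2) (PadicAlgCl p),
            (Matrix.GeneralLinearGroup.map (Valued.integer (PadicAlgCl p)).subtype (rint g)).val * M = M * T :=
  Fibre.stub_noStablePlaneSymplectic

/-! ### Rev 8 (lead c4-0): N1 — the GREENBERG (Selmer) condition of the realised cocycle AT `p`, registered sub-goals -/

/-- **STUB N1a `stub_greenbergPlane`** (rev 8; Theorems-side port of the disprover's T13-typed `exists_greenbergPlane`,
Disproof.lean §7, kernel-checked there but not importable): a shape-`(0,0,1,1)` Greenberg-ordinary `ρ : Γ_K → GL₄(ℚ̄_p)` has a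
`Γ_K`-stable PLANE on which INERTIA ACTS TRIVIALLY (`U = g⁻¹⟨e₀, e₁⟩` for the Greenberg frame `g`). [folklore] -/
theorem stub_greenbergPlane :
    ∀ (K : Type) [Field K] [ValuativeRel K] [TopologicalSpace K] [IsNonarchimedeanLocalField K]
      (p : ℕ) [Fact p.Prime] (ρ : FramedRep (Field.absoluteGaloisGroup K) (PadicAlgCl p) 4),
      ρ.IsGreenbergOrdinaryOfShape ![0, 0, 1, 1] →
      ∃ U : Submodule (PadicAlgCl p) (Fin 4 → PadicAlgCl p), Module.finrank (PadicAlgCl p) U = 2 ∧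
        (∀ τ, ∀ u ∈ U, (ρ τ).val *ᵥ u ∈ U) ∧
        (∀ τ ∈ absInertia K, ∀ u ∈ U, (ρ τ).val *ᵥ u = u) :=
  Fibre.stub_greenbergPlane

/-- **STUB N1-core `stub_greenbergCocycleCore`** (rev 8; the residual linear algebra of N1): if a plane of `k² ⊕ k²` (column span
of a rank-2 `N'`) is FIXED POINTWISE by a family of block upper-triangular maps `(S i, B i; 0, S' i)` whose diagonal blocks each
move something (`S i₀ ≠ 1`, `S' i₁ ≠ 1`), then — T13's core: the plane meets the `S`-plane in a LINE `k x₁` and is spanned by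
`(x₁, 0), (x₂, y₁)` with `y₁ ≠ 0` — the family `S` fixes `x₁ ≠ 0`, `S'` fixes `y₁ ≠ 0`, and after the coboundary change by any
`X₀` with `X₀ y₁ = -x₂` the cocycle KILLS `y₁`: `(B i - (S i X₀ - X₀ S' i)) y₁ = 0` for all `i`. [folklore] -/
theorem stub_greenbergCocycleCore :
    ∀ (k : Type) [Field k] (ι : Type) (S S' B : ι → Matrix (Fin 2) (Fin 2) k)
      (N' : Matrix (Fin 2 ⊕ Fin 2) (Fin 2) k),
      (∀ a : Fin 2 → k, N' *ᵥ a = 0 → a = 0) →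
      (∀ i, Matrix.fromBlocks (S i) (B i) 0 (S' i) * N' = N') →
      (∃ i, S i ≠ 1) → (∃ i, S' i ≠ 1) →
      ∃ (X₀ : Matrix (Fin 2) (Fin 2) k) (x₁ y₁ : Fin 2 → k), x₁ ≠ 0 ∧ y₁ ≠ 0 ∧
        (∀ i, S i *ᵥ x₁ = x₁) ∧ (∀ i, S' i *ᵥ y₁ = y₁) ∧
        ∀ i, (B i - (S i * X₀ - X₀ * S' i)) *ᵥ y₁ = 0 :=
  Fibre.stub_greenbergCocycleCore

/-- **STUB N1 `stub_realisedCocycleGreenberg`** (rev 8 = design note N1, assembly of N1a + T4 + N1-core over the crux binders;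
census R1(b), local part): for an `Sh`-point `ρ` realising `B` through the integral frame `(P, rint)` with reduction conjugator `h`,
on a fibre with `det σ̄ = det σ̄' = ε̄⁻¹` (`DetC`, so inertia at `v ∣ p` moves both constituents, `p ≠ 2`), the realised cocycle is
GREENBERG–SELMER AT `v`: inertia at `v` fixes a line `k x₁` of `σ̄` and a line `k y₁` of `σ̄'`, and after a coboundary change
`B - δX₀` the cocycle kills `y₁` on inertia — the image of `[B]` in `H¹(I_v, Hom(σ̄'^{I_v}, σ̄))` vanishes.  (Greenberg plane of
`Sh ρ` ∩ the lattice, saturated by T4, reduced, then N1-core with the inertia element `ε̄(τ₀) = -1` of the sibling crux's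
`exists_mem_absInertia_epsBar_ne_one`.) [folklore] -/
theorem stub_realisedCocycleGreenberg :
    ∀ (p : ℕ) [Fact p.Prime], p ≠ 2 → ∀ (k : Type) [Field k] [CharP k p] [IsAlgClosed k]
      [TopologicalSpace k] [DiscreteTopology k] (red : Valued.integer (PadicAlgCl p) →+* k)
      (σ σ' : FramedGaloisRep ℚ k 2) (ρ : FramedGaloisRep ℚ (PadicAlgCl p) 4)
      (P : GL (Fin 4) (PadicAlgCl p))
      (rint : Field.absoluteGaloisGroup ℚ →* GL (Fin 4) (Valued.integer (PadicAlgCl p))) (h : GL (Fin 4) k)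
      (B : Field.absoluteGaloisGroup ℚ → Matrix (Fin 2) (Fin 2) k)
      (v : HeightOneSpectrum (NumberField.RingOfIntegers ℚ)),
      ((p : ℕ) : NumberField.RingOfIntegers ℚ) ∈ v.asIdeal → DetC p k σ σ' → Sh p k red σ σ' ρ →
      (∀ g, Matrix.GeneralLinearGroup.map (Valued.integer (PadicAlgCl p)).subtype (rint g) = P⁻¹ * ρ g * P) →
      (∀ g, (Matrix.GeneralLinearGroup.map red (rint g)).val =
          h.val * Matrix.reindex finSumFinEquiv finSumFinEquiv
            (Matrix.fromBlocks (σ g).val (B g) 0 (σ' g).val) * (h⁻¹).val) →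
      ∃ (X₀ : Matrix (Fin 2) (Fin 2) k) (x₁ y₁ : Fin 2 → k), x₁ ≠ 0 ∧ y₁ ≠ 0 ∧
        (∀ τ ∈ absInertia (v.adicCompletion ℚ),
          (σ (absGaloisRestrict ℚ (v.adicCompletion ℚ) τ)).val *ᵥ x₁ = x₁) ∧
        (∀ τ ∈ absInertia (v.adicCompletion ℚ),
          (σ' (absGaloisRestrict ℚ (v.adicCompletion ℚ) τ)).val *ᵥ y₁ = y₁) ∧
        ∀ τ ∈ absInertia (v.adicCompletion ℚ),
          (B (absGaloisRestrict ℚ (v.adicCompletion ℚ) τ) -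
            ((σ (absGaloisRestrict ℚ (v.adicCompletion ℚ) τ)).val * X₀ -
              X₀ * (σ' (absGaloisRestrict ℚ (v.adicCompletion ℚ) τ)).val)) *ᵥ y₁ = 0 :=
  Fibre.stub_realisedCocycleGreenberg

/-- **STUB T8 `stub_symplecticRealiserIrreducible`** (rev 7, the lead's assembly; NEW THEOREM of this seat): on a NON-TWIST residual pair
(`σ̄'` is no pointwise-scalar twist of a conjugate of `σ̄` — in particular non-conjugate; automatic on `GenericSector`, and on the whole
`p ≥ 5` non-corner by p146293/p148821), EVERY SYMPLECTIC REALISER (any multiplier) of a NON-trivial class `[B]` is IRREDUCIBLE.  So the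
`ρ.IsIrreducible` conjuncts in the realiser clauses of R1c-rel / R1d-rel are automatic for `Sh`-points, and the reducible locus of the
symplectic realisation fibre of `[B] ≠ 0` — the object a Skinner–Wiles propagation must control — has NO characteristic-0 point.
Proof plan: T9 reduces to excluding stable lines (T2), hyperplanes (T3) and planes; a stable plane is saturated (T4), oriented (T5:
`τ̄ ∼ σ̄`), and by the symplectic block dichotomy (T6, in the `ℤ̄_p`-basis completed by two coordinate vectors, `p ≠ 2`) either splits
off — contradicting "no decomposable realiser" p146441 — or is Lagrangian, whence `charpoly σ̄' = charpoly(ν̄ σ̄⁻ᵀ)` (block-triangular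
charpoly bookkeeping, `ν` a unit character) and T7 makes `(σ̄, σ̄')` a twist pair — excluded. [folklore] -/
theorem stub_symplecticRealiserIrreducible :
    ∀ (p : ℕ) [Fact p.Prime], p ≠ 2 → ∀ (k : Type) [Field k] [CharP k p] [IsAlgClosed k]
      [TopologicalSpace k] [DiscreteTopology k] (red : Valued.integer (PadicAlgCl p) →+* k)
      (σ σ' : FramedGaloisRep ℚ k 2) (r : FramedGaloisRep ℚ (PadicAlgCl p) 4)
      (B : Field.absoluteGaloisGroup ℚ → Matrix (Fin 2) (Fin 2) k)
      (ν : Field.absoluteGaloisGroup ℚ → PadicAlgCl p),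
      σ.toGaloisRep.IsIrreducible → σ'.toGaloisRep.IsIrreducible →
      (¬ ∃ g : GL (Fin 2) k, ∀ x, ∃ c : k, (g * σ x * g⁻¹).val = c • (σ' x).val) →
      (¬ ∃ X : Matrix (Fin 2) (Fin 2) k, ∀ g, B g = (σ g).val * X - X * (σ' g).val) →
      (∃ (P : GL (Fin 4) (PadicAlgCl p))
        (rint : Field.absoluteGaloisGroup ℚ →* GL (Fin 4) (Valued.integer (PadicAlgCl p))) (h : GL (Fin 4) k),
        (∀ g, Matrix.GeneralLinearGroup.map (Valued.integer (PadicAlgCl p)).subtype (rint g) = P⁻¹ * r g * P) ∧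
        (∀ g, (Matrix.GeneralLinearGroup.map red (rint g)).val =
          h.val * Matrix.reindex finSumFinEquiv finSumFinEquiv
            (Matrix.fromBlocks (σ g).val (B g) 0 (σ' g).val) * (h⁻¹).val)) →
      r.IsSymplecticWithMultiplierFun ν → r.toGaloisRep.IsIrreducible :=
  Fibre.stub_symplecticRealiserIrreducible

/-- **Corollary (rev 7): `Sh`-realisers of a non-trivial class on a non-twist fibre are irreducible** — the form consumed by the
anchor / propagation stubs (`Sh ρ` supplies the symplectic structure with multiplier `ε⁻¹`). [folklore] -/
theorem shRealiser_isIrreducible_of_stub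
    (hT8 : ∀ (p : ℕ) [Fact p.Prime], p ≠ 2 → ∀ (k : Type) [Field k] [CharP k p] [IsAlgClosed k]
      [TopologicalSpace k] [DiscreteTopology k] (red : Valued.integer (PadicAlgCl p) →+* k)
      (σ σ' : FramedGaloisRep ℚ k 2) (r : FramedGaloisRep ℚ (PadicAlgCl p) 4)
      (B : Field.absoluteGaloisGroup ℚ → Matrix (Fin 2) (Fin 2) k)
      (ν : Field.absoluteGaloisGroup ℚ → PadicAlgCl p),
      σ.toGaloisRep.IsIrreducible → σ'.toGaloisRep.IsIrreducible →
      (¬ ∃ g : GL (Fin 2) k, ∀ x, ∃ c : k, (g * σ x * g⁻¹).val = c • (σ' x).val) →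
      (¬ ∃ X : Matrix (Fin 2) (Fin 2) k, ∀ g, B g = (σ g).val * X - X * (σ' g).val) →
      (∃ (P : GL (Fin 4) (PadicAlgCl p))
        (rint : Field.absoluteGaloisGroup ℚ →* GL (Fin 4) (Valued.integer (PadicAlgCl p))) (h : GL (Fin 4) k),
        (∀ g, Matrix.GeneralLinearGroup.map (Valued.integer (PadicAlgCl p)).subtype (rint g) = P⁻¹ * r g * P) ∧
        (∀ g, (Matrix.GeneralLinearGroup.map red (rint g)).val =
          h.val * Matrix.reindex finSumFinEquiv finSumFinEquiv
            (Matrix.fromBlocks (σ g).val (B g) 0 (σ' g).val) * (h⁻¹).val)) →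
      r.IsSymplecticWithMultiplierFun ν → r.toGaloisRep.IsIrreducible)
    {p : ℕ} [Fact p.Prime] (hp : p ≠ 2) {k : Type} [Field k] [CharP k p] [IsAlgClosed k]
    [TopologicalSpace k] [DiscreteTopology k] (red : Valued.integer (PadicAlgCl p) →+* k)
    (σ σ' : FramedGaloisRep ℚ k 2) (r : FramedGaloisRep ℚ (PadicAlgCl p) 4)
    (B : Field.absoluteGaloisGroup ℚ → Matrix (Fin 2) (Fin 2) k)
    (hσ : σ.toGaloisRep.IsIrreducible) (hσ' : σ'.toGaloisRep.IsIrreducible)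
    (hnt : ¬ ∃ g : GL (Fin 2) k, ∀ x, ∃ c : k, (g * σ x * g⁻¹).val = c • (σ' x).val)
    (hB : ¬ ∃ X : Matrix (Fin 2) (Fin 2) k, ∀ g, B g = (σ g).val * X - X * (σ' g).val)
    (hreal : ∃ (P : GL (Fin 4) (PadicAlgCl p))
        (rint : Field.absoluteGaloisGroup ℚ →* GL (Fin 4) (Valued.integer (PadicAlgCl p))) (h : GL (Fin 4) k),
        (∀ g, Matrix.GeneralLinearGroup.map (Valued.integer (PadicAlgCl p)).subtype (rint g) = P⁻¹ * r g * P) ∧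
        (∀ g, (Matrix.GeneralLinearGroup.map red (rint g)).val =
          h.val * Matrix.reindex finSumFinEquiv finSumFinEquiv
            (Matrix.fromBlocks (σ g).val (B g) 0 (σ' g).val) * (h⁻¹).val))
    (hSh : Sh p k red σ σ' r) : r.toGaloisRep.IsIrreducible :=
  hT8 p hp k red σ σ' r B _ hσ hσ' hnt hB hreal hSh.1

/-! ## Rev 11 (lead c4-0): R1(b) COMPLETE and the anchor DISCHARGED ON SELMER-RANK-ONE fibres — registered sub-goals

The realised class of an `Sh`-point is a GREENBERG–SELMER class (cocycle identity p151532, locally constant K1, unramified wherever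
the point is p145853, Greenberg at `p` N1 p157554): bundled as K3 `stub_realisedClassSelmer`.  Consequence K2
`stub_selmerAnchorRel_of_rankOne`: if the Greenberg–Selmer cocycles with ramification inside a finite set `S` containing the
ramification of the anchor `ρ₀` and of the realiser `ρ` are projectively CYCLIC (Berger–Klosin's rank-one regime, stated on
cocycles — a hypothesis on `(σ̄, σ̄', S)` alone, no longer on realisers as in rev 6's `selmerAnchorRel_of_cyclic`), then the anchor
stub R1c-rel holds for that class with `ρ₁ := ρ₀` (p148691 `stub_anchorOfSameClass`). -/

/-- **STUB K1 `stub_realisedCocycleLocallyConstant`** (rev 11): a realised cocycle is LOCALLY CONSTANT on `Γ_ℚ` (Krull topology):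
`rint = P⁻¹ r P` is continuous, `red` kills the open ball `‖·‖ < 1` of `ℤ̄_p` (characteristic `p`), and `B g` is a block of
`h⁻¹ red(rint g) h`. So realised classes are classes of CONTINUOUS cochains. [folklore] -/
theorem stub_realisedCocycleLocallyConstant :
    ∀ (p : ℕ) [Fact p.Prime] (k : Type) [Field k] [CharP k p] [TopologicalSpace k] [DiscreteTopology k]
      (red : Valued.integer (PadicAlgCl p) →+* k)
      (σ σ' : FramedGaloisRep ℚ k 2) (r : FramedGaloisRep ℚ (PadicAlgCl p) 4)
      (P : GL (Fin 4) (PadicAlgCl p)) (rint : Field.absoluteGaloisGroup ℚ →* GL (Fin 4) (Valued.integer (PadicAlgCl p)))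
      (h : GL (Fin 4) k) (B : Field.absoluteGaloisGroup ℚ → Matrix (Fin 2) (Fin 2) k),
      (∀ g, Matrix.GeneralLinearGroup.map (Valued.integer (PadicAlgCl p)).subtype (rint g) = P⁻¹ * r g * P) →
      (∀ g, (Matrix.GeneralLinearGroup.map red (rint g)).val =
        h.val * Matrix.reindex finSumFinEquiv finSumFinEquiv (Matrix.fromBlocks (σ g).val (B g) 0 (σ' g).val) * (h⁻¹).val) →
      IsLocallyConstant B :=
  Fibre.stub_realisedCocycleLocallyConstant

/-- **STUB K3 `stub_realisedClassSelmer`** (rev 11; census R1(b) COMPLETE): the cocycle `B` realised by an `Sh`-point `ρ` on a `DetC`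
fibre is a GREENBERG–SELMER cocycle for the ramification of `ρ`: (i) the 1-cocycle identity, (ii) locally constant, (iii) vanishing on
the inertia groups above every place where `ρ` is unramified, (iv) the Greenberg condition at every `v ∣ p` (after a coboundary change it
kills the inertia-invariant line of `σ̄'` on inertia).  Bundles p151532, K1, p145853, N1 p157554. [folklore] -/
theorem stub_realisedClassSelmer :
    ∀ (p : ℕ) [Fact p.Prime], p ≠ 2 → ∀ (k : Type) [Field k] [CharP k p] [IsAlgClosed k]
      [TopologicalSpace k] [DiscreteTopology k] (red : Valued.integer (PadicAlgCl p) →+* k)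
      (σ σ' : FramedGaloisRep ℚ k 2) (ρ : FramedGaloisRep ℚ (PadicAlgCl p) 4)
      (P : GL (Fin 4) (PadicAlgCl p)) (rint : Field.absoluteGaloisGroup ℚ →* GL (Fin 4) (Valued.integer (PadicAlgCl p)))
      (h : GL (Fin 4) k) (B : Field.absoluteGaloisGroup ℚ → Matrix (Fin 2) (Fin 2) k),
      DetC p k σ σ' → Sh p k red σ σ' ρ →
      (∀ g, Matrix.GeneralLinearGroup.map (Valued.integer (PadicAlgCl p)).subtype (rint g) = P⁻¹ * ρ g * P) →
      (∀ g, (Matrix.GeneralLinearGroup.map red (rint g)).val =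
        h.val * Matrix.reindex finSumFinEquiv finSumFinEquiv (Matrix.fromBlocks (σ g).val (B g) 0 (σ' g).val) * (h⁻¹).val) →
      (∀ g g', B (g * g') = (σ g).val * B g' + B g * (σ' g').val) ∧ IsLocallyConstant B ∧
      (∀ v : HeightOneSpectrum (NumberField.RingOfIntegers ℚ), ρ.IsUnramifiedAt v →
        ∀ 𝔓 ∈ v.primesAbove, ∀ i ∈ 𝔓.inertia (Field.absoluteGaloisGroup ℚ), B i = 0) ∧
      (∀ v : HeightOneSpectrum (NumberField.RingOfIntegers ℚ), ((p : ℕ) : NumberField.RingOfIntegers ℚ) ∈ v.asIdeal →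
        ∃ (X₀ : Matrix (Fin 2) (Fin 2) k) (x₁ y₁ : Fin 2 → k), x₁ ≠ 0 ∧ y₁ ≠ 0 ∧
          (∀ τ ∈ absInertia (v.adicCompletion ℚ),
            (σ (absGaloisRestrict ℚ (v.adicCompletion ℚ) τ)).val *ᵥ x₁ = x₁) ∧
          (∀ τ ∈ absInertia (v.adicCompletion ℚ),
            (σ' (absGaloisRestrict ℚ (v.adicCompletion ℚ) τ)).val *ᵥ y₁ = y₁) ∧
          ∀ τ ∈ absInertia (v.adicCompletion ℚ),
            (B (absGaloisRestrict ℚ (v.adicCompletion ℚ) τ) -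
              ((σ (absGaloisRestrict ℚ (v.adicCompletion ℚ) τ)).val * X₀ -
                X₀ * (σ' (absGaloisRestrict ℚ (v.adicCompletion ℚ) τ)).val)) *ᵥ y₁ = 0) :=
  Fibre.stub_realisedClassSelmer

/-- **STUB K2 `stub_selmerAnchorRel_of_rankOne`** (rev 11, the lead's assembly): THE ANCHOR IS DISCHARGED ON SELMER-RANK-ONE DATA.
On an admissible fibre (`σ̄, σ̄'` irreducible, non-conjugate, `DetC`) carrying the crux's anchor `ρ₀` (irreducible, `Sh`, `Aut`), let the
non-trivial class `B` be realised by an `Sh`-point `ρ`, and let `S` be a set of places outside which `ρ` and `ρ₀` are unramified.  IF the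
Greenberg–Selmer cocycles with ramification inside `S` — 1-cocycles for `Hom(σ̄', σ̄)`, locally constant, vanishing on the inertia groups
above every `v ∉ S`, Greenberg at every `v ∣ p` — that are not coboundaries are pairwise PROJECTIVELY EQUAL modulo coboundaries
(the rank-one regime of Berger–Klosin 2013 §10, now a hypothesis on `(σ̄, σ̄', S)` only), THEN the anchor stub's conclusion holds for
`B`, with `ρ₁ := ρ₀` (Klingen parameter `c = 1`): Ribet R1a for `ρ₀`, K3 for both realisers, rank one, p148691. [folklore] -/
theorem stub_selmerAnchorRel_of_rankOne :
    ∀ (p : ℕ) [Fact p.Prime], p ≠ 2 → ∀ (k : Type) [Field k] [CharP k p] [IsAlgClosed k]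
    [TopologicalSpace k] [DiscreteTopology k] (red : Valued.integer (PadicAlgCl p) →+* k)
    (σ σ' : FramedGaloisRep ℚ k 2) (hcpt : isCompact_glFiniteIntegralLevel 4 ℚ) (ι : PadicAlgCl p ≃+* ℂ)
    (ρ₀ ρ : FramedGaloisRep ℚ (PadicAlgCl p) 4) (B : Field.absoluteGaloisGroup ℚ → Matrix (Fin 2) (Fin 2) k)
    (S : Set (HeightOneSpectrum (NumberField.RingOfIntegers ℚ))),
    σ.toGaloisRep.IsIrreducible → σ'.toGaloisRep.IsIrreducible → DetC p k σ σ' →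
    (¬ ∃ g : GL (Fin 2) k, ∀ x, g * σ x * g⁻¹ = σ' x) →
    ρ₀.toGaloisRep.IsIrreducible → Sh p k red σ σ' ρ₀ → Aut p hcpt ι ρ₀ →
    (¬ ∃ X : Matrix (Fin 2) (Fin 2) k, ∀ g, B g = (σ g).val * X - X * (σ' g).val) →
    Sh p k red σ σ' ρ →
    (∃ (P : GL (Fin 4) (PadicAlgCl p))
        (rint : Field.absoluteGaloisGroup ℚ →* GL (Fin 4) (Valued.integer (PadicAlgCl p))) (h : GL (Fin 4) k),
        (∀ g, Matrix.GeneralLinearGroup.map (Valued.integer (PadicAlgCl p)).subtype (rint g) = P⁻¹ * ρ g * P) ∧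
        (∀ g, (Matrix.GeneralLinearGroup.map red (rint g)).val =
          h.val * Matrix.reindex finSumFinEquiv finSumFinEquiv
            (Matrix.fromBlocks (σ g).val (B g) 0 (σ' g).val) * (h⁻¹).val)) →
    (∀ v ∉ S, ρ.IsUnramifiedAt v ∧ ρ₀.IsUnramifiedAt v) →
    (∀ B₁ B₂ : Field.absoluteGaloisGroup ℚ → Matrix (Fin 2) (Fin 2) k,
      (∀ g g', B₁ (g * g') = (σ g).val * B₁ g' + B₁ g * (σ' g').val) →
      (∀ g g', B₂ (g * g') = (σ g).val * B₂ g' + B₂ g * (σ' g').val) →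
      IsLocallyConstant B₁ → IsLocallyConstant B₂ →
      (∀ v ∉ S, ∀ 𝔓 ∈ v.primesAbove, ∀ i ∈ 𝔓.inertia (Field.absoluteGaloisGroup ℚ), B₁ i = 0 ∧ B₂ i = 0) →
      (∀ v : HeightOneSpectrum (NumberField.RingOfIntegers ℚ), ((p : ℕ) : NumberField.RingOfIntegers ℚ) ∈ v.asIdeal →
        (∃ (X₀ : Matrix (Fin 2) (Fin 2) k) (x₁ y₁ : Fin 2 → k), x₁ ≠ 0 ∧ y₁ ≠ 0 ∧
          (∀ τ ∈ absInertia (v.adicCompletion ℚ),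
            (σ (absGaloisRestrict ℚ (v.adicCompletion ℚ) τ)).val *ᵥ x₁ = x₁) ∧
          (∀ τ ∈ absInertia (v.adicCompletion ℚ),
            (σ' (absGaloisRestrict ℚ (v.adicCompletion ℚ) τ)).val *ᵥ y₁ = y₁) ∧
          ∀ τ ∈ absInertia (v.adicCompletion ℚ),
            (B₁ (absGaloisRestrict ℚ (v.adicCompletion ℚ) τ) -
              ((σ (absGaloisRestrict ℚ (v.adicCompletion ℚ) τ)).val * X₀ -
                X₀ * (σ' (absGaloisRestrict ℚ (v.adicCompletion ℚ) τ)).val)) *ᵥ y₁ = 0) ∧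
        (∃ (X₀ : Matrix (Fin 2) (Fin 2) k) (x₁ y₁ : Fin 2 → k), x₁ ≠ 0 ∧ y₁ ≠ 0 ∧
          (∀ τ ∈ absInertia (v.adicCompletion ℚ),
            (σ (absGaloisRestrict ℚ (v.adicCompletion ℚ) τ)).val *ᵥ x₁ = x₁) ∧
          (∀ τ ∈ absInertia (v.adicCompletion ℚ),
            (σ' (absGaloisRestrict ℚ (v.adicCompletion ℚ) τ)).val *ᵥ y₁ = y₁) ∧
          ∀ τ ∈ absInertia (v.adicCompletion ℚ),
            (B₂ (absGaloisRestrict ℚ (v.adicCompletion ℚ) τ) -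
              ((σ (absGaloisRestrict ℚ (v.adicCompletion ℚ) τ)).val * X₀ -
                X₀ * (σ' (absGaloisRestrict ℚ (v.adicCompletion ℚ) τ)).val)) *ᵥ y₁ = 0)) →
      (¬ ∃ X : Matrix (Fin 2) (Fin 2) k, ∀ g, B₁ g = (σ g).val * X - X * (σ' g).val) →
      (¬ ∃ X : Matrix (Fin 2) (Fin 2) k, ∀ g, B₂ g = (σ g).val * X - X * (σ' g).val) →
      ∃ (c : kˣ) (X : Matrix (Fin 2) (Fin 2) k), ∀ g, B₂ g = (c : k) • B₁ g + ((σ g).val * X - X * (σ' g).val)) →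
    ∃ ρ₁ : FramedGaloisRep ℚ (PadicAlgCl p) 4, ρ₁.toGaloisRep.IsIrreducible ∧ Aut p hcpt ι ρ₁ ∧
      (∃ c : ℕ, (c : ZMod (p - 1)) = 1 ∧
        (∃ ν : Field.absoluteGaloisGroup ℚ → PadicAlgCl p, ρ₁.IsSymplecticWithMultiplierFun ν) ∧
        ∀ v : HeightOneSpectrum (NumberField.RingOfIntegers ℚ), ((p : ℕ) : NumberField.RingOfIntegers ℚ) ∈ v.asIdeal →
          ρ₁.IsGreenbergOrdinaryOfShapeAt v ![0, 0, c, c] ∧ ρ₁.IsResiduallyDistinguishedAt v ![0, 0, c, c]) ∧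
      ∃ (P : GL (Fin 4) (PadicAlgCl p))
        (rint : Field.absoluteGaloisGroup ℚ →* GL (Fin 4) (Valued.integer (PadicAlgCl p))) (h : GL (Fin 4) k),
        (∀ g, Matrix.GeneralLinearGroup.map (Valued.integer (PadicAlgCl p)).subtype (rint g) = P⁻¹ * ρ₁ g * P) ∧
        (∀ g, (Matrix.GeneralLinearGroup.map red (rint g)).val =
          h.val * Matrix.reindex finSumFinEquiv finSumFinEquiv
            (Matrix.fromBlocks (σ g).val (B g) 0 (σ' g).val) * (h⁻¹).val) :=
  Fibre.stub_selmerAnchorRel_of_rankOne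

/-! ## Rev 13 (lead c5-0, 2026-08-17): THE SYMPLECTIC STRUCTURE OF THE REALISED CLASS, the decomposition-group Greenberg
condition, and the Berger–Klosin criterion — registered sub-goals

(D) ADJUGATE DUALITY OF ORIENTATIONS.  For `2 × 2` matrices `adj B = J₂⁻¹ Bᵀ J₂` is `k`-linear, and for a pair `(σ̄, σ̄')` with a
common determinant `d` the map `B ↦ B'`, `B'(g) = -d(g)⁻¹ · σ̄'(g) · adj(B(g)) · σ̄(g)`, is a `k`-linear involution carrying
`Hom(σ̄', σ̄)`-cocycles to `Hom(σ̄, σ̄')`-cocycles and coboundaries to coboundaries (D2 `stub_adjugateDualCocycle`); the DUAL integral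
frame `ν · rint⁻ᵀ` of a symplectic realiser of `B` realises `B'` in the OPPOSITE orientation `(σ̄' sub, σ̄ quotient)`
(D1 `stub_dualFrameRealisation`); with uniqueness (p142701) the two Ribet invariants of an `Sh`-point are ONE projective class
(D3 `stub_realisedClassesDual`) — the Galois shadow of "one Selmer group governs the polarized deformation problem" (Berger–Klosin).
(G) THE RESIDUAL GRAM FORM.  A non-split `(σ̄, B; 0, σ̄')` on a non-twist pair preserves NO non-degenerate alternating form, for any
multiplier (G1 `stub_nonsplitNotSymplectic`, from T6 p155154); the Gram matrix `Pᵀ J P` of a symplectic integral frame rescales to a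
primitive integral invariant alternating `G₀` with unit multiplier and non-zero reduction (G2 `stub_residualGramForm`); its radical is
EXACTLY the `σ̄`-plane (G3 `stub_residualGramRadical`, from G1 + the trichotomy p152467): the residual representation of the Ribet
lattice is never `GSp₄(k)`-valued — the deformation problem behind R1d/R3 is the POLARIZED one (`tr ρ = tr ν ρ⁻ᵀ`), not a
`GSp₄`-valued one.
(N1⁺) `stub_greenbergStablePlane`: the Greenberg condition of the realised class for the whole DECOMPOSITION group at `v ∣ p` — `G_v`-stable
lines `ℓ = k x₁ ⊆ σ̄`, `ℓ' = k y₁ ⊆ σ̄'`, the modified cocycle maps `ℓ'` into `ℓ` on `G_v`, kills `ℓ'` on `I_v` and maps ALL of `σ̄'`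
into `ℓ` on `I_v` (inertia is scalar on the weight-`1` block) = the residual Siegel-ordinary condition of shape `(0,0,1,1)` defining
`R^{Sh}(ρ̄_B)`; then K3⁺ `stub_realisedClassSelmerDec` and K2⁺ `stub_selmerAnchorRel_of_rankOneDec` (the anchor discharged on rank one
of the smaller, correct Greenberg–Selmer space — strictly stronger than K2 p161389).
(BK) `stub_bergerKlosinCriterion`: the commutative-algebra `R = T` criterion of Berger–Klosin 2013 (principal `I = (x)` inside the
Jacobson radical, `φ(x)` a non-zero-divisor, `#R/I ≤ #T/φ(I)T < ∞` ⇒ `φ : R ↠ T` is bijective) — the engine of R3 on the rank-one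
sub-sector, where no Taylor–Wiles primes exist (census F1). -/

/-- **STUB D2 `stub_adjugateDualCocycle`** (rev 13): for a pair `σ̄, σ̄' : Γ → GL₂(k)` with a COMMON determinant `d`, the adjugate
duality `D B (g) = -d(g)⁻¹ • (σ̄'(g) · adj(B g) · σ̄(g))` and its mirror `D'` (roles of `σ̄, σ̄'` exchanged) are mutually inverse
`k`-linear maps; `D` carries `Hom(σ̄', σ̄)`-valued 1-cocycles (`B(gg') = σ̄ g B g' + B g σ̄' g'`) to `Hom(σ̄, σ̄')`-valued ones and
`B` is a coboundary `σ̄ X - X σ̄'` iff `D B` is a coboundary `σ̄' X' - X' σ̄` (`adj` is linear and anti-multiplicative on `M₂`,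
`adj S = d · S⁻¹`, `adj (adj B) = B`). [folklore] -/
theorem stub_adjugateDualCocycle :
    ∀ (k : Type) [Field k] (Γ : Type) [Group Γ] (σ σ' : Γ →* GL (Fin 2) k) (d : Γ → kˣ),
      (∀ g, (σ g).val.det = d g) → (∀ g, (σ' g).val.det = d g) →
      ∀ (D D' : (Γ → Matrix (Fin 2) (Fin 2) k) → Γ → Matrix (Fin 2) (Fin 2) k),
      (∀ B g, D B g = -(((d g)⁻¹ : kˣ) : k) • ((σ' g).val * (B g).adjugate * (σ g).val)) →
      (∀ B g, D' B g = -(((d g)⁻¹ : kˣ) : k) • ((σ g).val * (B g).adjugate * (σ' g).val)) →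
      (∀ B, D' (D B) = B) ∧ (∀ B, D (D' B) = B) ∧
      (∀ (B₁ B₂ : Γ → Matrix (Fin 2) (Fin 2) k) (c : k), D (c • B₁ + B₂) = c • D B₁ + D B₂) ∧
      (∀ B : Γ → Matrix (Fin 2) (Fin 2) k,
        (∀ g g', B (g * g') = (σ g).val * B g' + B g * (σ' g').val) →
        ∀ g g', D B (g * g') = (σ' g).val * D B g' + D B g * (σ g').val) ∧
      (∀ B : Γ → Matrix (Fin 2) (Fin 2) k,
        (∃ X : Matrix (Fin 2) (Fin 2) k, ∀ g, B g = (σ g).val * X - X * (σ' g).val) ↔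
        (∃ X : Matrix (Fin 2) (Fin 2) k, ∀ g, D B g = (σ' g).val * X - X * (σ g).val)) :=
  Fibre.stub_adjugateDualCocycle

/-- **STUB D1 `stub_dualFrameRealisation`** (rev 13): let `rint = P⁻¹ r P` be an integral frame of `r : Γ → GL₄(ℚ̄_p)` reducing
through `red` to `h (σ̄, B; 0, σ̄') h⁻¹`, let `r` be symplectic, `r(g)ᵀ J r(g) = ν(g) J` (`J` alternating invertible over `ℚ̄_p`),
and let the multiplier be integral with reduction the common determinant `d` of `σ̄, σ̄'` (supplied by p149860
`stub_realiserMultiplierResidual`).  Then the DUAL frame `rint₂ := ν · rint⁻ᵀ` (conjugator `P₂ = J⁻¹ P⁻ᵀ`) is an integral frame of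
the SAME `r` whose reduction is `h₂ (σ̄', B'; 0, σ̄) h₂⁻¹` in the OPPOSITE orientation, with the adjugate-dual cocycle
`B'(g) = -d(g)⁻¹ • σ̄'(g) adj(B g) σ̄(g)` (`M⁻ᵀ = (S⁻ᵀ, 0; -S'⁻ᵀ Bᵀ S⁻ᵀ, S'⁻ᵀ)`, `d · S⁻ᵀ = J₂ S J₂⁻¹`, `J₂⁻¹ Bᵀ J₂ = adj B`,
block swap). [folklore] -/
theorem stub_dualFrameRealisation :
    ∀ (p : ℕ) [Fact p.Prime] (k : Type) [Field k] (Γ : Type) [Group Γ]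
      (red : Valued.integer (PadicAlgCl p) →+* k) (σ σ' : Γ →* GL (Fin 2) k) (d : Γ → kˣ)
      (B : Γ → Matrix (Fin 2) (Fin 2) k)
      (r : Γ →* GL (Fin 4) (PadicAlgCl p)) (P : GL (Fin 4) (PadicAlgCl p))
      (rint : Γ →* GL (Fin 4) (Valued.integer (PadicAlgCl p))) (h : GL (Fin 4) k)
      (J : Matrix (Fin 4) (Fin 4) (PadicAlgCl p)) (ν : Γ → PadicAlgCl p),
      (∀ g, (σ g).val.det = d g) → (∀ g, (σ' g).val.det = d g) →
      (∀ g, Matrix.GeneralLinearGroup.map (Valued.integer (PadicAlgCl p)).subtype (rint g) = P⁻¹ * r g * P) →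
      (∀ g, (Matrix.GeneralLinearGroup.map red (rint g)).val =
          h.val * Matrix.reindex finSumFinEquiv finSumFinEquiv
            (Matrix.fromBlocks (σ g).val (B g) 0 (σ' g).val) * (h⁻¹).val) →
      Jᵀ = -J → J.det ≠ 0 → (∀ g, (r g).valᵀ * J * (r g).val = ν g • J) →
      (∀ g, ∃ u : Valued.integer (PadicAlgCl p), (u : PadicAlgCl p) = ν g ∧ red u = d g) →
      ∃ (P₂ : GL (Fin 4) (PadicAlgCl p))
        (rint₂ : Γ →* GL (Fin 4) (Valued.integer (PadicAlgCl p))) (h₂ : GL (Fin 4) k),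
        (∀ g, Matrix.GeneralLinearGroup.map (Valued.integer (PadicAlgCl p)).subtype (rint₂ g) = P₂⁻¹ * r g * P₂) ∧
        (∀ g, (Matrix.GeneralLinearGroup.map red (rint₂ g)).val =
          h₂.val * Matrix.reindex finSumFinEquiv finSumFinEquiv
            (Matrix.fromBlocks (σ' g).val
              (-(((d g)⁻¹ : kˣ) : k) • ((σ' g).val * (B g).adjugate * (σ g).val)) 0 (σ g).val) * (h₂⁻¹).val) :=
  Fibre.stub_dualFrameRealisation

/-- **STUB G1 `stub_nonsplitNotSymplectic`** (rev 13): a NON-split block representation `h (σ̄, B; 0, σ̄') h⁻¹` of a NON-TWIST pair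
(`σ̄'` is no pointwise-scalar twist of a conjugate of `σ̄`) preserves NO non-degenerate alternating form of `k⁴` up to any scalar
function `μ` (`char k ≠ 2`): by the symplectic block dichotomy T6 (p155154) the `σ̄`-plane would be Lagrangian — then
`σ̄' = μ d⁻¹ · X⁻¹ J₂ σ̄ J₂⁻¹ X`, a scalar twist of a conjugate — or complemented — then `B = σ̄ (-Z) - (-Z) σ̄'`, a coboundary.
So the residual representation of a Ribet lattice is never `GSp₄(k)`-valued. [folklore] -/
theorem stub_nonsplitNotSymplectic :
    ∀ (k : Type) [Field k], (2 : k) ≠ 0 → ∀ (Γ : Type) [Group Γ] (σ σ' : Γ →* GL (Fin 2) k),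
      (¬ ∃ g : GL (Fin 2) k, ∀ x, ∃ c : k, (g * σ x * g⁻¹).val = c • (σ' x).val) →
      ∀ (B : Γ → Matrix (Fin 2) (Fin 2) k),
      (¬ ∃ X : Matrix (Fin 2) (Fin 2) k, ∀ g, B g = (σ g).val * X - X * (σ' g).val) →
      ∀ (h : GL (Fin 4) k) (G : Matrix (Fin 4) (Fin 4) k) (μ : Γ → k), Gᵀ = -G → G.det ≠ 0 →
      ¬ ∀ g, (h.val * Matrix.reindex finSumFinEquiv finSumFinEquiv (Matrix.fromBlocks (σ g).val (B g) 0 (σ' g).val) *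
              (h⁻¹).val)ᵀ * G *
            (h.val * Matrix.reindex finSumFinEquiv finSumFinEquiv (Matrix.fromBlocks (σ g).val (B g) 0 (σ' g).val) *
              (h⁻¹).val) = μ g • G :=
  Fibre.stub_nonsplitNotSymplectic

/-- **STUB G2 `stub_residualGramForm`** (rev 13): the Gram matrix `Pᵀ J P` of a symplectic representation in an integral frame
`rint = P⁻¹ r P` rescales (by an entry of maximal norm, `exists_integral_rescale` p142701) to a PRIMITIVE INTEGRAL alternating `G₀`
(some entry `= 1`, so `red G₀ ≠ 0`), invariant under `rint` with the same multiplier, which is therefore integral (read off the unit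
entry) and a unit (`ν⁴ det G₀ = det(rint)² det G₀`). [folklore] -/
theorem stub_residualGramForm :
    ∀ (p : ℕ) [Fact p.Prime] (k : Type) [Field k] (Γ : Type) [Group Γ]
      (red : Valued.integer (PadicAlgCl p) →+* k)
      (r : Γ →* GL (Fin 4) (PadicAlgCl p)) (P : GL (Fin 4) (PadicAlgCl p))
      (rint : Γ →* GL (Fin 4) (Valued.integer (PadicAlgCl p)))
      (J : Matrix (Fin 4) (Fin 4) (PadicAlgCl p)) (ν : Γ → PadicAlgCl p),
      (∀ g, Matrix.GeneralLinearGroup.map (Valued.integer (PadicAlgCl p)).subtype (rint g) = P⁻¹ * r g * P) →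
      Jᵀ = -J → J.det ≠ 0 → (∀ g, (r g).valᵀ * J * (r g).val = ν g • J) →
      ∃ (G₀ : Matrix (Fin 4) (Fin 4) (Valued.integer (PadicAlgCl p))) (q : PadicAlgCl p)
        (νi : Γ → Valued.integer (PadicAlgCl p)),
        q ≠ 0 ∧ G₀.map (Valued.integer (PadicAlgCl p)).subtype = q⁻¹ • (P.valᵀ * J * P.val) ∧
        G₀ᵀ = -G₀ ∧ G₀.map red ≠ 0 ∧ (∀ g, ((νi g : Valued.integer (PadicAlgCl p)) : PadicAlgCl p) = ν g) ∧
        (∀ g, IsUnit (νi g)) ∧ ∀ g, (rint g).valᵀ * G₀ * (rint g).val = νi g • G₀ :=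
  Fibre.stub_residualGramForm

/-- **STUB G3 `stub_residualGramRadical`** (rev 13, assembly of G1 + the trichotomy p152467): for an integral frame `rint` realising the
NON-trivial class `B` of a NON-twist pair with irreducible constituents (`char k = p ≠ 2`), preserving the alternating integral `G₀`
with unit multiplier and `red G₀ ≠ 0` (G2), the RADICAL of the residual Gram form `red G₀` is EXACTLY the `σ̄`-plane `h (k² ⊕ 0)`:
it is a stable subspace (`Ḡ₀ M̄ x = ν̄ M̄⁻ᵀ Ḡ₀ x`), proper (`Ḡ₀ ≠ 0`), non-zero (G1), hence the `σ̄`-plane (trichotomy). [folklore] -/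
theorem stub_residualGramRadical :
    ∀ (p : ℕ) [Fact p.Prime], p ≠ 2 → ∀ (k : Type) [Field k] [CharP k p] (Γ : Type) [Group Γ]
      (red : Valued.integer (PadicAlgCl p) →+* k) (σ σ' : Γ →* GL (Fin 2) k),
      Representation.IsIrreducible ((glStdRepresentation (Fin 2) k).comp σ) →
      Representation.IsIrreducible ((glStdRepresentation (Fin 2) k).comp σ') →
      (¬ ∃ g : GL (Fin 2) k, ∀ x, ∃ c : k, (g * σ x * g⁻¹).val = c • (σ' x).val) →
      ∀ (B : Γ → Matrix (Fin 2) (Fin 2) k),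
      (¬ ∃ X : Matrix (Fin 2) (Fin 2) k, ∀ g, B g = (σ g).val * X - X * (σ' g).val) →
      ∀ (rint : Γ →* GL (Fin 4) (Valued.integer (PadicAlgCl p))) (h : GL (Fin 4) k),
      (∀ g, (Matrix.GeneralLinearGroup.map red (rint g)).val =
          h.val * Matrix.reindex finSumFinEquiv finSumFinEquiv
            (Matrix.fromBlocks (σ g).val (B g) 0 (σ' g).val) * (h⁻¹).val) →
      ∀ (G₀ : Matrix (Fin 4) (Fin 4) (Valued.integer (PadicAlgCl p))) (νi : Γ → Valued.integer (PadicAlgCl p)),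
      G₀ᵀ = -G₀ → G₀.map red ≠ 0 → (∀ g, IsUnit (νi g)) →
      (∀ g, (rint g).valᵀ * G₀ * (rint g).val = νi g • G₀) →
      ∀ x : Fin 4 → k, G₀.map red *ᵥ x = 0 ↔
        ∃ a : Fin 2 → k, x = h.val *ᵥ fun i => Sum.elim a 0 ((finSumFinEquiv (m := 2) (n := 2)).symm i) :=
  Fibre.stub_residualGramRadical

/-- **STUB N1⁺ `stub_greenbergStablePlane`** (rev 13; the DECOMPOSITION-GROUP Greenberg condition, strengthening N1 p157554): for an
`Sh`-point `ρ` realising `B` through the integral frame `(P, rint)` with reduction conjugator `h`, on a `DetC` fibre (`p ≠ 2`), at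
`v ∣ p`: there are lines `k x₁ ⊆ σ̄`, `k y₁ ⊆ σ̄'` STABLE under the decomposition group `G_v` and FIXED by inertia `I_v`, and a
coboundary correction `X₀`, such that the corrected cocycle `B̃ = B - δX₀` maps `y₁` into `k x₁` on all of `G_v`, kills `y₁` on `I_v`,
and maps ALL of `σ̄'` into `k x₁` on `I_v` (the Greenberg plane of `Sh ρ` is `G_v`-stable with inertia trivial on it and SCALAR on the
quotient; saturate by T4, reduce, read off in the basis `(x₁,0), (x₂,y₁)`).  This is the residual Siegel-ordinary local condition of
shape `(0,0,1,1)` on the class `[B|_{G_v}]`. [folklore] -/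
theorem stub_greenbergStablePlane :
    ∀ (p : ℕ) [Fact p.Prime], p ≠ 2 → ∀ (k : Type) [Field k] [CharP k p] [IsAlgClosed k]
      [TopologicalSpace k] [DiscreteTopology k] (red : Valued.integer (PadicAlgCl p) →+* k)
      (σ σ' : FramedGaloisRep ℚ k 2) (ρ : FramedGaloisRep ℚ (PadicAlgCl p) 4)
      (P : GL (Fin 4) (PadicAlgCl p))
      (rint : Field.absoluteGaloisGroup ℚ →* GL (Fin 4) (Valued.integer (PadicAlgCl p))) (h : GL (Fin 4) k)
      (B : Field.absoluteGaloisGroup ℚ → Matrix (Fin 2) (Fin 2) k)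
      (v : HeightOneSpectrum (NumberField.RingOfIntegers ℚ)),
      ((p : ℕ) : NumberField.RingOfIntegers ℚ) ∈ v.asIdeal → DetC p k σ σ' → Sh p k red σ σ' ρ →
      (∀ g, Matrix.GeneralLinearGroup.map (Valued.integer (PadicAlgCl p)).subtype (rint g) = P⁻¹ * ρ g * P) →
      (∀ g, (Matrix.GeneralLinearGroup.map red (rint g)).val =
          h.val * Matrix.reindex finSumFinEquiv finSumFinEquiv
            (Matrix.fromBlocks (σ g).val (B g) 0 (σ' g).val) * (h⁻¹).val) →
      ∃ (X₀ : Matrix (Fin 2) (Fin 2) k) (x₁ y₁ : Fin 2 → k), x₁ ≠ 0 ∧ y₁ ≠ 0 ∧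
        (∀ τ : Field.absoluteGaloisGroup (v.adicCompletion ℚ), ∃ a : k,
          (σ (absGaloisRestrict ℚ (v.adicCompletion ℚ) τ)).val *ᵥ x₁ = a • x₁) ∧
        (∀ τ : Field.absoluteGaloisGroup (v.adicCompletion ℚ), ∃ b : k,
          (σ' (absGaloisRestrict ℚ (v.adicCompletion ℚ) τ)).val *ᵥ y₁ = b • y₁) ∧
        (∀ τ : Field.absoluteGaloisGroup (v.adicCompletion ℚ), ∃ c : k,
          (B (absGaloisRestrict ℚ (v.adicCompletion ℚ) τ) -
            ((σ (absGaloisRestrict ℚ (v.adicCompletion ℚ) τ)).val * X₀ -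
              X₀ * (σ' (absGaloisRestrict ℚ (v.adicCompletion ℚ) τ)).val)) *ᵥ y₁ = c • x₁) ∧
        (∀ τ ∈ absInertia (v.adicCompletion ℚ),
          (σ (absGaloisRestrict ℚ (v.adicCompletion ℚ) τ)).val *ᵥ x₁ = x₁) ∧
        (∀ τ ∈ absInertia (v.adicCompletion ℚ),
          (σ' (absGaloisRestrict ℚ (v.adicCompletion ℚ) τ)).val *ᵥ y₁ = y₁) ∧
        (∀ τ ∈ absInertia (v.adicCompletion ℚ),
          (B (absGaloisRestrict ℚ (v.adicCompletion ℚ) τ) -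
            ((σ (absGaloisRestrict ℚ (v.adicCompletion ℚ) τ)).val * X₀ -
              X₀ * (σ' (absGaloisRestrict ℚ (v.adicCompletion ℚ) τ)).val)) *ᵥ y₁ = 0) ∧
        ∀ τ ∈ absInertia (v.adicCompletion ℚ), ∀ y : Fin 2 → k, ∃ c : k,
          (B (absGaloisRestrict ℚ (v.adicCompletion ℚ) τ) -
            ((σ (absGaloisRestrict ℚ (v.adicCompletion ℚ) τ)).val * X₀ -
              X₀ * (σ' (absGaloisRestrict ℚ (v.adicCompletion ℚ) τ)).val)) *ᵥ y = c • x₁ :=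
  Fibre.stub_greenbergStablePlane

/-- **STUB BK `stub_bergerKlosinCriterion`** (rev 13): THE BERGER–KLOSIN COMMUTATIVE-ALGEBRA `R = T` CRITERION.  Let `φ : R ↠ S` be a
surjection of commutative rings, `R` Noetherian, and `x ∈ R` in the Jacobson radical with `φ(x)` a non-zero-divisor of `S`.  If
`R/(x)` is finite and `#R/(x) ≤ #S/(φ x)`, then `φ` is an isomorphism: the surjection `R/(x) ↠ S/(φ x) = R/((x) + ker φ)` of finite sets
of the same size forces `ker φ ⊆ (x)`, then `ker φ = x · ker φ` (`φ x` regular), and Nakayama.  In Berger–Klosin, `x` generates the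
(principal) reducibility ideal of the universal deformation ring and `#S/(φ x)` is a congruence-module lower bound — no Taylor–Wiles
primes are used. [cite: BergerKlosin2013, §4 (the commutative algebra criterion, Thm. 4.1)] -/
theorem stub_bergerKlosinCriterion :
    ∀ (R S : Type) [CommRing R] [CommRing S] [IsNoetherianRing R] (φ : R →+* S) (x : R),
      Function.Surjective φ → x ∈ (⊥ : Ideal R).jacobson → φ x ∈ nonZeroDivisors S →
      Finite (R ⧸ Ideal.span ({x} : Set R)) →
      Nat.card (R ⧸ Ideal.span ({x} : Set R)) ≤ Nat.card (S ⧸ Ideal.span ({φ x} : Set S)) →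
      Function.Bijective φ :=
  Fibre.stub_bergerKlosinCriterion

/-- **STUB K3⁺ `stub_realisedClassSelmerDec`** (rev 13; K3 p160559 with the decomposition-group Greenberg condition N1⁺): the cocycle `B`
realised by an `Sh`-point `ρ` on a `DetC` fibre is a GREENBERG–SELMER cocycle for the ramification of `ρ` in the strong sense:
1-cocycle, locally constant, vanishing on the inertia groups above every place where `ρ` is unramified, and at every `v ∣ p` in the
Siegel-ordinary local condition of N1⁺ (bundle of p151532, K1 p160312, p145853, N1⁺). [folklore] -/
theorem stub_realisedClassSelmerDec :
    ∀ (p : ℕ) [Fact p.Prime], p ≠ 2 → ∀ (k : Type) [Field k] [CharP k p] [IsAlgClosed k]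
      [TopologicalSpace k] [DiscreteTopology k] (red : Valued.integer (PadicAlgCl p) →+* k)
      (σ σ' : FramedGaloisRep ℚ k 2) (ρ : FramedGaloisRep ℚ (PadicAlgCl p) 4)
      (P : GL (Fin 4) (PadicAlgCl p)) (rint : Field.absoluteGaloisGroup ℚ →* GL (Fin 4) (Valued.integer (PadicAlgCl p)))
      (h : GL (Fin 4) k) (B : Field.absoluteGaloisGroup ℚ → Matrix (Fin 2) (Fin 2) k),
      DetC p k σ σ' → Sh p k red σ σ' ρ →
      (∀ g, Matrix.GeneralLinearGroup.map (Valued.integer (PadicAlgCl p)).subtype (rint g) = P⁻¹ * ρ g * P) →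
      (∀ g, (Matrix.GeneralLinearGroup.map red (rint g)).val =
        h.val * Matrix.reindex finSumFinEquiv finSumFinEquiv (Matrix.fromBlocks (σ g).val (B g) 0 (σ' g).val) * (h⁻¹).val) →
      (∀ g g', B (g * g') = (σ g).val * B g' + B g * (σ' g').val) ∧ IsLocallyConstant B ∧
      (∀ v : HeightOneSpectrum (NumberField.RingOfIntegers ℚ), ρ.IsUnramifiedAt v →
        ∀ 𝔓 ∈ v.primesAbove, ∀ i ∈ 𝔓.inertia (Field.absoluteGaloisGroup ℚ), B i = 0) ∧
      (∀ v : HeightOneSpectrum (NumberField.RingOfIntegers ℚ), ((p : ℕ) : NumberField.RingOfIntegers ℚ) ∈ v.asIdeal →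
        ∃ (X₀ : Matrix (Fin 2) (Fin 2) k) (x₁ y₁ : Fin 2 → k), x₁ ≠ 0 ∧ y₁ ≠ 0 ∧
          (∀ τ : Field.absoluteGaloisGroup (v.adicCompletion ℚ), ∃ a : k,
            (σ (absGaloisRestrict ℚ (v.adicCompletion ℚ) τ)).val *ᵥ x₁ = a • x₁) ∧
          (∀ τ : Field.absoluteGaloisGroup (v.adicCompletion ℚ), ∃ b : k,
            (σ' (absGaloisRestrict ℚ (v.adicCompletion ℚ) τ)).val *ᵥ y₁ = b • y₁) ∧
          (∀ τ : Field.absoluteGaloisGroup (v.adicCompletion ℚ), ∃ c : k,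
            (B (absGaloisRestrict ℚ (v.adicCompletion ℚ) τ) -
              ((σ (absGaloisRestrict ℚ (v.adicCompletion ℚ) τ)).val * X₀ -
                X₀ * (σ' (absGaloisRestrict ℚ (v.adicCompletion ℚ) τ)).val)) *ᵥ y₁ = c • x₁) ∧
          (∀ τ ∈ absInertia (v.adicCompletion ℚ),
            (σ (absGaloisRestrict ℚ (v.adicCompletion ℚ) τ)).val *ᵥ x₁ = x₁) ∧
          (∀ τ ∈ absInertia (v.adicCompletion ℚ),
            (σ' (absGaloisRestrict ℚ (v.adicCompletion ℚ) τ)).val *ᵥ y₁ = y₁) ∧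
          (∀ τ ∈ absInertia (v.adicCompletion ℚ),
            (B (absGaloisRestrict ℚ (v.adicCompletion ℚ) τ) -
              ((σ (absGaloisRestrict ℚ (v.adicCompletion ℚ) τ)).val * X₀ -
                X₀ * (σ' (absGaloisRestrict ℚ (v.adicCompletion ℚ) τ)).val)) *ᵥ y₁ = 0) ∧
          ∀ τ ∈ absInertia (v.adicCompletion ℚ), ∀ y : Fin 2 → k, ∃ c : k,
            (B (absGaloisRestrict ℚ (v.adicCompletion ℚ) τ) -
              ((σ (absGaloisRestrict ℚ (v.adicCompletion ℚ) τ)).val * X₀ -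
                X₀ * (σ' (absGaloisRestrict ℚ (v.adicCompletion ℚ) τ)).val)) *ᵥ y = c • x₁) :=
  Fibre.stub_realisedClassSelmerDec

/-- **STUB K2⁺ `stub_selmerAnchorRel_of_rankOneDec`** (rev 13; K2 p161389 on the SMALLER Selmer space): on an admissible fibre carrying the
crux's anchor `ρ₀`, let the non-trivial class `B` be realised by an `Sh`-point `ρ`, and let `S` be a set of places outside which `ρ` and
`ρ₀` are unramified.  IF the cocycles that are Greenberg–Selmer in the strong (decomposition-group, N1⁺) sense with ramification inside `S`
and are not coboundaries are pairwise projectively equal modulo coboundaries (rank one of the CORRECT Greenberg–Selmer space — a weaker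
hypothesis than K2's), THEN the anchor stub's conclusion holds for `B` with `ρ₁ := ρ₀`: Ribet R1a for `ρ₀` + K3⁺ for both realisers +
p148691. [folklore] -/
theorem stub_selmerAnchorRel_of_rankOneDec :
    ∀ (p : ℕ) [Fact p.Prime], p ≠ 2 → ∀ (k : Type) [Field k] [CharP k p] [IsAlgClosed k]
    [TopologicalSpace k] [DiscreteTopology k] (red : Valued.integer (PadicAlgCl p) →+* k)
    (σ σ' : FramedGaloisRep ℚ k 2) (hcpt : isCompact_glFiniteIntegralLevel 4 ℚ) (ι : PadicAlgCl p ≃+* ℂ)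
    (ρ₀ ρ : FramedGaloisRep ℚ (PadicAlgCl p) 4) (B : Field.absoluteGaloisGroup ℚ → Matrix (Fin 2) (Fin 2) k)
    (S : Set (HeightOneSpectrum (NumberField.RingOfIntegers ℚ))),
    let GrDec := fun A (v : HeightOneSpectrum (NumberField.RingOfIntegers ℚ)) =>
      ∃ (X₀ : Matrix (Fin 2) (Fin 2) k) (x₁ y₁ : Fin 2 → k), x₁ ≠ 0 ∧ y₁ ≠ 0 ∧
        (∀ τ : Field.absoluteGaloisGroup (v.adicCompletion ℚ), ∃ a : k,
          (σ (absGaloisRestrict ℚ (v.adicCompletion ℚ) τ)).val *ᵥ x₁ = a • x₁) ∧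
        (∀ τ : Field.absoluteGaloisGroup (v.adicCompletion ℚ), ∃ b : k,
          (σ' (absGaloisRestrict ℚ (v.adicCompletion ℚ) τ)).val *ᵥ y₁ = b • y₁) ∧
        (∀ τ : Field.absoluteGaloisGroup (v.adicCompletion ℚ), ∃ c : k,
          (A (absGaloisRestrict ℚ (v.adicCompletion ℚ) τ) -
            ((σ (absGaloisRestrict ℚ (v.adicCompletion ℚ) τ)).val * X₀ -
              X₀ * (σ' (absGaloisRestrict ℚ (v.adicCompletion ℚ) τ)).val)) *ᵥ y₁ = c • x₁) ∧
        (∀ τ ∈ absInertia (v.adicCompletion ℚ),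
          (σ (absGaloisRestrict ℚ (v.adicCompletion ℚ) τ)).val *ᵥ x₁ = x₁) ∧
        (∀ τ ∈ absInertia (v.adicCompletion ℚ),
          (σ' (absGaloisRestrict ℚ (v.adicCompletion ℚ) τ)).val *ᵥ y₁ = y₁) ∧
        (∀ τ ∈ absInertia (v.adicCompletion ℚ),
          (A (absGaloisRestrict ℚ (v.adicCompletion ℚ) τ) -
            ((σ (absGaloisRestrict ℚ (v.adicCompletion ℚ) τ)).val * X₀ -
              X₀ * (σ' (absGaloisRestrict ℚ (v.adicCompletion ℚ) τ)).val)) *ᵥ y₁ = 0) ∧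
        ∀ τ ∈ absInertia (v.adicCompletion ℚ), ∀ y : Fin 2 → k, ∃ c : k,
          (A (absGaloisRestrict ℚ (v.adicCompletion ℚ) τ) -
            ((σ (absGaloisRestrict ℚ (v.adicCompletion ℚ) τ)).val * X₀ -
              X₀ * (σ' (absGaloisRestrict ℚ (v.adicCompletion ℚ) τ)).val)) *ᵥ y = c • x₁
    let Real := fun (r : FramedGaloisRep ℚ (PadicAlgCl p) 4) A =>
      ∃ (P : GL (Fin 4) (PadicAlgCl p))
        (rint : Field.absoluteGaloisGroup ℚ →* GL (Fin 4) (Valued.integer (PadicAlgCl p))) (h : GL (Fin 4) k),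
        (∀ g, Matrix.GeneralLinearGroup.map (Valued.integer (PadicAlgCl p)).subtype (rint g) = P⁻¹ * r g * P) ∧
        (∀ g, (Matrix.GeneralLinearGroup.map red (rint g)).val =
          h.val * Matrix.reindex finSumFinEquiv finSumFinEquiv
            (Matrix.fromBlocks (σ g).val (A g) 0 (σ' g).val) * (h⁻¹).val)
    σ.toGaloisRep.IsIrreducible → σ'.toGaloisRep.IsIrreducible → DetC p k σ σ' →
    (¬ ∃ g : GL (Fin 2) k, ∀ x, g * σ x * g⁻¹ = σ' x) →
    ρ₀.toGaloisRep.IsIrreducible → Sh p k red σ σ' ρ₀ → Aut p hcpt ι ρ₀ →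
    (¬ ∃ X : Matrix (Fin 2) (Fin 2) k, ∀ g, B g = (σ g).val * X - X * (σ' g).val) →
    Sh p k red σ σ' ρ → Real ρ B →
    (∀ v ∉ S, ρ.IsUnramifiedAt v ∧ ρ₀.IsUnramifiedAt v) →
    (∀ B₁ B₂ : Field.absoluteGaloisGroup ℚ → Matrix (Fin 2) (Fin 2) k,
      (∀ g g', B₁ (g * g') = (σ g).val * B₁ g' + B₁ g * (σ' g').val) →
      (∀ g g', B₂ (g * g') = (σ g).val * B₂ g' + B₂ g * (σ' g').val) →
      IsLocallyConstant B₁ → IsLocallyConstant B₂ →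
      (∀ v ∉ S, ∀ 𝔓 ∈ v.primesAbove, ∀ i ∈ 𝔓.inertia (Field.absoluteGaloisGroup ℚ), B₁ i = 0 ∧ B₂ i = 0) →
      (∀ v : HeightOneSpectrum (NumberField.RingOfIntegers ℚ), ((p : ℕ) : NumberField.RingOfIntegers ℚ) ∈ v.asIdeal →
        GrDec B₁ v ∧ GrDec B₂ v) →
      (¬ ∃ X : Matrix (Fin 2) (Fin 2) k, ∀ g, B₁ g = (σ g).val * X - X * (σ' g).val) →
      (¬ ∃ X : Matrix (Fin 2) (Fin 2) k, ∀ g, B₂ g = (σ g).val * X - X * (σ' g).val) →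
      ∃ (c : kˣ) (X : Matrix (Fin 2) (Fin 2) k), ∀ g, B₂ g = (c : k) • B₁ g + ((σ g).val * X - X * (σ' g).val)) →
    ∃ ρ₁ : FramedGaloisRep ℚ (PadicAlgCl p) 4, ρ₁.toGaloisRep.IsIrreducible ∧ Aut p hcpt ι ρ₁ ∧
      (∃ c : ℕ, (c : ZMod (p - 1)) = 1 ∧
        (∃ ν : Field.absoluteGaloisGroup ℚ → PadicAlgCl p, ρ₁.IsSymplecticWithMultiplierFun ν) ∧
        ∀ v : HeightOneSpectrum (NumberField.RingOfIntegers ℚ), ((p : ℕ) : NumberField.RingOfIntegers ℚ) ∈ v.asIdeal →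
          ρ₁.IsGreenbergOrdinaryOfShapeAt v ![0, 0, c, c] ∧ ρ₁.IsResiduallyDistinguishedAt v ![0, 0, c, c]) ∧
      Real ρ₁ B :=
  Fibre.stub_selmerAnchorRel_of_rankOneDec

/-- **STUB D3 `stub_realisedClassesDual`** (rev 13, the lead's assembly of D1 + D2 + p149860 + uniqueness p142701): THE TWO RIBET
INVARIANTS OF A SYMPLECTIC REALISER ARE ADJUGATE-DUAL.  On a non-twist pair with equal determinants and irreducible constituents
(`p ≠ 2`, `k` algebraically closed), let the symplectic `ρ` (any multiplier) realise the non-trivial class `B` in orientation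
`(σ̄ sub, σ̄' quotient)`.  Then (i) `ρ` realises the adjugate-dual cocycle `B'(g) = -(det σ̄ g)⁻¹ • σ̄'(g) adj(B g) σ̄(g)` in the
OPPOSITE orientation, (ii) `B'` is not a coboundary there, and (iii) every non-trivial class realised by `ρ` in the opposite
orientation is projectively `B'` modulo coboundaries: the invariant of `ρ` is ONE projective class, read in either orientation.
[folklore] -/
theorem stub_realisedClassesDual :
    ∀ (p : ℕ) [Fact p.Prime], p ≠ 2 → ∀ (k : Type) [Field k] [CharP k p] [IsAlgClosed k]
      [TopologicalSpace k] [DiscreteTopology k] (red : Valued.integer (PadicAlgCl p) →+* k)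
      (σ σ' : FramedGaloisRep ℚ k 2) (ρ : FramedGaloisRep ℚ (PadicAlgCl p) 4)
      (B : Field.absoluteGaloisGroup ℚ → Matrix (Fin 2) (Fin 2) k) (ν : Field.absoluteGaloisGroup ℚ → PadicAlgCl p),
      σ.toGaloisRep.IsIrreducible → σ'.toGaloisRep.IsIrreducible →
      (∀ x, (σ' x).val.det = (σ x).val.det) →
      (¬ ∃ g : GL (Fin 2) k, ∀ x, ∃ c : k, (g * σ x * g⁻¹).val = c • (σ' x).val) →
      (¬ ∃ X : Matrix (Fin 2) (Fin 2) k, ∀ g, B g = (σ g).val * X - X * (σ' g).val) →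
      ρ.IsSymplecticWithMultiplierFun ν →
      (∃ (P : GL (Fin 4) (PadicAlgCl p))
        (rint : Field.absoluteGaloisGroup ℚ →* GL (Fin 4) (Valued.integer (PadicAlgCl p))) (h : GL (Fin 4) k),
        (∀ g, Matrix.GeneralLinearGroup.map (Valued.integer (PadicAlgCl p)).subtype (rint g) = P⁻¹ * ρ g * P) ∧
        (∀ g, (Matrix.GeneralLinearGroup.map red (rint g)).val =
          h.val * Matrix.reindex finSumFinEquiv finSumFinEquiv
            (Matrix.fromBlocks (σ g).val (B g) 0 (σ' g).val) * (h⁻¹).val)) →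
      (∃ (P₂ : GL (Fin 4) (PadicAlgCl p))
        (rint₂ : Field.absoluteGaloisGroup ℚ →* GL (Fin 4) (Valued.integer (PadicAlgCl p))) (h₂ : GL (Fin 4) k),
        (∀ g, Matrix.GeneralLinearGroup.map (Valued.integer (PadicAlgCl p)).subtype (rint₂ g) = P₂⁻¹ * ρ g * P₂) ∧
        (∀ g, (Matrix.GeneralLinearGroup.map red (rint₂ g)).val =
          h₂.val * Matrix.reindex finSumFinEquiv finSumFinEquiv
            (Matrix.fromBlocks (σ' g).val
              (-(((Matrix.GeneralLinearGroup.det (σ g))⁻¹ : kˣ) : k) • ((σ' g).val * (B g).adjugate * (σ g).val))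
              0 (σ g).val) * (h₂⁻¹).val)) ∧
      (¬ ∃ X : Matrix (Fin 2) (Fin 2) k, ∀ g,
        -(((Matrix.GeneralLinearGroup.det (σ g))⁻¹ : kˣ) : k) • ((σ' g).val * (B g).adjugate * (σ g).val) =
          (σ' g).val * X - X * (σ g).val) ∧
      ∀ (P₃ : GL (Fin 4) (PadicAlgCl p))
        (rint₃ : Field.absoluteGaloisGroup ℚ →* GL (Fin 4) (Valued.integer (PadicAlgCl p))) (h₃ : GL (Fin 4) k)
        (B₃ : Field.absoluteGaloisGroup ℚ → Matrix (Fin 2) (Fin 2) k),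
        (∀ g, Matrix.GeneralLinearGroup.map (Valued.integer (PadicAlgCl p)).subtype (rint₃ g) = P₃⁻¹ * ρ g * P₃) →
        (∀ g, (Matrix.GeneralLinearGroup.map red (rint₃ g)).val =
          h₃.val * Matrix.reindex finSumFinEquiv finSumFinEquiv
            (Matrix.fromBlocks (σ' g).val (B₃ g) 0 (σ g).val) * (h₃⁻¹).val) →
        (¬ ∃ X : Matrix (Fin 2) (Fin 2) k, ∀ g, B₃ g = (σ' g).val * X - X * (σ g).val) →
        ∃ (c : kˣ) (X : Matrix (Fin 2) (Fin 2) k), ∀ g,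
          B₃ g = (c : k) • (-(((Matrix.GeneralLinearGroup.det (σ g))⁻¹ : kˣ) : k) •
            ((σ' g).val * (B g).adjugate * (σ g).val)) + ((σ' g).val * X - X * (σ g).val) :=
  Fibre.stub_realisedClassesDual


/-! ## Rev 14 (lead c5-0, cycle 2, 2026-08-17): RESIDUAL CONSTANCY ON RANK-ONE FIBRES, the tangent level of the reducible locus,
p-DISTINGUISHEDNESS of the Greenberg lines, inner twists, and the intrinsic Greenberg condition — registered sub-goals

(RC) `stub_residualConstancyOfRankOne`: on a fibre whose decomposition-group Greenberg–Selmer space with ramification inside `S` has rank one,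
ANY TWO `Sh`-points unramified outside `S` realising non-trivial classes have `GL₄(k)`-CONJUGATE residual representations (K3⁺ twice, rank
one, the explicit conjugator `h₂ (1, -X; 0, 1)(c, 0; 0, 1) h₁⁻¹`): one residual representation `ρ̄_B`, hence ONE deformation ring, governs
the whole fibre — the starting point of Berger–Klosin's method (R3) and of propagation (R1d).
(TL) `stub_firstOrderReducibility`: for a first-order deformation `M + εN` of the block representation `M = (σ̄, B; 0, σ̄')` the lower-left
block `c` of `N` is a `Hom(σ̄, σ̄')`-cocycle, conjugation by `1 + εY` changes it by a coboundary, and the deformation is first-order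
REDUCIBLE (conjugate to block upper-triangular) iff `[c] = 0`: the normal directions to the reducible locus at `ρ̄_B` inject into
`H¹(Γ, Hom(σ̄, σ̄'))` = (adjugate duality D2) the Selmer directions of the other orientation — the tangent level of the reducibility ideal.
(PD) `stub_inertiaFixedInOrdinaryPlane`: in any triangular frame of inertial shape `(0,0,1,1)` at `v ∣ p`, every inertia-fixed vector lies
in the weight-`0` plane (the cyclotomic character moves the weight-`1` graded piece: `ε(τ₀) ≠ 1` on `I_v`); so the Greenberg plane is UNIQUE.
`stub_greenbergLinesDistinguished`: for an `Sh`-point (Greenberg-ordinary AND residually distinguished) realising `B`, the `G_v`-characters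
on the Greenberg lines `k x₁ ⊆ σ̄` and `k y₁ ⊆ σ̄'` are DISTINCT — the residual pair is `p`-distinguished, the hypothesis under which
ordinary/Klingen Hida theory separates the two constituents and the ordinary deformation condition of `ρ̄_B` is well posed.
(W) `stub_innerTwistDihedral`: if `σ̄ ⊕ σ̄'` and `(σ̄ ⊕ σ̄') ⊗ χ` have the same characteristic polynomials (e.g. the residual shadow of an
inner twist `ρ ≅ ρ ⊗ χ` of an `Sh`-point — the INDUCED sub-locus of the `cross-primes-anchored` residue), then `σ̄ ≅ σ̄ ⊗ χ` (a
dihedral constituent) or `σ̄' ≅ σ̄ ⊗ χ` up to conjugation (the twist corner): induced `Sh`-points live off the generic non-dihedral fibres.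
(GL) `stub_greenbergDecIntrinsic`: the `B`-dependent clauses of the decomposition-group Greenberg condition are `k`-LINEAR in `(B, X₀)`,
invariant under `B ↦ c • B + δX`, and the inertia-fixed lines are unique once inertia moves each constituent: the strong Greenberg–Selmer
cocycles of K3⁺/K2⁺ form a `k`-subspace containing the coboundaries, so "rank one" is a statement about CLASSES. -/

/-- **STUB RC `stub_residualConstancyOfRankOne`** (rev 14): RESIDUAL CONSTANCY ON RANK-ONE FIBRES.  Two `Sh`-points `ρ₁, ρ₂` on a `DetC`
fibre (`p ≠ 2`), unramified outside `S`, realising NON-trivial classes `B₁, B₂` through integral frames, on a fibre whose strong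
(decomposition-group) Greenberg–Selmer cocycles with ramification inside `S` are projectively cyclic, have CONJUGATE residual
representations: `red ∘ rint₂ = g (red ∘ rint₁) g⁻¹` for one `g ∈ GL₄(k)` (K3⁺ for both, rank one gives `B₂ = c B₁ + δX`, and
`(σ̄, c B₁ + δX; 0, σ̄') = U (σ̄, B₁; 0, σ̄') U⁻¹` with `U = (1, -X; 0, 1)(c, 0; 0, 1)`). [folklore] -/
theorem stub_residualConstancyOfRankOne :
    ∀ (p : ℕ) [Fact p.Prime], p ≠ 2 → ∀ (k : Type) [Field k] [CharP k p] [IsAlgClosed k]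
    [TopologicalSpace k] [DiscreteTopology k] (red : Valued.integer (PadicAlgCl p) →+* k)
    (σ σ' : FramedGaloisRep ℚ k 2) (ρ₁ ρ₂ : FramedGaloisRep ℚ (PadicAlgCl p) 4) (P₁ P₂ : GL (Fin 4) (PadicAlgCl p))
    (rint₁ rint₂ : Field.absoluteGaloisGroup ℚ →* GL (Fin 4) (Valued.integer (PadicAlgCl p))) (h₁ h₂ : GL (Fin 4) k)
    (B₁ B₂ : Field.absoluteGaloisGroup ℚ → Matrix (Fin 2) (Fin 2) k) (S : Set (HeightOneSpectrum (NumberField.RingOfIntegers ℚ))),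
    let GrDec := fun A (v : HeightOneSpectrum (NumberField.RingOfIntegers ℚ)) =>
      ∃ (X₀ : Matrix (Fin 2) (Fin 2) k) (x₁ y₁ : Fin 2 → k), x₁ ≠ 0 ∧ y₁ ≠ 0 ∧
        (∀ τ : Field.absoluteGaloisGroup (v.adicCompletion ℚ), ∃ a : k,
          (σ (absGaloisRestrict ℚ (v.adicCompletion ℚ) τ)).val *ᵥ x₁ = a • x₁) ∧
        (∀ τ : Field.absoluteGaloisGroup (v.adicCompletion ℚ), ∃ b : k,
          (σ' (absGaloisRestrict ℚ (v.adicCompletion ℚ) τ)).val *ᵥ y₁ = b • y₁) ∧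
        (∀ τ : Field.absoluteGaloisGroup (v.adicCompletion ℚ), ∃ c : k,
          (A (absGaloisRestrict ℚ (v.adicCompletion ℚ) τ) -
            ((σ (absGaloisRestrict ℚ (v.adicCompletion ℚ) τ)).val * X₀ -
              X₀ * (σ' (absGaloisRestrict ℚ (v.adicCompletion ℚ) τ)).val)) *ᵥ y₁ = c • x₁) ∧
        (∀ τ ∈ absInertia (v.adicCompletion ℚ),
          (σ (absGaloisRestrict ℚ (v.adicCompletion ℚ) τ)).val *ᵥ x₁ = x₁) ∧
        (∀ τ ∈ absInertia (v.adicCompletion ℚ),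
          (σ' (absGaloisRestrict ℚ (v.adicCompletion ℚ) τ)).val *ᵥ y₁ = y₁) ∧
        (∀ τ ∈ absInertia (v.adicCompletion ℚ),
          (A (absGaloisRestrict ℚ (v.adicCompletion ℚ) τ) -
            ((σ (absGaloisRestrict ℚ (v.adicCompletion ℚ) τ)).val * X₀ -
              X₀ * (σ' (absGaloisRestrict ℚ (v.adicCompletion ℚ) τ)).val)) *ᵥ y₁ = 0) ∧
        ∀ τ ∈ absInertia (v.adicCompletion ℚ), ∀ y : Fin 2 → k, ∃ c : k,
          (A (absGaloisRestrict ℚ (v.adicCompletion ℚ) τ) -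
            ((σ (absGaloisRestrict ℚ (v.adicCompletion ℚ) τ)).val * X₀ -
              X₀ * (σ' (absGaloisRestrict ℚ (v.adicCompletion ℚ) τ)).val)) *ᵥ y = c • x₁
    let Fr := fun (r : FramedGaloisRep ℚ (PadicAlgCl p) 4) (Q : GL (Fin 4) (PadicAlgCl p))
        (ri : Field.absoluteGaloisGroup ℚ →* GL (Fin 4) (Valued.integer (PadicAlgCl p))) (hh : GL (Fin 4) k) A =>
      (∀ g, Matrix.GeneralLinearGroup.map (Valued.integer (PadicAlgCl p)).subtype (ri g) = Q⁻¹ * r g * Q) ∧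
        (∀ g, (Matrix.GeneralLinearGroup.map red (ri g)).val =
          hh.val * Matrix.reindex finSumFinEquiv finSumFinEquiv
            (Matrix.fromBlocks (σ g).val (A g) 0 (σ' g).val) * (hh⁻¹).val)
    DetC p k σ σ' → Sh p k red σ σ' ρ₁ → Sh p k red σ σ' ρ₂ →
    Fr ρ₁ P₁ rint₁ h₁ B₁ → Fr ρ₂ P₂ rint₂ h₂ B₂ →
    (¬ ∃ X : Matrix (Fin 2) (Fin 2) k, ∀ g, B₁ g = (σ g).val * X - X * (σ' g).val) →
    (¬ ∃ X : Matrix (Fin 2) (Fin 2) k, ∀ g, B₂ g = (σ g).val * X - X * (σ' g).val) →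
    (∀ v ∉ S, ρ₁.IsUnramifiedAt v ∧ ρ₂.IsUnramifiedAt v) →
    (∀ A₁ A₂ : Field.absoluteGaloisGroup ℚ → Matrix (Fin 2) (Fin 2) k,
      (∀ g g', A₁ (g * g') = (σ g).val * A₁ g' + A₁ g * (σ' g').val) →
      (∀ g g', A₂ (g * g') = (σ g).val * A₂ g' + A₂ g * (σ' g').val) →
      IsLocallyConstant A₁ → IsLocallyConstant A₂ →
      (∀ v ∉ S, ∀ 𝔓 ∈ v.primesAbove, ∀ i ∈ 𝔓.inertia (Field.absoluteGaloisGroup ℚ), A₁ i = 0 ∧ A₂ i = 0) →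
      (∀ v : HeightOneSpectrum (NumberField.RingOfIntegers ℚ), ((p : ℕ) : NumberField.RingOfIntegers ℚ) ∈ v.asIdeal →
        GrDec A₁ v ∧ GrDec A₂ v) →
      (¬ ∃ X : Matrix (Fin 2) (Fin 2) k, ∀ g, A₁ g = (σ g).val * X - X * (σ' g).val) →
      (¬ ∃ X : Matrix (Fin 2) (Fin 2) k, ∀ g, A₂ g = (σ g).val * X - X * (σ' g).val) →
      ∃ (c : kˣ) (X : Matrix (Fin 2) (Fin 2) k), ∀ g, A₂ g = (c : k) • A₁ g + ((σ g).val * X - X * (σ' g).val)) →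
    ∃ g : GL (Fin 4) k, ∀ γ,
      Matrix.GeneralLinearGroup.map red (rint₂ γ) = g * Matrix.GeneralLinearGroup.map red (rint₁ γ) * g⁻¹ :=
  Fibre.stub_residualConstancyOfRankOne

/-- **STUB TL `stub_firstOrderReducibility`** (rev 14; the TANGENT LEVEL of the reducible locus at `ρ̄_B`): let `N : Γ → M₄(k)` be a
first-order deformation cochain of the block representation `M g = (σ̄ g, B g; 0, σ̄' g)` (`M + εN` is a homomorphism over `k[ε]`, i.e. the
derivation identity `N(gg') = M g · N g' + N g · M g'`).  Then (i) the lower-left block `c g = (N g)₂₁` is a 1-cocycle for `Hom(σ̄, σ̄')`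
(`c(gg') = σ̄' g · c g' + c g · σ̄ g'`); (ii) conjugating by `1 + εY` replaces `N` by `N + (Y M - M Y)`, whose lower-left block is
`c + (Y₂₁ σ̄ - σ̄' Y₂₁)` — a coboundary change; (iii) the deformation is first-order REDUCIBLE in the adapted flag (some conjugate has
vanishing lower-left block) iff `[c] = 0` in `H¹(Γ, Hom(σ̄, σ̄'))`. [folklore] -/
theorem stub_firstOrderReducibility :
    ∀ (k : Type) [Field k] (Γ : Type) [Group Γ] (σ σ' : Γ →* GL (Fin 2) k) (B : Γ → Matrix (Fin 2) (Fin 2) k)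
      (N : Γ → Matrix (Fin 2 ⊕ Fin 2) (Fin 2 ⊕ Fin 2) k),
      (∀ g g', N (g * g') = Matrix.fromBlocks (σ g).val (B g) 0 (σ' g).val * N g' +
          N g * Matrix.fromBlocks (σ g').val (B g') 0 (σ' g').val) →
      (∀ g g', (N (g * g')).toBlocks₂₁ = (σ' g).val * (N g').toBlocks₂₁ + (N g).toBlocks₂₁ * (σ g').val) ∧
      (∀ (Y : Matrix (Fin 2 ⊕ Fin 2) (Fin 2 ⊕ Fin 2) k) (g : Γ),
          (N g + (Y * Matrix.fromBlocks (σ g).val (B g) 0 (σ' g).val -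
            Matrix.fromBlocks (σ g).val (B g) 0 (σ' g).val * Y)).toBlocks₂₁ =
            (N g).toBlocks₂₁ + (Y.toBlocks₂₁ * (σ g).val - (σ' g).val * Y.toBlocks₂₁)) ∧
      ((∃ Y : Matrix (Fin 2 ⊕ Fin 2) (Fin 2 ⊕ Fin 2) k, ∀ g,
          (N g + (Y * Matrix.fromBlocks (σ g).val (B g) 0 (σ' g).val -
            Matrix.fromBlocks (σ g).val (B g) 0 (σ' g).val * Y)).toBlocks₂₁ = 0) ↔
        ∃ X : Matrix (Fin 2) (Fin 2) k, ∀ g, (N g).toBlocks₂₁ = (σ' g).val * X - X * (σ g).val) :=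
  Fibre.stub_firstOrderReducibility

/-- **STUB PD-a `stub_inertiaFixedInOrdinaryPlane`** (rev 14): let `ρ : Γ_{ℚ_v} → GL₄(ℚ̄_p)` (`v ∣ p`, `p ≠ 2`) admit a frame `g` which is
upper triangular on `Γ_{ℚ_v}` with inertial diagonal `(1, 1, ε⁻¹, ε⁻¹)` (the first two clauses of the crystalline/Greenberg shape
`(0,0,1,1)`).  Then EVERY inertia-fixed vector lies in the weight-`0` plane `g⁻¹⟨e₀, e₁⟩`: its last two coordinates in the frame vanish
(inertia acts on the quotient by the plane through a triangular matrix with both diagonal entries `ε(τ)⁻¹`, and `ε(τ₀) ≠ 1` for some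
`τ₀ ∈ I_v` — `cyclotomicCharacter_absGaloisRestrict` + `exists_mem_absInertia_epsBar_ne_one`).  Hence the Greenberg plane is UNIQUE. [folklore] -/
theorem stub_inertiaFixedInOrdinaryPlane :
    ∀ (p : ℕ) [Fact p.Prime], p ≠ 2 → ∀ (v : HeightOneSpectrum (NumberField.RingOfIntegers ℚ)),
      ((p : ℕ) : NumberField.RingOfIntegers ℚ) ∈ v.asIdeal →
      ∀ (ρ : FramedRep (Field.absoluteGaloisGroup (v.adicCompletion ℚ)) (PadicAlgCl p) 4) (g : GL (Fin 4) (PadicAlgCl p)),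
      (∀ (τ : Field.absoluteGaloisGroup (v.adicCompletion ℚ)) (i j : Fin 4), j < i →
        ((g * ρ τ * g⁻¹ : GL (Fin 4) (PadicAlgCl p)) : Matrix (Fin 4) (Fin 4) (PadicAlgCl p)) i j = 0) →
      (∀ τ ∈ absInertia (v.adicCompletion ℚ), ∀ i : Fin 4,
        ((g * ρ τ * g⁻¹ : GL (Fin 4) (PadicAlgCl p)) : Matrix (Fin 4) (Fin 4) (PadicAlgCl p)) i i =
          algebraMap ℚ_[p] (PadicAlgCl p)
            ((((GaloisRep.cyclotomicCharacter (v.adicCompletion ℚ) p τ)⁻¹ : ℤ_[p]ˣ) : ℤ_[p]) : ℚ_[p]) ^ (![0, 0, 1, 1] i : ℕ)) →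
      ∀ w : Fin 4 → PadicAlgCl p, (∀ τ ∈ absInertia (v.adicCompletion ℚ), (ρ τ).val *ᵥ w = w) →
        (g.val *ᵥ w) 2 = 0 ∧ (g.val *ᵥ w) 3 = 0 :=
  Fibre.stub_inertiaFixedInOrdinaryPlane

/-- **STUB PD-b `stub_greenbergLinesDistinguished`** (rev 14): for an `Sh`-point `ρ` (Greenberg-ordinary of shape `(0,0,1,1)` AND
residually distinguished at `v ∣ p`) realising `B` through an integral frame on a `DetC` fibre (`p ≠ 2`), and for ANY non-zero `x₁ ∈ σ̄`,
`y₁ ∈ σ̄'` spanning `G_v`-stable lines fixed by `I_v` (the Greenberg lines of N1⁺), the `G_v`-characters `a, b` on `k x₁`, `k y₁` are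
DISTINCT: `a(τ) ≠ b(τ)` for some `τ`.  (The inertia-fixed lines are unique; the action of `rint(τ)` on the saturated Greenberg plane has
integral matrix `T_τ` with `red T_τ ∼ (a, *; 0, b)`; `charpoly T_τ = (X - ψ₀(τ))(X - ψ₁(τ))` for the weight-`0` diagonal characters of the
DISTINGUISHED frame, whose plane coincides with the Greenberg plane by PD-a; `‖ψ₀(τ₁) - ψ₁(τ₁)‖ = 1` gives `a(τ₁) ≠ b(τ₁)`.) [folklore] -/
theorem stub_greenbergLinesDistinguished :
    ∀ (p : ℕ) [Fact p.Prime], p ≠ 2 → ∀ (k : Type) [Field k] [CharP k p] [IsAlgClosed k]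
      [TopologicalSpace k] [DiscreteTopology k] (red : Valued.integer (PadicAlgCl p) →+* k)
      (σ σ' : FramedGaloisRep ℚ k 2) (ρ : FramedGaloisRep ℚ (PadicAlgCl p) 4)
      (P : GL (Fin 4) (PadicAlgCl p))
      (rint : Field.absoluteGaloisGroup ℚ →* GL (Fin 4) (Valued.integer (PadicAlgCl p))) (h : GL (Fin 4) k)
      (B : Field.absoluteGaloisGroup ℚ → Matrix (Fin 2) (Fin 2) k)
      (v : HeightOneSpectrum (NumberField.RingOfIntegers ℚ)),
      ((p : ℕ) : NumberField.RingOfIntegers ℚ) ∈ v.asIdeal → DetC p k σ σ' → Sh p k red σ σ' ρ →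
      (∀ g, Matrix.GeneralLinearGroup.map (Valued.integer (PadicAlgCl p)).subtype (rint g) = P⁻¹ * ρ g * P) →
      (∀ g, (Matrix.GeneralLinearGroup.map red (rint g)).val =
          h.val * Matrix.reindex finSumFinEquiv finSumFinEquiv
            (Matrix.fromBlocks (σ g).val (B g) 0 (σ' g).val) * (h⁻¹).val) →
      ∀ (x₁ y₁ : Fin 2 → k) (a b : Field.absoluteGaloisGroup (v.adicCompletion ℚ) → k), x₁ ≠ 0 → y₁ ≠ 0 →
      (∀ τ, (σ (absGaloisRestrict ℚ (v.adicCompletion ℚ) τ)).val *ᵥ x₁ = a τ • x₁) →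
      (∀ τ, (σ' (absGaloisRestrict ℚ (v.adicCompletion ℚ) τ)).val *ᵥ y₁ = b τ • y₁) →
      (∀ τ ∈ absInertia (v.adicCompletion ℚ), a τ = 1) → (∀ τ ∈ absInertia (v.adicCompletion ℚ), b τ = 1) →
      ∃ τ, a τ ≠ b τ :=
  Fibre.stub_greenbergLinesDistinguished

/-- **STUB W `stub_innerTwistDihedral`** (rev 14): let `σ̄, σ̄' : Γ → GL₂(k)` be irreducible and `χ : Γ → kˣ` a character such that
`σ̄ ⊕ σ̄'` and `(σ̄ ⊕ σ̄') ⊗ χ` have the same characteristic polynomials (the residual shadow of an INNER TWIST `ρ ≅ ρ ⊗ χ` of a point of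
the fibre — e.g. an induced `ρ ≅ Ind_K τ`, `χ = χ_K`).  Then, by Brauer–Nesbitt for the semisimple `4`-dimensional representations and Schur,
EITHER `σ̄ ≅ σ̄ ⊗ χ` (a dihedral constituent) OR `σ̄' ≅ σ̄ ⊗ χ` up to `GL₂(k)`-conjugation (a twist pair: the corner): induced points of the
fibre live off the generic non-dihedral locus. [cite: BourbakiAlgebreVIII2012, VIII § 20 n° 6, Thm. 2, Cor. 1 (p. 378)] -/
theorem stub_innerTwistDihedral :
    ∀ (k : Type) [Field k] (Γ : Type) [Group Γ] (σ σ' : Γ →* GL (Fin 2) k) (χ : Γ →* kˣ),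
      Representation.IsIrreducible ((glStdRepresentation (Fin 2) k).comp σ) →
      Representation.IsIrreducible ((glStdRepresentation (Fin 2) k).comp σ') →
      (∀ g, (σ g).val.charpoly * (σ' g).val.charpoly =
        (((χ g : kˣ) : k) • (σ g).val).charpoly * (((χ g : kˣ) : k) • (σ' g).val).charpoly) →
      (∃ A : GL (Fin 2) k, ∀ g, (A * σ g * A⁻¹).val = ((χ g : kˣ) : k) • (σ g).val) ∨
      (∃ A : GL (Fin 2) k, ∀ g, (A * σ g * A⁻¹).val = ((χ g : kˣ) : k) • (σ' g).val) :=
  Fibre.stub_innerTwistDihedral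

/-- **STUB GL `stub_greenbergDecIntrinsic`** (rev 14; hygiene for "rank"): fix families `S, S', A : ι → M₂(k)` (think `σ̄(res τ)`,
`σ̄'(res τ)`, `B(res τ)` for `τ : Γ_{ℚ_v}`) and an inertia predicate `I`.  (i) The `A`-dependent clauses of the decomposition-group
Greenberg condition with respect to fixed lines `x₁, y₁` — `(A - δX₀) y₁ ∈ k x₁` everywhere, `(A - δX₀) y₁ = 0` and `(A - δX₀)(k²) ⊆ k x₁`
on `I` — are LINEAR: they pass from `(A₁, X₁)`, `(A₂, X₂)` to `(c • A₁ + A₂, c • X₁ + X₂)`, and they hold for every coboundary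
`(S X - X S', X)`; (ii) if inertia moves `σ̄` (`S i₀ ≠ 1` for some `I i₀`) then a non-zero inertia-fixed `x₁` spans the WHOLE fixed space
(`S i₀ x = x → x ∈ k x₁`), and likewise for `σ̄'`: the Greenberg lines are unique, so the condition depends only on the class of `A` and
the strong Greenberg–Selmer cocycles form a `k`-subspace containing the coboundaries. [folklore] -/
theorem stub_greenbergDecIntrinsic :
    ∀ (k : Type) [Field k] (ι : Type) (I : ι → Prop) (S S' : ι → Matrix (Fin 2) (Fin 2) k) (x₁ y₁ : Fin 2 → k),
      (∀ (A₁ A₂ : ι → Matrix (Fin 2) (Fin 2) k) (X₁ X₂ : Matrix (Fin 2) (Fin 2) k) (c : k),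
        ((∀ i, ∃ e : k, (A₁ i - (S i * X₁ - X₁ * S' i)) *ᵥ y₁ = e • x₁) ∧
          (∀ i, I i → (A₁ i - (S i * X₁ - X₁ * S' i)) *ᵥ y₁ = 0) ∧
          (∀ i, I i → ∀ y : Fin 2 → k, ∃ e : k, (A₁ i - (S i * X₁ - X₁ * S' i)) *ᵥ y = e • x₁)) →
        ((∀ i, ∃ e : k, (A₂ i - (S i * X₂ - X₂ * S' i)) *ᵥ y₁ = e • x₁) ∧
          (∀ i, I i → (A₂ i - (S i * X₂ - X₂ * S' i)) *ᵥ y₁ = 0) ∧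
          (∀ i, I i → ∀ y : Fin 2 → k, ∃ e : k, (A₂ i - (S i * X₂ - X₂ * S' i)) *ᵥ y = e • x₁)) →
        (∀ i, ∃ e : k, ((c • A₁ i + A₂ i) - (S i * (c • X₁ + X₂) - (c • X₁ + X₂) * S' i)) *ᵥ y₁ = e • x₁) ∧
          (∀ i, I i → ((c • A₁ i + A₂ i) - (S i * (c • X₁ + X₂) - (c • X₁ + X₂) * S' i)) *ᵥ y₁ = 0) ∧
          (∀ i, I i → ∀ y : Fin 2 → k, ∃ e : k,
            ((c • A₁ i + A₂ i) - (S i * (c • X₁ + X₂) - (c • X₁ + X₂) * S' i)) *ᵥ y = e • x₁)) ∧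
      (∀ X : Matrix (Fin 2) (Fin 2) k,
        (∀ i, ∃ e : k, ((S i * X - X * S' i) - (S i * X - X * S' i)) *ᵥ y₁ = e • x₁) ∧
          (∀ i, I i → ((S i * X - X * S' i) - (S i * X - X * S' i)) *ᵥ y₁ = 0) ∧
          (∀ i, I i → ∀ y : Fin 2 → k, ∃ e : k, ((S i * X - X * S' i) - (S i * X - X * S' i)) *ᵥ y = e • x₁)) ∧
      ((∃ i₀, I i₀ ∧ S i₀ ≠ 1) → x₁ ≠ 0 → (∀ i, I i → S i *ᵥ x₁ = x₁) →
        ∀ x : Fin 2 → k, (∀ i, I i → S i *ᵥ x = x) → ∃ e : k, x = e • x₁) ∧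
      ((∃ i₀, I i₀ ∧ S' i₀ ≠ 1) → y₁ ≠ 0 → (∀ i, I i → S' i *ᵥ y₁ = y₁) →
        ∀ y : Fin 2 → k, (∀ i, I i → S' i *ᵥ y = y) → ∃ e : k, y = e • y₁) :=
  Fibre.stub_greenbergDecIntrinsic

/-! ## Rev 15 (lead c5-0, cycle 3, 2026-08-17): the Greenberg–Selmer VOCABULARY in use (Theorems/…GreenbergSelmerDefs, p170860),
cup-product obstructions at first order, Selmer classes are residually ordinary, duality of the Selmer CONDITION, inner twists in
characteristic 0 — registered sub-goals

(KV) `stub_realisedClass_isGreenbergSelmer`, `stub_selmerAnchorRel_of_rankLeOne`, `stub_residualConstancy_of_rankLeOne`: K3⁺ / K2⁺ / RC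
restated over `IsRealisedThrough`, `IsCoboundaryFor`, `IsGreenbergSelmerCocycle`, `GreenbergSelmerRankLeOne` (short, citable forms).
(TL2) `stub_firstOrderCupObstruction`: a cochain `N` is a first-order deformation of `M = (σ̄, B; 0, σ̄')` IFF blockwise: `c = N₂₁` is a
`Hom(σ̄,σ̄')`-cocycle, `δN₁₁ = B ∪ c`, `δN₂₂ = c ∪ B`, `δN₁₂ = B ∪ N₂₂ + N₁₁ ∪ B` — the cup products of the Selmer class `[B]` with a
dual direction `[c]` are the OBSTRUCTIONS to deforming `ρ̄_B` to first order in that direction (Berger–Klosin's `H¹ ⊗ H¹ → H²` pairing, typed).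
(RS) `stub_selmerClassResiduallyOrdinary`: a cochain satisfying the decomposition-group Greenberg condition `IsGreenbergDecAt` at `v ∣ p`
defines a residual representation `(σ̄, B; 0, σ̄')|_{G_v}` which is RESIDUALLY GREENBERG-ORDINARY of shape `(0,0,1,1)`: block upper
triangular in a `GL₄(k)`-frame with inertia trivial on the plane and scalar `det σ̄ = ε̄⁻¹` on the quotient — the converse of N1⁺: every
strong Selmer class, realised or not, is a point of the residual local condition of `R^{Sh}`.
(D4/D6) `stub_adjugateDualGreenbergSelmer`, `stub_rankLeOne_symm`: the adjugate duality `B ↦ B'` carries strong Greenberg–Selmer cocycles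
for `(σ̄, σ̄')` to strong Greenberg–Selmer cocycles for `(σ̄', σ̄)` and coboundaries to coboundaries, so `GreenbergSelmerRankLeOne` is
SYMMETRIC in the pair: the rank-one regime does not depend on the orientation (completes D3 at the level of Selmer CONDITIONS).
(W2/W3) `stub_innerTwistResidualShadow`, `stub_innerTwistOffGeneric`: an INNER TWIST `A r A⁻¹ = χ ⊗ r` (χ integral-unit valued) of a
representation with an integral frame realising `(σ̄, B; 0, σ̄')` forces the residual charpoly identity of W, hence (W p170739) a dihedral
constituent `σ̄ ≅ σ̄ ⊗ χ̄` or a twist pair: inner-twisted (e.g. induced) points live off the generic non-dihedral fibres. -/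

/-- **STUB KV1 `stub_realisedClass_isGreenbergSelmer`** (rev 15; K3⁺ p168375 over the vocabulary p170860): the class realised by an
`Sh`-point `ρ` on a `DetC` fibre (`p ≠ 2`) is a Greenberg–Selmer cocycle with ramification inside any `S` outside which `ρ` is unramified.
[folklore] -/
theorem stub_realisedClass_isGreenbergSelmer :
    ∀ (p : ℕ) [Fact p.Prime], p ≠ 2 → ∀ (k : Type) [Field k] [CharP k p] [IsAlgClosed k]
      [TopologicalSpace k] [DiscreteTopology k] (red : Valued.integer (PadicAlgCl p) →+* k)
      (σ σ' : FramedGaloisRep ℚ k 2) (ρ : FramedGaloisRep ℚ (PadicAlgCl p) 4)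
      (B : Field.absoluteGaloisGroup ℚ → Matrix (Fin 2) (Fin 2) k)
      (S : Set (HeightOneSpectrum (NumberField.RingOfIntegers ℚ))),
      DetC p k σ σ' → Sh p k red σ σ' ρ → IsRealisedThrough p k red σ σ' ρ B →
      (∀ v ∉ S, ρ.IsUnramifiedAt v) → IsGreenbergSelmerCocycle p k σ σ' S B :=
  Fibre.stub_realisedClass_isGreenbergSelmer

/-- **STUB KV2 `stub_selmerAnchorRel_of_rankLeOne`** (rev 15; K2⁺ p169418 over the vocabulary): on an admissible fibre carrying the crux's
anchor `ρ₀`, if the Greenberg–Selmer space with ramification inside `S` has rank at most one, every non-trivial class realised by an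
`Sh`-point unramified outside `S` (with `ρ₀` unramified outside `S` too) is realised by `ρ₀` itself: the anchor stub's conclusion with
`ρ₁ := ρ₀`, `c = 1`. [folklore] -/
theorem stub_selmerAnchorRel_of_rankLeOne :
    ∀ (p : ℕ) [Fact p.Prime], p ≠ 2 → ∀ (k : Type) [Field k] [CharP k p] [IsAlgClosed k]
      [TopologicalSpace k] [DiscreteTopology k] (red : Valued.integer (PadicAlgCl p) →+* k)
      (σ σ' : FramedGaloisRep ℚ k 2) (hcpt : isCompact_glFiniteIntegralLevel 4 ℚ) (ι : PadicAlgCl p ≃+* ℂ)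
      (ρ₀ ρ : FramedGaloisRep ℚ (PadicAlgCl p) 4) (B : Field.absoluteGaloisGroup ℚ → Matrix (Fin 2) (Fin 2) k)
      (S : Set (HeightOneSpectrum (NumberField.RingOfIntegers ℚ))),
      σ.toGaloisRep.IsIrreducible → σ'.toGaloisRep.IsIrreducible → DetC p k σ σ' →
      (¬ ∃ g : GL (Fin 2) k, ∀ x, g * σ x * g⁻¹ = σ' x) →
      ρ₀.toGaloisRep.IsIrreducible → Sh p k red σ σ' ρ₀ → Aut p hcpt ι ρ₀ →
      ¬ IsCoboundaryFor σ σ' B → Sh p k red σ σ' ρ → IsRealisedThrough p k red σ σ' ρ B →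
      (∀ v ∉ S, ρ.IsUnramifiedAt v ∧ ρ₀.IsUnramifiedAt v) → GreenbergSelmerRankLeOne p k σ σ' S →
      ∃ ρ₁ : FramedGaloisRep ℚ (PadicAlgCl p) 4, ρ₁.toGaloisRep.IsIrreducible ∧ Aut p hcpt ι ρ₁ ∧
        (∃ c : ℕ, (c : ZMod (p - 1)) = 1 ∧
          (∃ ν : Field.absoluteGaloisGroup ℚ → PadicAlgCl p, ρ₁.IsSymplecticWithMultiplierFun ν) ∧
          ∀ v : HeightOneSpectrum (NumberField.RingOfIntegers ℚ), ((p : ℕ) : NumberField.RingOfIntegers ℚ) ∈ v.asIdeal →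
            ρ₁.IsGreenbergOrdinaryOfShapeAt v ![0, 0, c, c] ∧ ρ₁.IsResiduallyDistinguishedAt v ![0, 0, c, c]) ∧
        IsRealisedThrough p k red σ σ' ρ₁ B :=
  Fibre.stub_selmerAnchorRel_of_rankLeOne

/-- **STUB KV3 `stub_residualConstancy_of_rankLeOne`** (rev 15; RC p170002 over the vocabulary): if the Greenberg–Selmer space with
ramification inside `S` has rank at most one, any two `Sh`-points unramified outside `S` whose integral frames realise non-trivial classes
have `GL₄(k)`-conjugate residual representations. [folklore] -/
theorem stub_residualConstancy_of_rankLeOne :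
    ∀ (p : ℕ) [Fact p.Prime], p ≠ 2 → ∀ (k : Type) [Field k] [CharP k p] [IsAlgClosed k]
      [TopologicalSpace k] [DiscreteTopology k] (red : Valued.integer (PadicAlgCl p) →+* k)
      (σ σ' : FramedGaloisRep ℚ k 2) (ρ₁ ρ₂ : FramedGaloisRep ℚ (PadicAlgCl p) 4) (P₁ P₂ : GL (Fin 4) (PadicAlgCl p))
      (rint₁ rint₂ : Field.absoluteGaloisGroup ℚ →* GL (Fin 4) (Valued.integer (PadicAlgCl p))) (h₁ h₂ : GL (Fin 4) k)
      (B₁ B₂ : Field.absoluteGaloisGroup ℚ → Matrix (Fin 2) (Fin 2) k) (S : Set (HeightOneSpectrum (NumberField.RingOfIntegers ℚ))),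
      DetC p k σ σ' → Sh p k red σ σ' ρ₁ → Sh p k red σ σ' ρ₂ →
      (∀ g, Matrix.GeneralLinearGroup.map (Valued.integer (PadicAlgCl p)).subtype (rint₁ g) = P₁⁻¹ * ρ₁ g * P₁) →
      (∀ g, (Matrix.GeneralLinearGroup.map red (rint₁ g)).val =
          h₁.val * Matrix.reindex finSumFinEquiv finSumFinEquiv
            (Matrix.fromBlocks (σ g).val (B₁ g) 0 (σ' g).val) * (h₁⁻¹).val) →
      (∀ g, Matrix.GeneralLinearGroup.map (Valued.integer (PadicAlgCl p)).subtype (rint₂ g) = P₂⁻¹ * ρ₂ g * P₂) →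
      (∀ g, (Matrix.GeneralLinearGroup.map red (rint₂ g)).val =
          h₂.val * Matrix.reindex finSumFinEquiv finSumFinEquiv
            (Matrix.fromBlocks (σ g).val (B₂ g) 0 (σ' g).val) * (h₂⁻¹).val) →
      ¬ IsCoboundaryFor σ σ' B₁ → ¬ IsCoboundaryFor σ σ' B₂ →
      (∀ v ∉ S, ρ₁.IsUnramifiedAt v ∧ ρ₂.IsUnramifiedAt v) → GreenbergSelmerRankLeOne p k σ σ' S →
      ∃ g : GL (Fin 4) k, ∀ γ,
        Matrix.GeneralLinearGroup.map red (rint₂ γ) = g * Matrix.GeneralLinearGroup.map red (rint₁ γ) * g⁻¹ :=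
  Fibre.stub_residualConstancy_of_rankLeOne

/-- **STUB TL2 `stub_firstOrderCupObstruction`** (rev 15; the CUP-PRODUCT OBSTRUCTIONS at first order): a cochain `N : Γ → M₄(k)` in `2 × 2`
blocks is a first-order deformation cochain of `M g = (σ̄ g, B g; 0, σ̄' g)` (derivation identity `N(gg') = M g N g' + N g M g'`) IF AND ONLY IF
blockwise: the lower-left block `c = N₂₁` is a `Hom(σ̄, σ̄')`-cocycle, `δN₁₁ = B ∪ c` (`N₁₁(gg') - σ̄ g N₁₁ g' - N₁₁ g σ̄ g' = B g · c g'`),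
`δN₂₂ = c ∪ B` (`… = c g · B g'`), and `δN₁₂ = B ∪ N₂₂ + N₁₁ ∪ B` (`N₁₂(gg') - σ̄ g N₁₂ g' - N₁₂ g σ̄' g' = B g N₂₂ g' + N₁₁ g B g'`).  So a
dual Selmer direction `[c] ∈ H¹(Γ, Hom(σ̄, σ̄'))` deforms `ρ̄_B` to first order only if the cup products `[B] ∪ [c] ∈ H²(Γ, End σ̄)` and
`[c] ∪ [B] ∈ H²(Γ, End σ̄')` vanish. [folklore] -/
theorem stub_firstOrderCupObstruction :
    ∀ (k : Type) [Field k] (Γ : Type) [Group Γ] (σ σ' : Γ →* GL (Fin 2) k) (B : Γ → Matrix (Fin 2) (Fin 2) k)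
      (N : Γ → Matrix (Fin 2 ⊕ Fin 2) (Fin 2 ⊕ Fin 2) k),
      (∀ g g', N (g * g') = Matrix.fromBlocks (σ g).val (B g) 0 (σ' g).val * N g' +
          N g * Matrix.fromBlocks (σ g').val (B g') 0 (σ' g').val) ↔
      ((∀ g g', (N (g * g')).toBlocks₂₁ = (σ' g).val * (N g').toBlocks₂₁ + (N g).toBlocks₂₁ * (σ g').val) ∧
        (∀ g g', (N (g * g')).toBlocks₁₁ - ((σ g).val * (N g').toBlocks₁₁ + (N g).toBlocks₁₁ * (σ g').val) =
          B g * (N g').toBlocks₂₁) ∧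
        (∀ g g', (N (g * g')).toBlocks₂₂ - ((σ' g).val * (N g').toBlocks₂₂ + (N g).toBlocks₂₂ * (σ' g').val) =
          (N g).toBlocks₂₁ * B g') ∧
        (∀ g g', (N (g * g')).toBlocks₁₂ - ((σ g).val * (N g').toBlocks₁₂ + (N g).toBlocks₁₂ * (σ' g').val) =
          B g * (N g').toBlocks₂₂ + (N g).toBlocks₁₁ * B g')) :=
  Fibre.stub_firstOrderCupObstruction

/-- **STUB RS `stub_selmerClassResiduallyOrdinary`** (rev 15; the converse of N1⁺ at the residual level): a cochain `B` satisfying the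
decomposition-group Greenberg condition `IsGreenbergDecAt` at `v ∣ p` on a `DetC` fibre defines a residual representation
`τ ↦ (σ̄, B; 0, σ̄')(res τ)` of `G_v` which is RESIDUALLY GREENBERG-ORDINARY OF SHAPE `(0,0,1,1)`: in the `GL₄(k)`-frame
`(x₁,0), (-X₀ y₁, y₁), (x₂,0), (-X₀ y₂, y₂)` it is block upper triangular, inertia acts TRIVIALLY on the plane and through the SCALAR
`det σ̄ = ε̄⁻¹` on the quotient.  Every strong Selmer class — realised or not — is a point of the residual local condition of `R^{Sh}(ρ̄_B)`.
[cite: Greenberg1991, §2 (the ordinary local condition)] -/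
theorem stub_selmerClassResiduallyOrdinary :
    ∀ (p : ℕ) [Fact p.Prime] (k : Type) [Field k] [CharP k p] [TopologicalSpace k] [DiscreteTopology k]
      (σ σ' : FramedGaloisRep ℚ k 2) (v : HeightOneSpectrum (NumberField.RingOfIntegers ℚ))
      (B : Field.absoluteGaloisGroup ℚ → Matrix (Fin 2) (Fin 2) k),
      DetC p k σ σ' → IsGreenbergDecAt p k σ σ' v B →
      ∃ (Q : GL (Fin 4) k) (A C D : Field.absoluteGaloisGroup (v.adicCompletion ℚ) → Matrix (Fin 2) (Fin 2) k),
        (∀ τ, Q.val * Matrix.reindex finSumFinEquiv finSumFinEquiv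
              (Matrix.fromBlocks (σ (absGaloisRestrict ℚ (v.adicCompletion ℚ) τ)).val
                (B (absGaloisRestrict ℚ (v.adicCompletion ℚ) τ)) 0
                (σ' (absGaloisRestrict ℚ (v.adicCompletion ℚ) τ)).val) * (Q⁻¹).val =
            Matrix.reindex finSumFinEquiv finSumFinEquiv (Matrix.fromBlocks (A τ) (C τ) 0 (D τ))) ∧
        (∀ τ ∈ absInertia (v.adicCompletion ℚ), A τ = 1) ∧
        (∀ τ ∈ absInertia (v.adicCompletion ℚ),
          D τ = (σ (absGaloisRestrict ℚ (v.adicCompletion ℚ) τ)).val.det • (1 : Matrix (Fin 2) (Fin 2) k)) :=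
  Fibre.stub_selmerClassResiduallyOrdinary

/-- **STUB D4 `stub_adjugateDualGreenbergSelmer`** (rev 15; duality of the Selmer CONDITION): for a pair with a common determinant the adjugate
duality `B ↦ B'(g) = -(det σ̄ g)⁻¹ • σ̄'(g) adj(B g) σ̄(g)` (D2 p164728) carries Greenberg–Selmer cocycles for `(σ̄, σ̄')` with ramification
inside `S` to Greenberg–Selmer cocycles for `(σ̄', σ̄)` (cocycle by D2; locally constant; vanishing on the same inertia groups; and the
decomposition-group Greenberg condition transports with the lines exchanged and the correction `X₀ ↦ -adj X₀`: `B̃ y₁ ∥ x₁ ⟺ adj(B̃) x₁ ∥ y₁`),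
and `B` is a coboundary iff `B'` is. [folklore] -/
theorem stub_adjugateDualGreenbergSelmer :
    ∀ (p : ℕ) [Fact p.Prime] (k : Type) [Field k] [TopologicalSpace k] [DiscreteTopology k]
      (σ σ' : FramedGaloisRep ℚ k 2) (S : Set (HeightOneSpectrum (NumberField.RingOfIntegers ℚ)))
      (B : Field.absoluteGaloisGroup ℚ → Matrix (Fin 2) (Fin 2) k),
      (∀ g, (σ' g).val.det = (σ g).val.det) →
      (IsGreenbergSelmerCocycle p k σ σ' S B →
        IsGreenbergSelmerCocycle p k σ' σ S
          (fun g => -(((Matrix.GeneralLinearGroup.det (σ g))⁻¹ : kˣ) : k) • ((σ' g).val * (B g).adjugate * (σ g).val))) ∧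
      (IsCoboundaryFor σ σ' B ↔
        IsCoboundaryFor σ' σ
          (fun g => -(((Matrix.GeneralLinearGroup.det (σ g))⁻¹ : kˣ) : k) • ((σ' g).val * (B g).adjugate * (σ g).val))) :=
  Fibre.stub_adjugateDualGreenbergSelmer

/-- **STUB D6 `stub_rankLeOne_symm`** (rev 15, assembly of D4 + the involutivity of D2): for a pair with a common determinant,
`GreenbergSelmerRankLeOne` is SYMMETRIC in the pair — the rank-one regime of Berger–Klosin does not depend on the orientation in which the
Selmer space is read. [folklore] -/
theorem stub_rankLeOne_symm :
    ∀ (p : ℕ) [Fact p.Prime] (k : Type) [Field k] [TopologicalSpace k] [DiscreteTopology k]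
      (σ σ' : FramedGaloisRep ℚ k 2) (S : Set (HeightOneSpectrum (NumberField.RingOfIntegers ℚ))),
      (∀ g, (σ' g).val.det = (σ g).val.det) →
      (GreenbergSelmerRankLeOne p k σ σ' S ↔ GreenbergSelmerRankLeOne p k σ' σ S) :=
  Fibre.stub_rankLeOne_symm

/-- **STUB W2 `stub_innerTwistResidualShadow`** (rev 15): let `rint : Γ → GL₄(ℤ̄_p)` reduce through `red` to `h (σ̄, B; 0, σ̄') h⁻¹`, and let
the representation `rint ⊗ ℚ̄_p` admit an INNER TWIST by an integral-unit valued character `χ`: `A · rint(g) · A⁻¹ = χ(g) · rint(g)` for one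
`A ∈ GL₄(ℚ̄_p)`.  Then `σ̄ ⊕ σ̄'` and `(σ̄ ⊕ σ̄') ⊗ χ̄` (`χ̄ = red ∘ χ`) have the same characteristic polynomials (conjugate matrices have
equal charpolys; `ℤ̄_p[X] → ℚ̄_p[X]` is injective; reduce; block-triangular charpolys multiply) — the hypothesis of W. [folklore] -/
theorem stub_innerTwistResidualShadow :
    ∀ (p : ℕ) [Fact p.Prime] (k : Type) [Field k] (Γ : Type) [Group Γ]
      (red : Valued.integer (PadicAlgCl p) →+* k) (σ σ' : Γ →* GL (Fin 2) k) (B : Γ → Matrix (Fin 2) (Fin 2) k)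
      (rint : Γ →* GL (Fin 4) (Valued.integer (PadicAlgCl p))) (h : GL (Fin 4) k)
      (A : GL (Fin 4) (PadicAlgCl p)) (χ : Γ →* (Valued.integer (PadicAlgCl p))ˣ),
      (∀ g, (Matrix.GeneralLinearGroup.map red (rint g)).val =
          h.val * Matrix.reindex finSumFinEquiv finSumFinEquiv
            (Matrix.fromBlocks (σ g).val (B g) 0 (σ' g).val) * (h⁻¹).val) →
      (∀ g, A.val * (Matrix.GeneralLinearGroup.map (Valued.integer (PadicAlgCl p)).subtype (rint g)).val * (A⁻¹).val =
          (((χ g : (Valued.integer (PadicAlgCl p))ˣ) : Valued.integer (PadicAlgCl p)) : PadicAlgCl p) •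
            (Matrix.GeneralLinearGroup.map (Valued.integer (PadicAlgCl p)).subtype (rint g)).val) →
      ∀ g, (σ g).val.charpoly * (σ' g).val.charpoly =
        ((red ((χ g : (Valued.integer (PadicAlgCl p))ˣ) : Valued.integer (PadicAlgCl p))) • (σ g).val).charpoly *
          ((red ((χ g : (Valued.integer (PadicAlgCl p))ˣ) : Valued.integer (PadicAlgCl p))) • (σ' g).val).charpoly :=
  Fibre.stub_innerTwistResidualShadow

/-- **STUB W3 `stub_innerTwistOffGeneric`** (rev 15, assembly of W2 + W p170739): an inner twist `A rint A⁻¹ = χ · rint` (χ integral-unit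
valued) of a representation whose integral frame realises `(σ̄, B; 0, σ̄')` with IRREDUCIBLE constituents forces `σ̄ ≅ σ̄ ⊗ χ̄` (a dihedral
constituent) or `σ̄' ≅ σ̄ ⊗ χ̄` up to `GL₂(k)`-conjugation (a twist pair): inner-twisted — in particular induced — points of the fibre live off
the generic non-dihedral locus (coverage lemma for the residue stub of `cross-primes-anchored` and the corner dossier). [folklore] -/
theorem stub_innerTwistOffGeneric :
    ∀ (p : ℕ) [Fact p.Prime] (k : Type) [Field k] (Γ : Type) [Group Γ]
      (red : Valued.integer (PadicAlgCl p) →+* k) (σ σ' : Γ →* GL (Fin 2) k) (B : Γ → Matrix (Fin 2) (Fin 2) k)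
      (rint : Γ →* GL (Fin 4) (Valued.integer (PadicAlgCl p))) (h : GL (Fin 4) k)
      (A : GL (Fin 4) (PadicAlgCl p)) (χ : Γ →* (Valued.integer (PadicAlgCl p))ˣ),
      Representation.IsIrreducible ((glStdRepresentation (Fin 2) k).comp σ) →
      Representation.IsIrreducible ((glStdRepresentation (Fin 2) k).comp σ') →
      (∀ g, (Matrix.GeneralLinearGroup.map red (rint g)).val =
          h.val * Matrix.reindex finSumFinEquiv finSumFinEquiv
            (Matrix.fromBlocks (σ g).val (B g) 0 (σ' g).val) * (h⁻¹).val) →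
      (∀ g, A.val * (Matrix.GeneralLinearGroup.map (Valued.integer (PadicAlgCl p)).subtype (rint g)).val * (A⁻¹).val =
          (((χ g : (Valued.integer (PadicAlgCl p))ˣ) : Valued.integer (PadicAlgCl p)) : PadicAlgCl p) •
            (Matrix.GeneralLinearGroup.map (Valued.integer (PadicAlgCl p)).subtype (rint g)).val) →
      (∃ T : GL (Fin 2) k, ∀ g, (T * σ g * T⁻¹).val =
          (red ((χ g : (Valued.integer (PadicAlgCl p))ˣ) : Valued.integer (PadicAlgCl p))) • (σ g).val) ∨
      (∃ T : GL (Fin 2) k, ∀ g, (T * σ g * T⁻¹).val =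
          (red ((χ g : (Valued.integer (PadicAlgCl p))ˣ) : Valued.integer (PadicAlgCl p))) • (σ' g).val) :=
  Fibre.stub_innerTwistOffGeneric

/-! ## Rev 16 (lead c5-0, cycle 4, 2026-08-17): THE RANK-ONE REDUCTION, the tame relation of ramified classes (why ×-type level-raising
places are the auxiliary places), the converse of RS, duality of realisation — registered sub-goals

(RR) `stub_anchorRealises_of_rankLeOne` + `stub_rankOneReduction`: on a fibre whose Greenberg–Selmer space has rank at most one, the
crux's own anchor `ρ₀` REALISES the class of every `Sh`-point (Ribet + KV1 + rank one + p140957), so the composition of the line needs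
ONLY the propagation stub there, and only in its `c = 1` form: `(non-split relative lifting: ρ₀, ρ realise the same non-trivial class,
Aut ρ₀ ⇒ KLim ρ) ⇒ KLim ρ` on rank-one fibres — the anchor stub R1c-rel is ELIMINATED on the Berger–Klosin sub-sector, and what is left
is relative lifting between two points with ONE residual representation `ρ̄_B` (RC), the indecomposable analogue of Skinner–Wiles 1997.
(LR) `stub_ramifiedClassTameRelation`: at `v ∤ p` where `σ̄, σ̄'` are unramified, a locally constant `Hom(σ̄', σ̄)`-cocycle restricted to
inertia is an additive homomorphism killed by wild inertia and TWISTED BY `q_v` UNDER FROBENIUS: `σ̄(φ) B(τ) = q_v · B(τ) σ̄'(φ)` — so a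
Greenberg–Selmer class can ramify at `v` only if `q_v` is an eigenvalue of `X ↦ σ̄(φ) X σ̄'(φ)⁻¹`, i.e. (LR2 `stub_crossRatioOfTameEigen`)
only if `α = q_v β` for eigenvalues `α` of `σ̄(Frob_v)`, `β` of `σ̄'(Frob_v)`: the auxiliary ramification of `Sh`-points is supported on the
CROSS-RATIO (×-type level-raising) places of line C — the Galois side of census F1⁺(c).
(RS2) `stub_greenbergDecOfOrdinaryFrame`: converse of RS p171290 — a residual ordinary frame of shape `(0,0,1,1)` for `(σ̄, B; 0, σ̄')|_{G_v}`
gives back `IsGreenbergDecAt`: the strong Greenberg condition IS residual Siegel-ordinarity.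
(KV4) `stub_isRealisedThrough_dual`: D3 over the vocabulary — a symplectic realiser of `B` realises the adjugate-dual class in the opposite
orientation, which is non-trivial. -/

/-- **STUB KV2' `stub_anchorRealises_of_rankLeOne`** (rev 16): on an admissible fibre, if the Greenberg–Selmer space with ramification inside
`S` has rank at most one, the anchor `ρ₀` (irreducible `Sh`, unramified outside `S`) REALISES every non-trivial class realised by an `Sh`-point
unramified outside `S` (Ribet R1a for `ρ₀`, KV1 twice, rank one, realisation depends only on the projective class p140957). [folklore] -/
theorem stub_anchorRealises_of_rankLeOne :
    ∀ (p : ℕ) [Fact p.Prime], p ≠ 2 → ∀ (k : Type) [Field k] [CharP k p] [IsAlgClosed k]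
      [TopologicalSpace k] [DiscreteTopology k] (red : Valued.integer (PadicAlgCl p) →+* k)
      (σ σ' : FramedGaloisRep ℚ k 2) (ρ₀ ρ : FramedGaloisRep ℚ (PadicAlgCl p) 4)
      (B : Field.absoluteGaloisGroup ℚ → Matrix (Fin 2) (Fin 2) k)
      (S : Set (HeightOneSpectrum (NumberField.RingOfIntegers ℚ))),
      σ.toGaloisRep.IsIrreducible → σ'.toGaloisRep.IsIrreducible → DetC p k σ σ' →
      (¬ ∃ g : GL (Fin 2) k, ∀ x, g * σ x * g⁻¹ = σ' x) →
      ρ₀.toGaloisRep.IsIrreducible → Sh p k red σ σ' ρ₀ →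
      ¬ IsCoboundaryFor σ σ' B → Sh p k red σ σ' ρ → IsRealisedThrough p k red σ σ' ρ B →
      (∀ v ∉ S, ρ.IsUnramifiedAt v ∧ ρ₀.IsUnramifiedAt v) → GreenbergSelmerRankLeOne p k σ σ' S →
      IsRealisedThrough p k red σ σ' ρ₀ B :=
  Fibre.stub_anchorRealises_of_rankLeOne

/-- **STUB RR `stub_rankOneReduction`** (rev 16; THE RANK-ONE REDUCTION of the line): on an admissible fibre carrying the anchor `ρ₀`,
if the Greenberg–Selmer space with ramification inside `S` has rank at most one, then the relative sub-crux for an irreducible `Sh`-point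
`ρ` unramified outside `S` follows from NON-SPLIT RELATIVE LIFTING alone — "`ρ₀` and `r` realise the SAME non-trivial class, `Aut ρ₀`
⇒ `r` is a Klingen classical limit" (the `c = 1` specialisation of R1d-rel; by RC the two points then have one residual representation
`ρ̄_B`): the anchor stub R1c-rel is eliminated on the Berger–Klosin sub-sector. [folklore] -/
theorem stub_rankOneReduction :
    ∀ (p : ℕ) [Fact p.Prime], p ≠ 2 → ∀ (k : Type) [Field k] [CharP k p] [IsAlgClosed k]
      [TopologicalSpace k] [DiscreteTopology k] (red : Valued.integer (PadicAlgCl p) →+* k)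
      (σ σ' : FramedGaloisRep ℚ k 2) (hcpt : isCompact_glFiniteIntegralLevel 4 ℚ) (ι : PadicAlgCl p ≃+* ℂ)
      (ρ₀ ρ : FramedGaloisRep ℚ (PadicAlgCl p) 4) (S : Set (HeightOneSpectrum (NumberField.RingOfIntegers ℚ))),
      (∀ (r : FramedGaloisRep ℚ (PadicAlgCl p) 4) (A : Field.absoluteGaloisGroup ℚ → Matrix (Fin 2) (Fin 2) k),
        ¬ IsCoboundaryFor σ σ' A → r.toGaloisRep.IsIrreducible → Sh p k red σ σ' r →
        IsRealisedThrough p k red σ σ' ρ₀ A → IsRealisedThrough p k red σ σ' r A →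
        IsKlingenClassicalLimit p hcpt ι r) →
      σ.toGaloisRep.IsIrreducible → σ'.toGaloisRep.IsIrreducible → DetC p k σ σ' →
      (¬ ∃ g : GL (Fin 2) k, ∀ x, g * σ x * g⁻¹ = σ' x) →
      ρ₀.toGaloisRep.IsIrreducible → Sh p k red σ σ' ρ₀ → Aut p hcpt ι ρ₀ →
      ρ.toGaloisRep.IsIrreducible → Sh p k red σ σ' ρ →
      (∀ v ∉ S, ρ.IsUnramifiedAt v ∧ ρ₀.IsUnramifiedAt v) → GreenbergSelmerRankLeOne p k σ σ' S →
      IsKlingenClassicalLimit p hcpt ι ρ :=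
  Fibre.stub_rankOneReduction

/-- **STUB LR `stub_ramifiedClassTameRelation`** (rev 16; THE TAME RELATION OF A RAMIFIED CLASS): let `v ∤ p` and let `σ̄, σ̄'` be unramified
at `v` (trivial on the inertia group of `Γ_{ℚ_v}`).  A locally constant `Hom(σ̄', σ̄)`-cocycle `B` restricted to `I_v` is an additive
homomorphism; it KILLS WILD INERTIA (`P_v` is pro-`ℓ`, `ℓ ≠ p`, and `B(I_v)` has exponent `p`: `absWildInertia_isProP_holds`), and for a
Frobenius element `φ` (`IsFrobPow φ 1`) the cocycle identity `B(φ τ φ⁻¹) = σ̄(φ) B(τ) σ̄'(φ)⁻¹` combined with the tame relation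
`φ τ φ⁻¹ ≡ τ^{q_v} (mod P_v)` (`conj_mul_pow_inv_mem_absWildInertia`) gives `σ̄(φ) B(τ) = q_v · B(τ) σ̄'(φ)` for every `τ ∈ I_v`.
Consequence: a Greenberg–Selmer class ramifies at `v` only where `q_v` is an eigenvalue of `X ↦ σ̄(φ) X σ̄'(φ)⁻¹` — the ×-type level-raising
position of line C (LR2). [cite: SerreInventiones1972, §1.8 Prop. 6 (Frobenius acts on tame inertia by q)] -/
theorem stub_ramifiedClassTameRelation :
    ∀ (p : ℕ) [Fact p.Prime] (k : Type) [Field k] [CharP k p] [TopologicalSpace k] [DiscreteTopology k]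
      (σ σ' : FramedGaloisRep ℚ k 2) (B : Field.absoluteGaloisGroup ℚ → Matrix (Fin 2) (Fin 2) k)
      (v : HeightOneSpectrum (NumberField.RingOfIntegers ℚ)),
      ((p : ℕ) : NumberField.RingOfIntegers ℚ) ∉ v.asIdeal →
      (∀ g g', B (g * g') = (σ g).val * B g' + B g * (σ' g').val) → IsLocallyConstant B →
      (∀ τ ∈ absInertia (v.adicCompletion ℚ),
        σ (absGaloisRestrict ℚ (v.adicCompletion ℚ) τ) = 1 ∧ σ' (absGaloisRestrict ℚ (v.adicCompletion ℚ) τ) = 1) →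
      ∀ φ : Field.absoluteGaloisGroup (v.adicCompletion ℚ), IsFrobPow φ 1 →
      ∀ τ ∈ absInertia (v.adicCompletion ℚ),
        (σ (absGaloisRestrict ℚ (v.adicCompletion ℚ) φ)).val * B (absGaloisRestrict ℚ (v.adicCompletion ℚ) τ) =
          (IsNonarchimedeanLocalField.residueFieldCard (v.adicCompletion ℚ) : k) •
            (B (absGaloisRestrict ℚ (v.adicCompletion ℚ) τ) * (σ' (absGaloisRestrict ℚ (v.adicCompletion ℚ) φ)).val) :=
  Fibre.stub_ramifiedClassTameRelation

/-- **STUB LR2 `stub_crossRatioOfTameEigen`** (rev 16; the eigenvalue reading of LR): over an algebraically closed field, if a NON-ZERO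
`X ∈ M₂(k)` satisfies `S X = q · X S'`, then `α = q β` for some eigenvalue `α` of `S` and some eigenvalue `β` of `S'` (apply `S` to `X y` for an
eigenvector or a generalised eigenvector `y` of `S'`).  With LR: a Greenberg–Selmer class ramified at `v ∤ p` forces a CROSS RATIO
`α / β = q_v` between the eigenvalues of `σ̄(Frob_v)` and `σ̄'(Frob_v)` — the residual level-raising position `CrossRes` of line C; at places
without such a ratio every Greenberg–Selmer class is unramified. [folklore] -/
theorem stub_crossRatioOfTameEigen :
    ∀ (k : Type) [Field k] [IsAlgClosed k] (S S' X : Matrix (Fin 2) (Fin 2) k) (q : k),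
      X ≠ 0 → S * X = q • (X * S') →
      ∃ α β : k, S.charpoly.IsRoot α ∧ S'.charpoly.IsRoot β ∧ α = q * β :=
  Fibre.stub_crossRatioOfTameEigen

/-- **STUB RS2 `stub_greenbergDecOfOrdinaryFrame`** (rev 16; converse of RS p171290): if the residual representation
`τ ↦ (σ̄, B; 0, σ̄')(res τ)` of `G_v` (`v ∣ p`, `DetC`, `p ≠ 2`) admits a `GL₄(k)`-frame in which it is block upper triangular with inertia
TRIVIAL on the plane and SCALAR on the quotient, then `B` satisfies the decomposition-group Greenberg condition `IsGreenbergDecAt` at `v`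
(the plane is stable and inertia-fixed with the quotient-scalar clause; the residual core `greenbergStable_of_identityRows` of N1⁺ after a
column reduction of the plane's matrix; inertia moves both constituents by `DetC` and `ε̄(τ₀) ≠ 1`).  With RS: the strong Greenberg
condition IS residual Siegel-ordinarity of shape `(0,0,1,1)`. [folklore] -/
theorem stub_greenbergDecOfOrdinaryFrame :
    ∀ (p : ℕ) [Fact p.Prime], p ≠ 2 → ∀ (k : Type) [Field k] [CharP k p] [TopologicalSpace k] [DiscreteTopology k]
      (σ σ' : FramedGaloisRep ℚ k 2) (v : HeightOneSpectrum (NumberField.RingOfIntegers ℚ))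
      (B : Field.absoluteGaloisGroup ℚ → Matrix (Fin 2) (Fin 2) k),
      ((p : ℕ) : NumberField.RingOfIntegers ℚ) ∈ v.asIdeal → DetC p k σ σ' →
      (∃ (Q : GL (Fin 4) k) (A C D : Field.absoluteGaloisGroup (v.adicCompletion ℚ) → Matrix (Fin 2) (Fin 2) k),
        (∀ τ, Q.val * Matrix.reindex finSumFinEquiv finSumFinEquiv
              (Matrix.fromBlocks (σ (absGaloisRestrict ℚ (v.adicCompletion ℚ) τ)).val
                (B (absGaloisRestrict ℚ (v.adicCompletion ℚ) τ)) 0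
                (σ' (absGaloisRestrict ℚ (v.adicCompletion ℚ) τ)).val) * (Q⁻¹).val =
            Matrix.reindex finSumFinEquiv finSumFinEquiv (Matrix.fromBlocks (A τ) (C τ) 0 (D τ))) ∧
        (∀ τ ∈ absInertia (v.adicCompletion ℚ), A τ = 1) ∧
        (∀ τ ∈ absInertia (v.adicCompletion ℚ), ∃ c : k, D τ = c • (1 : Matrix (Fin 2) (Fin 2) k))) →
      IsGreenbergDecAt p k σ σ' v B :=
  Fibre.stub_greenbergDecOfOrdinaryFrame

/-- **STUB KV4 `stub_isRealisedThrough_dual`** (rev 16; D3 p169383 over the vocabulary): on a non-twist pair with equal determinants and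
irreducible constituents, a SYMPLECTIC realiser of a non-trivial class `B` realises the adjugate-dual class in the OPPOSITE orientation, and
that class is non-trivial. [folklore] -/
theorem stub_isRealisedThrough_dual :
    ∀ (p : ℕ) [Fact p.Prime], p ≠ 2 → ∀ (k : Type) [Field k] [CharP k p] [IsAlgClosed k]
      [TopologicalSpace k] [DiscreteTopology k] (red : Valued.integer (PadicAlgCl p) →+* k)
      (σ σ' : FramedGaloisRep ℚ k 2) (ρ : FramedGaloisRep ℚ (PadicAlgCl p) 4)
      (B : Field.absoluteGaloisGroup ℚ → Matrix (Fin 2) (Fin 2) k) (ν : Field.absoluteGaloisGroup ℚ → PadicAlgCl p),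
      σ.toGaloisRep.IsIrreducible → σ'.toGaloisRep.IsIrreducible →
      (∀ x, (σ' x).val.det = (σ x).val.det) →
      (¬ ∃ g : GL (Fin 2) k, ∀ x, ∃ c : k, (g * σ x * g⁻¹).val = c • (σ' x).val) →
      ¬ IsCoboundaryFor σ σ' B → ρ.IsSymplecticWithMultiplierFun ν → IsRealisedThrough p k red σ σ' ρ B →
      IsRealisedThrough p k red σ' σ ρ
          (fun g => -(((Matrix.GeneralLinearGroup.det (σ g))⁻¹ : kˣ) : k) • ((σ' g).val * (B g).adjugate * (σ g).val)) ∧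
        ¬ IsCoboundaryFor σ' σ
          (fun g => -(((Matrix.GeneralLinearGroup.det (σ g))⁻¹ : kˣ) : k) • ((σ' g).val * (B g).adjugate * (σ g).val)) :=
  Fibre.stub_isRealisedThrough_dual

/-- **STUB LR3 `stub_selmerClassUnramifiedOffCross`** (rev 16c, assembly of LR p171801 + LR2 p171699): at a place `v ∤ p` where `σ̄, σ̄'`
are unramified and NO CROSS RATIO `α = q_v β` holds between the eigenvalues of `σ̄(φ)` and `σ̄'(φ)` for a Frobenius element `φ`, every
locally constant `Hom(σ̄', σ̄)`-cocycle — in particular every Greenberg–Selmer class, e.g. the class realised by an `Sh`-point (K3⁺) — is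
UNRAMIFIED at `v` (vanishes on `I_v`): the auxiliary ramification of the fibre is supported on the ×-type level-raising places of line C.
[folklore] -/
theorem stub_selmerClassUnramifiedOffCross :
    ∀ (p : ℕ) [Fact p.Prime] (k : Type) [Field k] [CharP k p] [IsAlgClosed k] [TopologicalSpace k] [DiscreteTopology k]
      (σ σ' : FramedGaloisRep ℚ k 2) (B : Field.absoluteGaloisGroup ℚ → Matrix (Fin 2) (Fin 2) k)
      (v : HeightOneSpectrum (NumberField.RingOfIntegers ℚ)),
      ((p : ℕ) : NumberField.RingOfIntegers ℚ) ∉ v.asIdeal →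
      (∀ g g', B (g * g') = (σ g).val * B g' + B g * (σ' g').val) → IsLocallyConstant B →
      (∀ τ ∈ absInertia (v.adicCompletion ℚ),
        σ (absGaloisRestrict ℚ (v.adicCompletion ℚ) τ) = 1 ∧ σ' (absGaloisRestrict ℚ (v.adicCompletion ℚ) τ) = 1) →
      ∀ φ : Field.absoluteGaloisGroup (v.adicCompletion ℚ), IsFrobPow φ 1 →
      (¬ ∃ α β : k, (σ (absGaloisRestrict ℚ (v.adicCompletion ℚ) φ)).val.charpoly.IsRoot α ∧
          (σ' (absGaloisRestrict ℚ (v.adicCompletion ℚ) φ)).val.charpoly.IsRoot β ∧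
          α = (IsNonarchimedeanLocalField.residueFieldCard (v.adicCompletion ℚ) : k) * β) →
      ∀ τ ∈ absInertia (v.adicCompletion ℚ), B (absGaloisRestrict ℚ (v.adicCompletion ℚ) τ) = 0 :=
  Fibre.stub_selmerClassUnramifiedOffCross

/-! ## Name-keyed aliases of the registered stub statements -/
namespace Registered

/-- Alias of the R1a statement (Ribet over `ℤ̄_p`) keyed by the registered stub name (LANDED p142340; kept for reference,
no longer a hypothesis of `ResiduallyYoshidaLifting_of`). -/
abbrev stub_ribetNonsplitLattice : Prop :=
  ∀ (p : ℕ) [Fact p.Prime] (k : Type) [Field k] [CharP k p] [IsAlgClosed k]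
    [TopologicalSpace k] [DiscreteTopology k] (red : Valued.integer (PadicAlgCl p) →+* k)
    (σ σ' : FramedGaloisRep ℚ k 2) (r : FramedGaloisRep ℚ (PadicAlgCl p) 4),
    σ.toGaloisRep.IsIrreducible → σ'.toGaloisRep.IsIrreducible →
    (¬ ∃ g : GL (Fin 2) k, ∀ x, g * σ x * g⁻¹ = σ' x) →
    r.toGaloisRep.IsIrreducible →
    (∀ᶠ v : HeightOneSpectrum (NumberField.RingOfIntegers ℚ) in Filter.cofinite,
      r.IsUnramifiedAt v ∧ σ.IsUnramifiedAt v ∧ σ'.IsUnramifiedAt v ∧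
      ∃ (P : Polynomial (Valued.integer (PadicAlgCl p))) (P₁ P₂ : Polynomial k),
        r.HasFrobCharpolyAt v (P.map (Valued.integer (PadicAlgCl p)).subtype) ∧
        σ.HasFrobCharpolyAt v P₁ ∧ σ'.HasFrobCharpolyAt v P₂ ∧ P.map red = P₁ * P₂) →
    ∃ (P : GL (Fin 4) (PadicAlgCl p))
      (rint : Field.absoluteGaloisGroup ℚ →* GL (Fin 4) (Valued.integer (PadicAlgCl p)))
      (h : GL (Fin 4) k) (B : Field.absoluteGaloisGroup ℚ → Matrix (Fin 2) (Fin 2) k),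
      (∀ g, Matrix.GeneralLinearGroup.map (Valued.integer (PadicAlgCl p)).subtype (rint g) = P⁻¹ * r g * P) ∧
      (∀ g, (Matrix.GeneralLinearGroup.map red (rint g)).val =
        h.val * Matrix.reindex finSumFinEquiv finSumFinEquiv
          (Matrix.fromBlocks (σ g).val (B g) 0 (σ' g).val) * (h⁻¹).val) ∧
      ¬ ∃ X : Matrix (Fin 2) (Fin 2) k, ∀ g, B g = (σ g).val * X - X * (σ' g).val
/-- Alias of the R1c-rel statement keyed by the registered stub name. -/
abbrev stub_selmerAnchorRel : Prop :=
  ∀ (p : ℕ) [Fact p.Prime], p ≠ 2 → ∀ (k : Type) [Field k] [CharP k p] [IsAlgClosed k]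
    [TopologicalSpace k] [DiscreteTopology k] (red : Valued.integer (PadicAlgCl p) →+* k)
    (σ σ' : FramedGaloisRep ℚ k 2) (hcpt : isCompact_glFiniteIntegralLevel 4 ℚ) (ι : PadicAlgCl p ≃+* ℂ)
    (B : Field.absoluteGaloisGroup ℚ → Matrix (Fin 2) (Fin 2) k),
    σ.toGaloisRep.IsIrreducible → σ'.toGaloisRep.IsIrreducible → DetC p k σ σ' →
    (¬ ∃ g : GL (Fin 2) k, ∀ x, g * σ x * g⁻¹ = σ' x) → GenericSector p k σ σ' →
    (∃ ρ₀ : FramedGaloisRep ℚ (PadicAlgCl p) 4, ρ₀.toGaloisRep.IsIrreducible ∧ Sh p k red σ σ' ρ₀ ∧ Aut p hcpt ι ρ₀) →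
    (¬ ∃ X : Matrix (Fin 2) (Fin 2) k, ∀ g, B g = (σ g).val * X - X * (σ' g).val) →
    (∃ ρ : FramedGaloisRep ℚ (PadicAlgCl p) 4, ρ.toGaloisRep.IsIrreducible ∧ Sh p k red σ σ' ρ ∧
      ∃ (P : GL (Fin 4) (PadicAlgCl p))
        (rint : Field.absoluteGaloisGroup ℚ →* GL (Fin 4) (Valued.integer (PadicAlgCl p))) (h : GL (Fin 4) k),
        (∀ g, Matrix.GeneralLinearGroup.map (Valued.integer (PadicAlgCl p)).subtype (rint g) = P⁻¹ * ρ g * P) ∧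
        (∀ g, (Matrix.GeneralLinearGroup.map red (rint g)).val =
          h.val * Matrix.reindex finSumFinEquiv finSumFinEquiv
            (Matrix.fromBlocks (σ g).val (B g) 0 (σ' g).val) * (h⁻¹).val)) →
    ∃ ρ₁ : FramedGaloisRep ℚ (PadicAlgCl p) 4, ρ₁.toGaloisRep.IsIrreducible ∧ Aut p hcpt ι ρ₁ ∧
      (∃ c : ℕ, (c : ZMod (p - 1)) = 1 ∧
        (∃ ν : Field.absoluteGaloisGroup ℚ → PadicAlgCl p, ρ₁.IsSymplecticWithMultiplierFun ν) ∧
        ∀ v : HeightOneSpectrum (NumberField.RingOfIntegers ℚ), ((p : ℕ) : NumberField.RingOfIntegers ℚ) ∈ v.asIdeal →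
          ρ₁.IsGreenbergOrdinaryOfShapeAt v ![0, 0, c, c] ∧ ρ₁.IsResiduallyDistinguishedAt v ![0, 0, c, c]) ∧
      ∃ (P : GL (Fin 4) (PadicAlgCl p))
        (rint : Field.absoluteGaloisGroup ℚ →* GL (Fin 4) (Valued.integer (PadicAlgCl p))) (h : GL (Fin 4) k),
        (∀ g, Matrix.GeneralLinearGroup.map (Valued.integer (PadicAlgCl p)).subtype (rint g) = P⁻¹ * ρ₁ g * P) ∧
        (∀ g, (Matrix.GeneralLinearGroup.map red (rint g)).val =
          h.val * Matrix.reindex finSumFinEquiv finSumFinEquiv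
            (Matrix.fromBlocks (σ g).val (B g) 0 (σ' g).val) * (h⁻¹).val)
/-- Alias of the R1d-rel statement keyed by the registered stub name. -/
abbrev stub_nonsplitPropagationRel : Prop :=
  ∀ (p : ℕ) [Fact p.Prime], p ≠ 2 → ∀ (k : Type) [Field k] [CharP k p] [IsAlgClosed k]
    [TopologicalSpace k] [DiscreteTopology k] (red : Valued.integer (PadicAlgCl p) →+* k)
    (σ σ' : FramedGaloisRep ℚ k 2) (hcpt : isCompact_glFiniteIntegralLevel 4 ℚ) (ι : PadicAlgCl p ≃+* ℂ)
    (ρ : FramedGaloisRep ℚ (PadicAlgCl p) 4) (B : Field.absoluteGaloisGroup ℚ → Matrix (Fin 2) (Fin 2) k),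
    σ.toGaloisRep.IsIrreducible → σ'.toGaloisRep.IsIrreducible → DetC p k σ σ' →
    (¬ ∃ g : GL (Fin 2) k, ∀ x, g * σ x * g⁻¹ = σ' x) → GenericSector p k σ σ' →
    (∃ ρ₀ : FramedGaloisRep ℚ (PadicAlgCl p) 4, ρ₀.toGaloisRep.IsIrreducible ∧ Sh p k red σ σ' ρ₀ ∧ Aut p hcpt ι ρ₀) →
    (¬ ∃ X : Matrix (Fin 2) (Fin 2) k, ∀ g, B g = (σ g).val * X - X * (σ' g).val) →
    ρ.toGaloisRep.IsIrreducible → Sh p k red σ σ' ρ →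
    (∃ (P : GL (Fin 4) (PadicAlgCl p))
        (rint : Field.absoluteGaloisGroup ℚ →* GL (Fin 4) (Valued.integer (PadicAlgCl p))) (h : GL (Fin 4) k),
        (∀ g, Matrix.GeneralLinearGroup.map (Valued.integer (PadicAlgCl p)).subtype (rint g) = P⁻¹ * ρ g * P) ∧
        (∀ g, (Matrix.GeneralLinearGroup.map red (rint g)).val =
          h.val * Matrix.reindex finSumFinEquiv finSumFinEquiv
            (Matrix.fromBlocks (σ g).val (B g) 0 (σ' g).val) * (h⁻¹).val)) →
    (∃ ρ₁ : FramedGaloisRep ℚ (PadicAlgCl p) 4, ρ₁.toGaloisRep.IsIrreducible ∧ Aut p hcpt ι ρ₁ ∧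
      (∃ c : ℕ, (c : ZMod (p - 1)) = 1 ∧
        (∃ ν : Field.absoluteGaloisGroup ℚ → PadicAlgCl p, ρ₁.IsSymplecticWithMultiplierFun ν) ∧
        ∀ v : HeightOneSpectrum (NumberField.RingOfIntegers ℚ), ((p : ℕ) : NumberField.RingOfIntegers ℚ) ∈ v.asIdeal →
          ρ₁.IsGreenbergOrdinaryOfShapeAt v ![0, 0, c, c] ∧ ρ₁.IsResiduallyDistinguishedAt v ![0, 0, c, c]) ∧
      ∃ (P : GL (Fin 4) (PadicAlgCl p))
        (rint : Field.absoluteGaloisGroup ℚ →* GL (Fin 4) (Valued.integer (PadicAlgCl p))) (h : GL (Fin 4) k),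
        (∀ g, Matrix.GeneralLinearGroup.map (Valued.integer (PadicAlgCl p)).subtype (rint g) = P⁻¹ * ρ₁ g * P) ∧
        (∀ g, (Matrix.GeneralLinearGroup.map red (rint g)).val =
          h.val * Matrix.reindex finSumFinEquiv finSumFinEquiv
            (Matrix.fromBlocks (σ g).val (B g) 0 (σ' g).val) * (h⁻¹).val)) →
    IsKlingenClassicalLimit p hcpt ι ρ
/-- Alias of `KlingenLimitClassicality` (p116982) keyed by the registered stub name. -/
abbrev stub_klingenLimitClassicality : Prop := KlingenLimitClassicality
/-- Alias of the stub-3a-rel statement (anchored `p = 3` corner) keyed by the registered stub name. -/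
abbrev stub_cornerThreeRel : Prop :=
  ∀ (p : ℕ) [Fact p.Prime], p = 3 → ∀ (k : Type) [Field k] [CharP k p] [IsAlgClosed k]
    [TopologicalSpace k] [DiscreteTopology k] (red : Valued.integer (PadicAlgCl p) →+* k)
    (σ σ' : FramedGaloisRep ℚ k 2) (hcpt : isCompact_glFiniteIntegralLevel 4 ℚ) (ι : PadicAlgCl p ≃+* ℂ)
    (ρ₀ ρ : FramedGaloisRep ℚ (PadicAlgCl p) 4),
    σ.toGaloisRep.IsIrreducible → σ'.toGaloisRep.IsIrreducible → DetC p k σ σ' →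
    (¬ ∃ g : GL (Fin 2) k, ∀ x, g * σ x * g⁻¹ = σ' x) →
    ρ₀.toGaloisRep.IsIrreducible → Sh p k red σ σ' ρ₀ → Aut p hcpt ι ρ₀ →
    ρ.toGaloisRep.IsIrreducible → Sh p k red σ σ' ρ → IsKlingenClassicalLimit p hcpt ι ρ
/-- Alias of the stub-3b-rel statement (anchored twist corner, `p ≥ 5`) keyed by the registered stub name. -/
abbrev stub_cornerTwistRel : Prop :=
  ∀ (p : ℕ) [Fact p.Prime], 5 ≤ p → ∀ (k : Type) [Field k] [CharP k p] [IsAlgClosed k]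
    [TopologicalSpace k] [DiscreteTopology k] (red : Valued.integer (PadicAlgCl p) →+* k)
    (σ σ' : FramedGaloisRep ℚ k 2) (hcpt : isCompact_glFiniteIntegralLevel 4 ℚ) (ι : PadicAlgCl p ≃+* ℂ)
    (ρ₀ ρ : FramedGaloisRep ℚ (PadicAlgCl p) 4),
    σ.toGaloisRep.IsIrreducible → σ'.toGaloisRep.IsIrreducible → DetC p k σ σ' →
    (¬ ∃ g : GL (Fin 2) k, ∀ x, g * σ x * g⁻¹ = σ' x) →
    (∃ g : GL (Fin 2) k, ∀ x, ∃ c : k, (g * σ x * g⁻¹).val = c • (σ' x).val) →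
    ρ₀.toGaloisRep.IsIrreducible → Sh p k red σ σ' ρ₀ → Aut p hcpt ι ρ₀ →
    ρ.toGaloisRep.IsIrreducible → Sh p k red σ σ' ρ → IsKlingenClassicalLimit p hcpt ι ρ

end Registered


/-- **R1c-rel is PROVED on CYCLIC fibres** (rev 6; landed `stub_selmerAnchorKlingen_of_cyclic`, p148691, wave-2 worker): if on every
admissible fibre any two non-trivial classes realised by irreducible `Sh`-points are projectively equal (Berger–Klosin's uniqueness
regime `dim = 1`), then the crux's own anchor `ρ₀` realises every such class (Ribet R1a for `ρ₀` + realisation depends only on the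
projective class, p140957) and the anchor stub holds with `ρ₁ := ρ₀`, `c = 1`.  The relative datum `ρ₀` is therefore NOT idle in the
non-split geometry: the anchor is open only OFF the projective class of `[B_{ρ₀}]`. -/
theorem selmerAnchorRel_of_cyclic
    (hcyc : ∀ (p : ℕ) [Fact p.Prime] (k : Type) [Field k] [CharP k p] [IsAlgClosed k]
      [TopologicalSpace k] [DiscreteTopology k] (red : Valued.integer (PadicAlgCl p) →+* k)
      (σ σ' : FramedGaloisRep ℚ k 2),
      ∀ B₁ B₂ : Field.absoluteGaloisGroup ℚ → Matrix (Fin 2) (Fin 2) k,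
      (¬ ∃ X : Matrix (Fin 2) (Fin 2) k, ∀ g, B₁ g = (σ g).val * X - X * (σ' g).val) →
      (¬ ∃ X : Matrix (Fin 2) (Fin 2) k, ∀ g, B₂ g = (σ g).val * X - X * (σ' g).val) →
      (∃ ρ : FramedGaloisRep ℚ (PadicAlgCl p) 4, ρ.toGaloisRep.IsIrreducible ∧ Sh p k red σ σ' ρ ∧
        ∃ (P : GL (Fin 4) (PadicAlgCl p))
          (rint : Field.absoluteGaloisGroup ℚ →* GL (Fin 4) (Valued.integer (PadicAlgCl p))) (h : GL (Fin 4) k),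
          (∀ g, Matrix.GeneralLinearGroup.map (Valued.integer (PadicAlgCl p)).subtype (rint g) = P⁻¹ * ρ g * P) ∧
          (∀ g, (Matrix.GeneralLinearGroup.map red (rint g)).val =
            h.val * Matrix.reindex finSumFinEquiv finSumFinEquiv
              (Matrix.fromBlocks (σ g).val (B₁ g) 0 (σ' g).val) * (h⁻¹).val)) →
      (∃ ρ : FramedGaloisRep ℚ (PadicAlgCl p) 4, ρ.toGaloisRep.IsIrreducible ∧ Sh p k red σ σ' ρ ∧
        ∃ (P : GL (Fin 4) (PadicAlgCl p))
          (rint : Field.absoluteGaloisGroup ℚ →* GL (Fin 4) (Valued.integer (PadicAlgCl p))) (h : GL (Fin 4) k),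
          (∀ g, Matrix.GeneralLinearGroup.map (Valued.integer (PadicAlgCl p)).subtype (rint g) = P⁻¹ * ρ g * P) ∧
          (∀ g, (Matrix.GeneralLinearGroup.map red (rint g)).val =
            h.val * Matrix.reindex finSumFinEquiv finSumFinEquiv
              (Matrix.fromBlocks (σ g).val (B₂ g) 0 (σ' g).val) * (h⁻¹).val)) →
      ∃ (c : kˣ) (X : Matrix (Fin 2) (Fin 2) k), ∀ g, B₂ g = (c : k) • B₁ g + ((σ g).val * X - X * (σ' g).val)) :
    Registered.stub_selmerAnchorRel := by
  intro p _ hp k _ _ _ _ _ red σ σ' hcpt ι B hσ hσ' hdet hnc hG hanch hncB hreal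
  exact stub_selmerAnchorKlingen_of_cyclic p hp k red σ σ' hcpt ι hσ hσ' hnc hanch (hcyc p k red σ σ') B hdet hG hncB hreal

/-- **R1c-rel follows from a UNIFORM rank-one hypothesis** (rev 12; the rev-12 analogue of rev 6's `selmerAnchorRel_of_cyclic`, now with a
hypothesis on Greenberg–Selmer COCYCLES of `(σ̄, σ̄', S)` instead of on realisers): if for every set of places `S` the non-coboundary
Greenberg–Selmer cocycles with ramification inside `S` are pairwise projectively equal modulo coboundaries, the registered anchor stub holds
(K2 with `S :=` the places where the realiser or the anchor ramifies).  The uniform hypothesis is of course far stronger than what K2 needs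
fibrewise; this theorem only records the wiring. [folklore] -/
theorem selmerAnchorRel_of_rankOne
    (hR1 : ∀ (p : ℕ) [Fact p.Prime] (k : Type) [Field k] [TopologicalSpace k] [DiscreteTopology k]
      (σ σ' : FramedGaloisRep ℚ k 2) (S : Set (HeightOneSpectrum (NumberField.RingOfIntegers ℚ))),
      ∀ B₁ B₂ : Field.absoluteGaloisGroup ℚ → Matrix (Fin 2) (Fin 2) k,
      (∀ g g', B₁ (g * g') = (σ g).val * B₁ g' + B₁ g * (σ' g').val) →
      (∀ g g', B₂ (g * g') = (σ g).val * B₂ g' + B₂ g * (σ' g').val) →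
      IsLocallyConstant B₁ → IsLocallyConstant B₂ →
      (∀ v ∉ S, ∀ 𝔓 ∈ v.primesAbove, ∀ i ∈ 𝔓.inertia (Field.absoluteGaloisGroup ℚ), B₁ i = 0 ∧ B₂ i = 0) →
      (∀ v : HeightOneSpectrum (NumberField.RingOfIntegers ℚ), ((p : ℕ) : NumberField.RingOfIntegers ℚ) ∈ v.asIdeal →
        (∃ (X₀ : Matrix (Fin 2) (Fin 2) k) (x₁ y₁ : Fin 2 → k), x₁ ≠ 0 ∧ y₁ ≠ 0 ∧
          (∀ τ ∈ absInertia (v.adicCompletion ℚ),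
            (σ (absGaloisRestrict ℚ (v.adicCompletion ℚ) τ)).val *ᵥ x₁ = x₁) ∧
          (∀ τ ∈ absInertia (v.adicCompletion ℚ),
            (σ' (absGaloisRestrict ℚ (v.adicCompletion ℚ) τ)).val *ᵥ y₁ = y₁) ∧
          ∀ τ ∈ absInertia (v.adicCompletion ℚ),
            (B₁ (absGaloisRestrict ℚ (v.adicCompletion ℚ) τ) -
              ((σ (absGaloisRestrict ℚ (v.adicCompletion ℚ) τ)).val * X₀ -
                X₀ * (σ' (absGaloisRestrict ℚ (v.adicCompletion ℚ) τ)).val)) *ᵥ y₁ = 0) ∧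
        (∃ (X₀ : Matrix (Fin 2) (Fin 2) k) (x₁ y₁ : Fin 2 → k), x₁ ≠ 0 ∧ y₁ ≠ 0 ∧
          (∀ τ ∈ absInertia (v.adicCompletion ℚ),
            (σ (absGaloisRestrict ℚ (v.adicCompletion ℚ) τ)).val *ᵥ x₁ = x₁) ∧
          (∀ τ ∈ absInertia (v.adicCompletion ℚ),
            (σ' (absGaloisRestrict ℚ (v.adicCompletion ℚ) τ)).val *ᵥ y₁ = y₁) ∧
          ∀ τ ∈ absInertia (v.adicCompletion ℚ),
            (B₂ (absGaloisRestrict ℚ (v.adicCompletion ℚ) τ) -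
              ((σ (absGaloisRestrict ℚ (v.adicCompletion ℚ) τ)).val * X₀ -
                X₀ * (σ' (absGaloisRestrict ℚ (v.adicCompletion ℚ) τ)).val)) *ᵥ y₁ = 0)) →
      (¬ ∃ X : Matrix (Fin 2) (Fin 2) k, ∀ g, B₁ g = (σ g).val * X - X * (σ' g).val) →
      (¬ ∃ X : Matrix (Fin 2) (Fin 2) k, ∀ g, B₂ g = (σ g).val * X - X * (σ' g).val) →
      ∃ (c : kˣ) (X : Matrix (Fin 2) (Fin 2) k), ∀ g, B₂ g = (c : k) • B₁ g + ((σ g).val * X - X * (σ' g).val)) :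
    Registered.stub_selmerAnchorRel := by
  intro p _ hp k _ _ _ _ _ red σ σ' hcpt ι B hσ hσ' hdet hnc _hG hanch hncB hreal
  obtain ⟨ρ₀, hρ₀, hSh₀, hA₀⟩ := hanch
  obtain ⟨ρ, _hρ, hSh, hfr⟩ := hreal
  exact stub_selmerAnchorRel_of_rankOne p hp k red σ σ' hcpt ι ρ₀ ρ B
    {v | ¬ (ρ.IsUnramifiedAt v ∧ ρ₀.IsUnramifiedAt v)} hσ hσ' hdet hnc hρ₀ hSh₀ hA₀ hncB hSh hfr
    (fun v hv => by simpa only [Set.mem_setOf_eq, not_not] using hv) (hR1 p k σ σ' _)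

/-- **R1c-rel follows from a UNIFORM rank-one hypothesis on the DECOMPOSITION-GROUP Greenberg–Selmer space** (rev 13; the K2⁺
analogue of `selmerAnchorRel_of_rankOne`): if for every set of places `S` the strong Greenberg–Selmer cocycles (N1⁺ local condition at
`v ∣ p`) with ramification inside `S` that are not coboundaries are pairwise projectively equal modulo coboundaries, the registered
anchor stub holds (`ρ₁ := ρ₀`).  The hypothesis quantifies over a SMALLER space than rev 12's, so this wiring is strictly stronger.
[folklore] -/
theorem selmerAnchorRel_of_rankOneDec
    (hR1 : ∀ (p : ℕ) [Fact p.Prime] (k : Type) [Field k] [TopologicalSpace k] [DiscreteTopology k]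
      (σ σ' : FramedGaloisRep ℚ k 2) (S : Set (HeightOneSpectrum (NumberField.RingOfIntegers ℚ))),
      ∀ B₁ B₂ : Field.absoluteGaloisGroup ℚ → Matrix (Fin 2) (Fin 2) k,
      (∀ g g', B₁ (g * g') = (σ g).val * B₁ g' + B₁ g * (σ' g').val) →
      (∀ g g', B₂ (g * g') = (σ g).val * B₂ g' + B₂ g * (σ' g').val) →
      IsLocallyConstant B₁ → IsLocallyConstant B₂ →
      (∀ v ∉ S, ∀ 𝔓 ∈ v.primesAbove, ∀ i ∈ 𝔓.inertia (Field.absoluteGaloisGroup ℚ), B₁ i = 0 ∧ B₂ i = 0) →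
      (∀ v : HeightOneSpectrum (NumberField.RingOfIntegers ℚ), ((p : ℕ) : NumberField.RingOfIntegers ℚ) ∈ v.asIdeal →
        (∃ (X₀ : Matrix (Fin 2) (Fin 2) k) (x₁ y₁ : Fin 2 → k), x₁ ≠ 0 ∧ y₁ ≠ 0 ∧
          (∀ τ : Field.absoluteGaloisGroup (v.adicCompletion ℚ), ∃ a : k,
            (σ (absGaloisRestrict ℚ (v.adicCompletion ℚ) τ)).val *ᵥ x₁ = a • x₁) ∧
          (∀ τ : Field.absoluteGaloisGroup (v.adicCompletion ℚ), ∃ b : k,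
            (σ' (absGaloisRestrict ℚ (v.adicCompletion ℚ) τ)).val *ᵥ y₁ = b • y₁) ∧
          (∀ τ : Field.absoluteGaloisGroup (v.adicCompletion ℚ), ∃ c : k,
            (B₁ (absGaloisRestrict ℚ (v.adicCompletion ℚ) τ) -
              ((σ (absGaloisRestrict ℚ (v.adicCompletion ℚ) τ)).val * X₀ -
                X₀ * (σ' (absGaloisRestrict ℚ (v.adicCompletion ℚ) τ)).val)) *ᵥ y₁ = c • x₁) ∧
          (∀ τ ∈ absInertia (v.adicCompletion ℚ),
            (σ (absGaloisRestrict ℚ (v.adicCompletion ℚ) τ)).val *ᵥ x₁ = x₁) ∧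
          (∀ τ ∈ absInertia (v.adicCompletion ℚ),
            (σ' (absGaloisRestrict ℚ (v.adicCompletion ℚ) τ)).val *ᵥ y₁ = y₁) ∧
          (∀ τ ∈ absInertia (v.adicCompletion ℚ),
            (B₁ (absGaloisRestrict ℚ (v.adicCompletion ℚ) τ) -
              ((σ (absGaloisRestrict ℚ (v.adicCompletion ℚ) τ)).val * X₀ -
                X₀ * (σ' (absGaloisRestrict ℚ (v.adicCompletion ℚ) τ)).val)) *ᵥ y₁ = 0) ∧
          ∀ τ ∈ absInertia (v.adicCompletion ℚ), ∀ y : Fin 2 → k, ∃ c : k,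
            (B₁ (absGaloisRestrict ℚ (v.adicCompletion ℚ) τ) -
              ((σ (absGaloisRestrict ℚ (v.adicCompletion ℚ) τ)).val * X₀ -
                X₀ * (σ' (absGaloisRestrict ℚ (v.adicCompletion ℚ) τ)).val)) *ᵥ y = c • x₁) ∧
        (∃ (X₀ : Matrix (Fin 2) (Fin 2) k) (x₁ y₁ : Fin 2 → k), x₁ ≠ 0 ∧ y₁ ≠ 0 ∧
          (∀ τ : Field.absoluteGaloisGroup (v.adicCompletion ℚ), ∃ a : k,
            (σ (absGaloisRestrict ℚ (v.adicCompletion ℚ) τ)).val *ᵥ x₁ = a • x₁) ∧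
          (∀ τ : Field.absoluteGaloisGroup (v.adicCompletion ℚ), ∃ b : k,
            (σ' (absGaloisRestrict ℚ (v.adicCompletion ℚ) τ)).val *ᵥ y₁ = b • y₁) ∧
          (∀ τ : Field.absoluteGaloisGroup (v.adicCompletion ℚ), ∃ c : k,
            (B₂ (absGaloisRestrict ℚ (v.adicCompletion ℚ) τ) -
              ((σ (absGaloisRestrict ℚ (v.adicCompletion ℚ) τ)).val * X₀ -
                X₀ * (σ' (absGaloisRestrict ℚ (v.adicCompletion ℚ) τ)).val)) *ᵥ y₁ = c • x₁) ∧
          (∀ τ ∈ absInertia (v.adicCompletion ℚ),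
            (σ (absGaloisRestrict ℚ (v.adicCompletion ℚ) τ)).val *ᵥ x₁ = x₁) ∧
          (∀ τ ∈ absInertia (v.adicCompletion ℚ),
            (σ' (absGaloisRestrict ℚ (v.adicCompletion ℚ) τ)).val *ᵥ y₁ = y₁) ∧
          (∀ τ ∈ absInertia (v.adicCompletion ℚ),
            (B₂ (absGaloisRestrict ℚ (v.adicCompletion ℚ) τ) -
              ((σ (absGaloisRestrict ℚ (v.adicCompletion ℚ) τ)).val * X₀ -
                X₀ * (σ' (absGaloisRestrict ℚ (v.adicCompletion ℚ) τ)).val)) *ᵥ y₁ = 0) ∧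
          ∀ τ ∈ absInertia (v.adicCompletion ℚ), ∀ y : Fin 2 → k, ∃ c : k,
            (B₂ (absGaloisRestrict ℚ (v.adicCompletion ℚ) τ) -
              ((σ (absGaloisRestrict ℚ (v.adicCompletion ℚ) τ)).val * X₀ -
                X₀ * (σ' (absGaloisRestrict ℚ (v.adicCompletion ℚ) τ)).val)) *ᵥ y = c • x₁)) →
      (¬ ∃ X : Matrix (Fin 2) (Fin 2) k, ∀ g, B₁ g = (σ g).val * X - X * (σ' g).val) →
      (¬ ∃ X : Matrix (Fin 2) (Fin 2) k, ∀ g, B₂ g = (σ g).val * X - X * (σ' g).val) →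
      ∃ (c : kˣ) (X : Matrix (Fin 2) (Fin 2) k), ∀ g, B₂ g = (c : k) • B₁ g + ((σ g).val * X - X * (σ' g).val)) :
    Registered.stub_selmerAnchorRel := by
  intro p _ hp k _ _ _ _ _ red σ σ' hcpt ι B hσ hσ' hdet hnc _hG hanch hncB hreal
  obtain ⟨ρ₀, hρ₀, hSh₀, hA₀⟩ := hanch
  obtain ⟨ρ, _hρ, hSh, hfr⟩ := hreal
  exact stub_selmerAnchorRel_of_rankOneDec p hp k red σ σ' hcpt ι ρ₀ ρ B
    {v | ¬ (ρ.IsUnramifiedAt v ∧ ρ₀.IsUnramifiedAt v)} hσ hσ' hdet hnc hρ₀ hSh₀ hA₀ hncB hSh hfr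
    (fun v hv => by simpa only [Set.mem_setOf_eq, not_not] using hv) (hR1 p k σ σ' _)

/-- **On rank-one fibres the PROPAGATION stub alone gives the relative generic child** (rev 16; the rank-one reduction wired to the
registered stub): `Registered.stub_nonsplitPropagationRel` ⇒ for every admissible generic fibre with anchor `ρ₀` and every irreducible
`Sh`-point `ρ` such that the Greenberg–Selmer space with ramification inside `ram(ρ) ∪ ram(ρ₀)` has rank at most one, `ρ` is a Klingen
classical limit — WITHOUT the anchor stub (KV2' supplies the anchor with `ρ₁ := ρ₀`, `c = 1`). [folklore] -/
theorem klim_onRankOne_of_propagation (hPr : Registered.stub_nonsplitPropagationRel) :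
    ∀ (p : ℕ) [Fact p.Prime], p ≠ 2 → ∀ (k : Type) [Field k] [CharP k p] [IsAlgClosed k]
      [TopologicalSpace k] [DiscreteTopology k] (red : Valued.integer (PadicAlgCl p) →+* k)
      (σ σ' : FramedGaloisRep ℚ k 2) (hcpt : isCompact_glFiniteIntegralLevel 4 ℚ) (ι : PadicAlgCl p ≃+* ℂ)
      (ρ₀ ρ : FramedGaloisRep ℚ (PadicAlgCl p) 4),
      σ.toGaloisRep.IsIrreducible → σ'.toGaloisRep.IsIrreducible → DetC p k σ σ' →
      (¬ ∃ g : GL (Fin 2) k, ∀ x, g * σ x * g⁻¹ = σ' x) → GenericSector p k σ σ' →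
      ρ₀.toGaloisRep.IsIrreducible → Sh p k red σ σ' ρ₀ → Aut p hcpt ι ρ₀ →
      ρ.toGaloisRep.IsIrreducible → Sh p k red σ σ' ρ →
      GreenbergSelmerRankLeOne p k σ σ' {v | ¬ (ρ.IsUnramifiedAt v ∧ ρ₀.IsUnramifiedAt v)} →
      IsKlingenClassicalLimit p hcpt ι ρ := by
  intro p _ hp k _ _ _ _ _ red σ σ' hcpt ι ρ₀ ρ hσ hσ' hdet hnc hG hρ₀ hSh₀ hA₀ hρ hSh hrank
  refine Fibre.stub_rankOneReduction p hp k red σ σ' hcpt ι ρ₀ ρ _ ?_ hσ hσ' hdet hnc hρ₀ hSh₀ hA₀ hρ hSh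
    (fun v hv => by simpa only [Set.mem_setOf_eq, not_not] using hv) hrank
  -- non-split relative lifting from the registered propagation stub with the anchor `ρ₀` itself (`c = 1`)
  intro r A hA hr hShr hreal₀ hreal
  have hA' : ¬ ∃ X : Matrix (Fin 2) (Fin 2) k, ∀ g, A g = (σ g).val * X - X * (σ' g).val := fun ⟨X, hX⟩ => hA ⟨X, hX⟩
  obtain ⟨P, rint, h, hP, hred⟩ := hreal
  obtain ⟨P₀, rint₀, h₀, hP₀, hred₀⟩ := hreal₀
  exact hPr p hp k red σ σ' hcpt ι r A hσ hσ' hdet hnc hG ⟨ρ₀, hρ₀, hSh₀, hA₀⟩ hA' hr hShr ⟨P, rint, h, hP, hred⟩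
    ⟨ρ₀, hρ₀, hA₀, ⟨1, by simp, ⟨_, hSh₀.1⟩, fun v hv => hSh₀.2.1 v hv⟩, P₀, rint₀, h₀, hP₀, hred₀⟩

/-! ## Composition (kernel-checked, no sorry outside `stub_*`): the stubs conclude the crux BY NAME -/

/-- **`ResiduallyYoshidaLifting_of`**: (R1a, LANDED and used by name) → R1c-rel → R1d-rel → STUB 2 → STUBS 3a-rel, 3b-rel → the crux,
by name (glue = the RELATIVE split `ResiduallyYoshidaLifting_of_relSubs`, strategist s1, landed by this lead).  Rev 4: the four hypotheses are exactly the four OPEN registered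
stubs; Ribet's R1a enters as the proved theorem `stub_ribetNonsplitLattice` (p142340).  Rev 6: five open registered stubs
(R1c-rel, R1d-rel, KL2, corner-3-rel, corner-twist-rel), the anchored ones weaker than their rev-5 forms; the corner composition consumes
the landed vacuity theorem p146293; exactness: (children) ⟺ (crux ∧ KL2) (`relSubs_iff`). -/
theorem ResiduallyYoshidaLifting_of (hA : Registered.stub_selmerAnchorRel)
    (hPr : Registered.stub_nonsplitPropagationRel) (h₂ : Registered.stub_klingenLimitClassicality)
    (h₃ : Registered.stub_cornerThreeRel) (h₄ : Registered.stub_cornerTwistRel) :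
    Summit.Langlands.Langlands.Theses.PhantomRMYoshida.ResiduallyYoshidaLifting :=
  ResiduallyYoshidaLifting_of_relSubs (relKlingenDensityGeneric_of_R1 stub_ribetNonsplitLattice hA hPr) h₂
    (relKlingenDensityCorner_of_corners h₃ h₄)

/-- Wiring check: the registered stubs feed `ResiduallyYoshidaLifting_of` as stated. -/
example : Summit.Langlands.Langlands.Theses.PhantomRMYoshida.ResiduallyYoshidaLifting :=
  ResiduallyYoshidaLifting_of stub_selmerAnchorRel stub_nonsplitPropagationRel
    stub_klingenLimitClassicality stub_cornerThreeRel stub_cornerTwistRel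

end Summit.Langlands.Langlands.Cruxes.ResiduallyYoshidaLifting.SectorKlingenSplit

end
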